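import Literature.Analysis.FluidPDE.LocalizedDirectionStretching
import Literature.Analysis.FluidPDE.LocalizedHybridDirectionStretching
import Literature.Analysis.FluidPDE.LocalizedCoherenceWeightStretching
import Literature.Analysis.FluidPDE.HeatFlowLocalEnstrophy
import Literature.Analysis.FluidPDE.NSVorticityOfSmoothRepresentative
import Literature.Analysis.FluidPDE.LerayHopf
import HarnessLib

/-!
# The local enstrophy balance of a Leray–Hopf solution on a cylinder of smoothness
# (Grujić 2009, §4: "Control of the localized enstrophy")

Analysis/FluidPDE proof file (theorems only: no definition, no named fact, no `sorry`), third brick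
of the discharge of `Literature.Analysis.FluidPDE.grujic2009_localized_halfHolder_coherence`
(`GrujicLocalizedCoherence.lean`; Z. Grujić, *Localization and geometric depletion of
vortex-stretching in the 3D NSE*, Comm. Math. Phys. **290** (2009) 861–870).

Grujić (§4, p. 865): "Let `u` be a Leray solution … we will assume that `u` is smooth on an open
parabolic cylinder `Q_{2R}(x₀, t₀)` and obtain bounds on the enstrophy localized to `B(x₀, R)`
uniformly in `t` in `(t₀ − R², t₀)`. … multiplying the vorticity equations (2) by `ψ²ω` and
integrating … yields `½∫φ²|ω|²(x, s) dx + ∫∫|∇(ψω)|² ≤ ∫∫(|η||∂ₜη| + |∇ψ|²)|ω|² + |∫∫(u·∇)ω·ψ²ω|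
+ |∫∫(ω·∇)u·ψ²ω| = T₁ + T₂ + T₃`", with `T₁ ≤ c(r)∫∫|ω|²` ((5)), the transport bound
`T₂ ≤ ½∫∫|∇(ψω)|² + c(r)∫∫|ω|²` of [GrZh] §2 ((6)), and the estimate of `T₃` (Thm. 1).

This file proves the **pointwise-in-time** form of this balance for the tree's Leray–Hopf
solutions (`IsLerayHopfOn`), in three steps:

* `IsLerayHopfOn.vorticity_classical_of_contDiffOn` — **the classical vorticity equation on a
  region of smoothness**: if a Leray–Hopf weak solution `u` (viscosity `ν`, no force) is jointly
  `C^∞` on `I × S` (`I ⊆ (0,T)`, `S ⊆ ℝ³` open), then on `I × S` it is divergence free, `u`, `∇u`,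
  `ω = curl u`, `∇ω`, `Δω` are jointly continuous, and `∂ₜω = νΔω − (u·∇)ω + (ω·∇)u` holds as a
  pointwise time derivative (the pressure-free weak formulation tested with curls of test fields,
  `integral_slice_vorticity_identity` and `hasDerivAt_of_integral_identity` of
  `NSVorticityOfSmoothRepresentative.lean`; Lemarié-Rieusset 2016, Thm. 13.1, Step 1);
* the calculus of the weighted slice energy `t ↦ ∫φ²|ω(t)|²` (differentiation under the integral
  sign, continuity of the local norms) and the fixed-time slice inequality: the viscous term by
  `integral_sq_mul_inner_laplacian_le` (`HeatFlowLocalEnstrophy.lean`), the transport term — with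
  the cut-off `φ = θ²`, so that `|∇φ²| ≤ 4B_θ θ³` and `T₂` closes by Cauchy–Schwarz twice, the
  Sobolev inequality for `θ²ω` and Young `(4, 4/3)` (a pointwise-in-time substitute for the
  parabolic interpolation of [GrZh] §2, recorded deviation) — and the stretching term by
  `exists_localized_stretching_le_of_holderHalf` (`LocalizedDirectionStretching.lean`);
* `IsLerayHopfOn.exists_weight_localEnstrophy_deriv_le` /
  `IsLerayHopfOn.exists_localEnstrophy_deriv_le` — **the local enstrophy balance**: under the
  ½-Hölder coherence hypothesis on `B(c, 6s)` for the times of `I`, with `B̄(c, 12s) ⊆ S`, there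
  are a weight `φ` (`0 ≤ φ ≤ 1`, `= 1` on `B(c, s/2)`; continuous and supported in `B̄(c, s)`,
  recorded in the first form), a continuous function `D` on
  `I` and constants `A₀, A₁, B₀, B₁ ≥ 0` with `d/dt ∫φ²|ω(t)|² = D(t)` and
  `D(t) ≤ (A₀ + A₁(Y + F + E)(t)) ∫φ²|ω(t)|² + (B₀ + B₁E(t)²)(Y + F)(t)` for `t ∈ I`, where
  `Y, F, E` are the (continuous) local sizes `∫_{B̄(c,6s)}|ω|², ∫_{B̄(c,6s)}‖∇u‖², ∫_{B̄(c,6s)}|u|²`.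
* `IsLerayHopfOn.exists_weight_localEnstrophy_deriv_le_hybrid` /
  `IsLerayHopfOn.exists_localEnstrophy_deriv_le_hybrid` — the same balance under a local Hölder
  coherence of exponent `α` compensated by a local `L^r` bound on the vorticity (Grujić–Zhang 2006,
  Thm. 1.1: `α = 1/q`, `r = q`), with the extra Grönwall weight `A₂ (∫_{B̄(c,6s)}|ω(t)|^r)^{1/(rθ)}`
  supplied by `exists_localized_stretching_le_of_holderExp_of_vorticity_Lr`
  (`LocalizedHybridDirectionStretching.lean`), and the continuity of `t ↦ ∫_{B̄(c,6s)}|ω(t)|^r`.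
* `IsLerayHopfOn.exists_weight_localEnstrophy_deriv_le_kernel` — the same balance (no extra weight)
  under a measurable weak-`L^{6/5}` kernel dominating the triple product of the vorticity
  directions on the pairs of high-vorticity points of `B(c, 6s)` (Grujić–Zhang 2006, Thm. 1.2),
  supplied by `exists_localized_stretching_le_of_kernel` (`LocalizedHybridDirectionStretching.lean`).
* `IsLerayHopfOn.exists_weight_localEnstrophy_deriv_le_vorticity_Lq` — the same balance with the
  Grönwall weight `A₂ (∫_{B̄(c,6s)}|ω(t)|^q)^{2/(2q−3)}` and NO direction hypothesis
  (Grujić–Guberović 2010, Thm. 1), supplied by `exists_localized_stretching_le_of_vorticity_Lq`.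
* `IsLerayHopfOn.exists_weight_localEnstrophy_deriv_le_holderWeight` — the same balance when the
  Hölder constant of the coherence hypothesis is a time-dependent bounded measurable WEIGHT
  `m(t, y)` on the second point (Grujić–Guberović 2010, Thm. 2: `m = ρ_{γ,2R}`, the `γ`-Hölder
  measure of coherence of the direction), with the Grönwall weight
  `A₂ (∫_{B̄(c,6s)} (m(t)|ω(t)|)^r)^{1/(rθ)}` supplied by
  `exists_localized_stretching_le_of_holderWeight_Lr` (`LocalizedCoherenceWeightStretching.lean`).
The Grönwall/covering step of Grujić's proof (p. 868) is the fourth brick.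

## References

* Z. Grujić, Comm. Math. Phys. 290 (2009) 861–870, §2 (2) (p. 863), §4 pp. 865–866 ((5), (6)),
  Thm. 1 and its proof pp. 866–868. [Grujic2009]
* Z. Grujić, Qi S. Zhang, Comm. Math. Phys. 262 (2006) 555–564, §2 (the localized transport
  bound (6)); Thm. 1.1 and its proof §2 (2.4)–(2.6), §3 (3.2)–(3.10) (the hybrid criterion).
  [GrujicZhang2006]
* Z. Grujić, R. Guberović, Comm. Math. Phys. 298 (2010) 407–418, Thm. 1 (p. 413), Thm. 2 (p. 415)
  and its proof pp. 415–417. [GrujicGuberovic2010]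
* P. G. Lemarié-Rieusset, *The Navier–Stokes Problem in the 21st Century* (2016), Thm. 13.1,
  proof Step 1 (p. 436): the curl of the weak formulation. [LemarieRieusset2016]
-/

noncomputable section

open MeasureTheory TopologicalSpace Set Function Filter Metric Real InnerProductSpace
open _root_.Topology
open scoped ENNReal NNReal RealInnerProductSpace ContDiff Laplacian Pointwise

namespace Literature.Analysis.FluidPDE

-- nested operator types (second derivatives)
set_option maxSynthPendingDepth 3

/-! ### Slices of a jointly smooth field on a product of open sets -/

/-- Iterated partial derivatives in the second variable are restrictions of iterated total
derivatives: for `f` of class `C^∞` on an open `s ⊆ E × F` and `(x, w) ∈ s`, the `j`-th derivative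
of `w' ↦ f (x, w')` at `w` is the `j`-th derivative of `f` at `(x, w)` composed with the inclusions
`inr : F → E × F` in every slot. [folklore] -/
private theorem iteratedFDeriv_slice_eq_compContinuousLinearMap_inr {E F G : Type*}
    [NormedAddCommGroup E] [NormedSpace ℝ E] [NormedAddCommGroup F] [NormedSpace ℝ F]
    [NormedAddCommGroup G] [NormedSpace ℝ G] {f : E × F → G} {s : Set (E × F)}
    (hs : IsOpen s) (hf : ContDiffOn ℝ ∞ f s) {x : E} {w : F} (hx : (x, w) ∈ s) (j : ℕ) :
    iteratedFDeriv ℝ j (fun w' ↦ f (x, w')) w =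
      (iteratedFDeriv ℝ j f (x, w)).compContinuousLinearMap
        fun _ ↦ ContinuousLinearMap.inr ℝ E F := by
  set a : E × F := (x, 0) with ha
  set s' : Set (E × F) := (fun z ↦ z + a) ⁻¹' s with hs'
  set g : E × F → G := fun z ↦ f (z + a) with hg
  have hs'o : IsOpen s' := hs.preimage (continuous_id.add continuous_const)
  have hvadd : a +ᵥ s' = s := by
    ext z
    rw [Set.mem_vadd_set]
    constructor
    · rintro ⟨y, hy, rfl⟩
      have : y + a ∈ s := hy
      rwa [vadd_eq_add, add_comm]
    · intro hz
      refine ⟨z - a, ?_, by rw [vadd_eq_add]; abel⟩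
      show z - a + a ∈ s
      rwa [sub_add_cancel]
  have hgs : ContDiffOn ℝ ∞ g s' := hf.comp (contDiffOn_id.add contDiffOn_const) fun z hz ↦ hz
  have hfun : (fun w' ↦ f (x, w')) = g ∘ ContinuousLinearMap.inr ℝ E F := by
    funext w'; simp [hg, ha]
  have hxs' : ContinuousLinearMap.inr ℝ E F w ∈ s' := by
    show ((0 : E), w) + a ∈ s; simpa [ha] using hx
  have hpre : IsOpen (ContinuousLinearMap.inr ℝ E F ⁻¹' s') :=
    hs'o.preimage (ContinuousLinearMap.inr ℝ E F).continuous
  rw [hfun, ← iteratedFDerivWithin_of_isOpen j hpre hxs',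
    (ContinuousLinearMap.inr ℝ E F).iteratedFDerivWithin_comp_right hgs hs'o.uniqueDiffOn
      hpre.uniqueDiffOn hxs' (by exact_mod_cast le_top)]
  congr 1
  rw [hg, iteratedFDerivWithin_comp_add_right j a, hvadd, iteratedFDerivWithin_of_isOpen j hs]
  · congr 1; simp [ha]
  · simpa [ha] using hx

/-- The spatial Taylor coefficients `(t, x) ↦ D_xⁿ u(t, ·)(x)` of a field jointly `C^∞` on a
product `I × S` of open sets are jointly continuous there. [folklore] -/
private theorem continuousOn_iteratedFDeriv_slice
    {u : ℝ → (EuclideanSpace ℝ (Fin 3)) → (EuclideanSpace ℝ (Fin 3))} {I : Set ℝ}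
    {S : Set (EuclideanSpace ℝ (Fin 3))} (hI : IsOpen I) (hS : IsOpen S)
    (hu : ContDiffOn ℝ ∞ (uncurry u) (I ×ˢ S)) (n : ℕ) :
    ContinuousOn (fun w : ℝ × (EuclideanSpace ℝ (Fin 3)) => iteratedFDeriv ℝ n (u w.1) w.2) (I ×ˢ S) := by
  have hO : IsOpen (I ×ˢ S) := hI.prod hS
  have h1 : ContinuousOn (iteratedFDeriv ℝ n (uncurry u)) (I ×ˢ S) := by
    have h := hu.continuousOn_iteratedFDerivWithin (m := n) (by exact_mod_cast le_top) hO.uniqueDiffOn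
    exact h.congr fun w hw => (iteratedFDerivWithin_of_isOpen n hO hw).symm
  have h2 : ContinuousOn (fun w : ℝ × (EuclideanSpace ℝ (Fin 3)) =>
      ContinuousMultilinearMap.compContinuousLinearMapL
        (fun _ : Fin n => ContinuousLinearMap.inr ℝ ℝ (EuclideanSpace ℝ (Fin 3)))
        (iteratedFDeriv ℝ n (uncurry u) w)) (I ×ˢ S) :=
    (ContinuousMultilinearMap.compContinuousLinearMapL _).continuous.comp_continuousOn h1
  refine h2.congr fun w hw => ?_
  beta_reduce
  rw [ContinuousMultilinearMap.compContinuousLinearMapL_apply]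
  exact iteratedFDeriv_slice_eq_compContinuousLinearMap_inr hO hu (x := w.1) (w := w.2) hw n

/-- The slices `u(t, ·)`, `t ∈ I`, of a field jointly `C^∞` on `I × S` are `C^∞` on `S`.
[folklore] -/
private theorem contDiffOn_slice_of_contDiffOn_prod
    {u : ℝ → (EuclideanSpace ℝ (Fin 3)) → (EuclideanSpace ℝ (Fin 3))} {I : Set ℝ}
    {S : Set (EuclideanSpace ℝ (Fin 3))} (hu : ContDiffOn ℝ ∞ (uncurry u) (I ×ˢ S)) {t : ℝ}
    (ht : t ∈ I) : ContDiffOn ℝ ∞ (u t) S := by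
  have h : ContDiffOn ℝ ∞ (fun x : (EuclideanSpace ℝ (Fin 3)) => ((t, x) : ℝ × (EuclideanSpace ℝ (Fin 3)))) S :=
    contDiffOn_const.prodMk contDiffOn_id
  exact hu.comp h fun x hx => ⟨ht, hx⟩

/-! ### The classical vorticity equation of a Leray–Hopf solution on a cylinder of smoothness -/

/-- **The classical vorticity equation of a Leray–Hopf weak solution on a region of
smoothness.** Let `u` be a Leray–Hopf weak solution of the unforced Navier–Stokes system with
viscosity `ν` on `[0, T)` (`IsLerayHopfOn T ν 0 u₀ u`) and suppose that `u` is jointly `C^∞` on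
`I × S`, `I ⊆ (0, T)` and `S ⊆ ℝ³` open. Then on `I × S`: `div u = 0` pointwise; `u`, `∇u`,
`ω = curl u`, `∇ω`, `Δω` are jointly continuous; and for every `(t, x) ∈ I × S` the time line
`s ↦ ω(s, x)` is differentiable at `t` with
`∂ₜω = νΔω − (u·∇)ω + (ω·∇)u` (Grujić 2009, (2) p. 863 with §4 p. 865: "we will assume that `u`
is smooth on an open parabolic cylinder … multiplying the vorticity equations (2) by `ψ²ω` …";
the derivation of (2) from the weak formulation is Lemarié-Rieusset 2016, proof of Thm. 13.1,
Step 1: "to get rid of the unknown pressure `p`, we take the curl"). Proof: the pressure-free weak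
formulation tested with the curl `∇ ∧ Ψ` of a space–time test field `Ψ` on `I × S` (divergence
free, vanishing at `t = 0`), integrated by parts slicewise (`integral_slice_vorticity_identity`),
gives `∂ₜω = νΔω − (u·∇)ω + (ω·∇)u` in `𝒟'(I × S)`, and `hasDerivAt_of_integral_identity` turns
it into the pointwise derivative; `div u(t) = 0` on `S` holds for a.e. `t` by the weak divergence
condition and for all `t ∈ I` by continuity. [cite: Grujic2009, §2 (2) (p. 863) and §4 (p. 865); LemarieRieusset2016, Thm. 13.1 proof Step 1 (p. 436)] -/
theorem IsLerayHopfOn.vorticity_classical_of_contDiffOn {T ν : ℝ}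
    {u₀ : (EuclideanSpace ℝ (Fin 3)) → (EuclideanSpace ℝ (Fin 3))}
    {u : ℝ → (EuclideanSpace ℝ (Fin 3)) → (EuclideanSpace ℝ (Fin 3))}
    (hLH : IsLerayHopfOn T ν 0 u₀ u) {I : Set ℝ} {S : Set (EuclideanSpace ℝ (Fin 3))}
    (hI : IsOpen I) (hS : IsOpen S) (hIT : I ⊆ Ioo 0 T)
    (hu : ContDiffOn ℝ ∞ (uncurry u) (I ×ˢ S)) :
    (∀ t ∈ I, ∀ x ∈ S, VectorCalculus.divergence (u t) x = 0) ∧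
    ContinuousOn (uncurry u) (I ×ˢ S) ∧
    ContinuousOn (fun w : ℝ × (EuclideanSpace ℝ (Fin 3)) => fderiv ℝ (u w.1) w.2) (I ×ˢ S) ∧
    ContinuousOn (fun w : ℝ × (EuclideanSpace ℝ (Fin 3)) => curl (u w.1) w.2) (I ×ˢ S) ∧
    ContinuousOn (fun w : ℝ × (EuclideanSpace ℝ (Fin 3)) => fderiv ℝ (curl (u w.1)) w.2) (I ×ˢ S) ∧
    ContinuousOn (fun w : ℝ × (EuclideanSpace ℝ (Fin 3)) => Δ (curl (u w.1)) w.2) (I ×ˢ S) ∧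
    (∀ t ∈ I, ∀ x ∈ S, HasDerivAt (fun s => curl (u s) x)
      (ν • Δ (curl (u t)) x - convect (u t) (curl (u t)) x + convect (curl (u t)) (u t) x) t) := by
  set O : Set (ℝ × (EuclideanSpace ℝ (Fin 3))) := I ×ˢ S with hOdef
  have hO : IsOpen O := hI.prod hS
  -- slices and spatial Taylor coefficients
  have hU3 : ∀ t ∈ I, ContDiffOn ℝ 3 (u t) S := fun t ht =>
    contDiffOn_infty.1 (contDiffOn_slice_of_contDiffOn_prod hu ht) 3
  have hU1 : ∀ t ∈ I, ContDiffOn ℝ 1 (u t) S := fun t ht => (hU3 t ht).of_le (by norm_cast)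
  have hΦ : ∀ n ≤ 3, ContinuousOn
      (fun w : ℝ × (EuclideanSpace ℝ (Fin 3)) => iteratedFDeriv ℝ n (u w.1) w.2) O := fun n _ =>
    continuousOn_iteratedFDeriv_slice hI hS hu n
  -- joint continuity of `u`, `Du`, `ω`, `Dω`, `Δω`
  have hU0 : ContinuousOn (uncurry u) O :=
    continuousOn_uncurry_of_continuousOn_iteratedFDeriv_zero (hΦ 0 (by norm_num))
  have hDU : ContinuousOn (fun w : ℝ × (EuclideanSpace ℝ (Fin 3)) => fderiv ℝ (u w.1) w.2) O :=
    continuousOn_fderiv_of_continuousOn_iteratedFDeriv_one (hΦ 1 (by norm_num))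
  have hGn : ∀ n ≤ 2, ContinuousOn
      (fun w : ℝ × (EuclideanSpace ℝ (Fin 3)) => iteratedFDeriv ℝ n (fun y => fderiv ℝ (u w.1) y) w.2) O :=
    fun n hn => continuousOn_iteratedFDeriv_fderiv_of_succ (hΦ (n + 1) (by omega))
  have hGd : ∀ n : ℕ, n ≤ 2 → ∀ w ∈ O, ContDiffAt ℝ n (fun y => fderiv ℝ (u w.1) y) w.2 := by
    intro n hn w hw
    have h3 : ContDiffAt ℝ 3 (u w.1) w.2 := (hU3 w.1 hw.1).contDiffAt (hS.mem_nhds hw.2)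
    have h2 : ContDiffAt ℝ 2 (fderiv ℝ (u w.1)) w.2 := h3.fderiv_right (by norm_cast)
    exact h2.of_le (by exact_mod_cast hn)
  have hωn : ∀ n ≤ 2, ContinuousOn
      (fun w : ℝ × (EuclideanSpace ℝ (Fin 3)) => iteratedFDeriv ℝ n (curl (u w.1)) w.2) O := by
    intro n hn
    have h := continuousOn_iteratedFDeriv_clm_comp (O := O) (H := fun t y => fderiv ℝ (u t) y)
      curlCLM (hGn n hn) (hGd n hn)
    have e : (fun w : ℝ × (EuclideanSpace ℝ (Fin 3)) => iteratedFDeriv ℝ n (curl (u w.1)) w.2) =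
        fun w : ℝ × (EuclideanSpace ℝ (Fin 3)) =>
          iteratedFDeriv ℝ n (fun y => curlCLM (fderiv ℝ (u w.1) y)) w.2 := by
      funext w
      rfl
    rw [e]
    exact h
  have hω0 : ContinuousOn (fun w : ℝ × (EuclideanSpace ℝ (Fin 3)) => curl (u w.1) w.2) O :=
    continuousOn_uncurry_of_continuousOn_iteratedFDeriv_zero (H := fun t y => curl (u t) y)
      (hωn 0 (by norm_num))
  have hDω : ContinuousOn (fun w : ℝ × (EuclideanSpace ℝ (Fin 3)) => fderiv ℝ (curl (u w.1)) w.2) O :=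
    continuousOn_fderiv_of_continuousOn_iteratedFDeriv_one (H := fun t y => curl (u t) y)
      (hωn 1 (by norm_num))
  have hΔω : ContinuousOn (fun w : ℝ × (EuclideanSpace ℝ (Fin 3)) => Δ (curl (u w.1)) w.2) O :=
    continuousOn_laplacian_of_continuousOn_iteratedFDeriv_two (H := fun t y => curl (u t) y)
      (hωn 2 le_rfl)
  -- the right-hand side `g`
  obtain ⟨g, hg⟩ : ∃ g : ℝ → (EuclideanSpace ℝ (Fin 3)) → (EuclideanSpace ℝ (Fin 3)), ∀ t x, g t x =
      ν • Δ (curl (u t)) x - convect (u t) (curl (u t)) x + convect (curl (u t)) (u t) x :=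
    ⟨_, fun _ _ => rfl⟩
  have hgc : ContinuousOn (uncurry g) O := by
    have e : uncurry g = fun w : ℝ × (EuclideanSpace ℝ (Fin 3)) => ν • Δ (curl (u w.1)) w.2 -
        fderiv ℝ (curl (u w.1)) w.2 (u w.1 w.2) + fderiv ℝ (u w.1) w.2 (curl (u w.1) w.2) := by
      funext w
      exact hg w.1 w.2
    rw [e]
    exact ((hΔω.const_smul ν).sub (hDω.clm_apply hU0)).add (hDU.clm_apply hω0)
  -- ### Step A: `div u = 0` on `I × S`
  set d : ℝ × (EuclideanSpace ℝ (Fin 3)) → ℝ := fun w => VectorCalculus.divergence (u w.1) w.2 with hd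
  have hdc : ContinuousOn d O := continuousOn_divergence_of_continuousOn_fderiv hDU
  -- a.e. slice is weakly divergence free, hence divergence free on `S`
  have hgood : ∀ t ∈ I, IsWeaklyDivFree (u t) → ∀ x ∈ S, d (t, x) = 0 := by
    intro t ht hwdf
    have hdt : ContinuousOn (fun x => d (t, x)) S := by
      have hc : ContinuousOn (fun x : (EuclideanSpace ℝ (Fin 3)) => ((t, x) : ℝ × (EuclideanSpace ℝ (Fin 3)))) S :=
        (continuous_const.prodMk continuous_id).continuousOn
      exact hdc.comp hc fun x hx => ⟨ht, hx⟩
    have key : ∀ θ : (EuclideanSpace ℝ (Fin 3)) → ℝ, ContDiff ℝ ∞ θ → HasCompactSupport θ → tsupport θ ⊆ S →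
        ∫ x, θ x * d (t, x) = 0 := by
      intro θ hθ hθc hθS
      have h1 := integral_inner_gradient_eq_neg_of_contDiffOn hS (hU1 t ht)
        (hθ.of_le (by exact_mod_cast le_top)) hθc hθS
      have h0 : ∫ x, ⟪u t x, gradient θ x⟫ = 0 := hwdf θ ⟨hθ, hθc, by simp⟩
      rw [h0] at h1
      have h2 : ∫ x, θ x * VectorCalculus.divergence (u t) x = 0 := by linarith
      exact h2
    have hae : ∀ᵐ x ∂(volume : Measure (EuclideanSpace ℝ (Fin 3))), x ∈ S → d (t, x) = 0 := by
      refine hS.ae_eq_zero_of_integral_contDiff_smul_eq_zero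
        (hdt.locallyIntegrableOn hS.measurableSet) fun θ hθ hθc hθS => ?_
      simp only [smul_eq_mul]
      exact key θ hθ hθc hθS
    have hEq : EqOn (fun x => d (t, x)) 0 S :=
      Measure.eqOn_open_of_ae_eq ((ae_restrict_iff' hS.measurableSet).2 hae) hS hdt
        continuousOn_const
    exact fun x hx => hEq hx
  have hdiv : ∀ w ∈ O, d w = 0 := by
    rintro ⟨t, x⟩ ⟨ht, hx⟩
    by_contra hne
    -- `s ↦ d (s, x)` is continuous at `t`, so `d (s, x) ≠ 0` for `s` near `t`
    have hct : ContinuousAt (fun s => d (s, x)) t := by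
      have hc : Continuous (fun s : ℝ => ((s, x) : ℝ × (EuclideanSpace ℝ (Fin 3)))) :=
        continuous_id.prodMk continuous_const
      have e : (fun s => d (s, x)) = d ∘ fun s : ℝ => ((s, x) : ℝ × (EuclideanSpace ℝ (Fin 3))) := rfl
      rw [e]
      exact ContinuousAt.comp (hdc.continuousAt (hO.mem_nhds ⟨ht, hx⟩)) hc.continuousAt
    have hev : ∀ᶠ s in 𝓝 t, d (s, x) ≠ 0 ∧ s ∈ I := (hct.eventually_ne hne).and (hI.mem_nhds ht)
    obtain ⟨ε, hε, hball⟩ := Metric.eventually_nhds_iff_ball.1 hev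
    -- `ball t ε ⊆ I ⊆ (0, T)` has positive measure: it contains a weakly divergence-free time
    have hsub : ball t ε ⊆ Ioo 0 T := fun s hs => hIT (hball s hs).2
    have hae' : ∀ᵐ s ∂((volume : Measure ℝ).restrict (ball t ε)), IsWeaklyDivFree (u s) :=
      ae_restrict_of_ae_restrict_of_subset hsub hLH.weak.2.2.1
    have hmem : ∀ᵐ s ∂((volume : Measure ℝ).restrict (ball t ε)), s ∈ ball t ε :=
      ae_restrict_mem measurableSet_ball
    haveI : (ae ((volume : Measure ℝ).restrict (ball t ε))).NeBot := by
      rw [ae_neBot, Ne, Measure.restrict_eq_zero]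
      exact (measure_ball_pos volume t hε).ne'
    obtain ⟨s, hs1, hs2⟩ := (hae'.and hmem).exists
    exact (hball s hs2).1 (hgood s (hball s hs2).2 hs1 x hx)
  -- ### Step B: the distributional vorticity identity from the pressure-free weak formulation
  have hOT : ∀ z ∈ O, z ∈ (slab (EuclideanSpace ℝ (Fin 3)) (Iio T) isOpen_Iio : Set (ℝ × (EuclideanSpace ℝ (Fin 3)))) :=
    fun z hz => mem_slab.2 (hIT hz.1).2
  have h0I : (0 : ℝ) ∉ I := fun h => lt_irrefl _ (hIT h).1
  have hid : ∀ Ψ : ℝ → (EuclideanSpace ℝ (Fin 3)) → (EuclideanSpace ℝ (Fin 3)), IsSpaceTimeTestOn ⟨O, hO⟩ Ψ →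
      ∫ t, ∫ x, (⟪curl (u t) x, timeDeriv Ψ t x⟫ + ⟪g t x, Ψ t x⟫) = 0 := by
    intro Ψ hΨ
    have hΨO : tsupport (uncurry Ψ) ⊆ O := hΨ.tsupport_subset
    -- the curl test field, a divergence-free test field on the slab `(-∞, T) × ℝ³`
    set ψ : ℝ → (EuclideanSpace ℝ (Fin 3)) → (EuclideanSpace ℝ (Fin 3)) := fun t x => curl (Ψ t) x with hψdef
    have hψ : IsSpaceTimeTestOn ⟨O, hO⟩ ψ := hΨ.curl_slice
    have hψO : tsupport (uncurry ψ) ⊆ O := hψ.tsupport_subset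
    have hψΨ : tsupport (uncurry ψ) ⊆ tsupport (uncurry Ψ) := tsupport_uncurry_curl_slice_subset Ψ
    have hψ' : IsSpaceTimeTestOn (slab (EuclideanSpace ℝ (Fin 3)) (Iio T) isOpen_Iio) ψ :=
      hψ.mono fun z hz => hOT z hz
    have hdivψ : ∀ t, VectorCalculus.IsDivFree (ψ t) := fun t x =>
      divergence_curl_eq_zero_holds (Ψ t) (contDiff_infty.1 (hΨ.contDiff_slice t) 2) x
    have hmom := hLH.weak.2.2.2 ψ hψ' hdivψ
    -- the datum term vanishes: `ψ 0 = 0`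
    have hψ0 : ∀ x, ψ 0 x = 0 := fun x => slice_eq_zero_of_notMem_time hψO h0I x
    simp only [hψ0, inner_zero_right, integral_zero, add_zero, Pi.zero_apply, inner_zero_left] at hmom
    -- the integrand
    set G : ℝ → (EuclideanSpace ℝ (Fin 3)) → ℝ := fun t x => ⟪u t x, timeDeriv ψ t x⟫ +
      ⟪u t x, convect (u t) (ψ t) x⟫ + ν * ⟪u t x, Δ (ψ t) x⟫ with hGdef
    change ∫ t in Ioo 0 T, ∫ x, G t x = 0 at hmom
    -- off `I` the slices of the integrand vanish
    have hG0 : ∀ t ∉ I, ∀ x, G t x = 0 := by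
      intro t ht x
      have hz : (t, x) ∉ tsupport (uncurry ψ) := fun h => ht (hψO h).1
      simp only [hGdef, convect, IsSpaceTimeTestOn.timeDeriv_eq_zero_of_notMem hz,
        IsSpaceTimeTestOn.fderiv_slice_eq_zero_of_notMem hz,
        laplacian_eq_zero_of_notMem_tsupport (notMem_tsupport_slice_of_notMem hz),
        inner_zero_right, _root_.zero_apply, mul_zero, add_zero]
    have hmom' : ∫ t, ∫ x, G t x = 0 := by
      rw [← setIntegral_eq_integral_of_forall_compl_eq_zero (s := Ioo 0 T) fun t ht => ?_]
      · exact hmom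
      · have htI : t ∉ I := fun h => ht (hIT h)
        simp only [hG0 t htI, integral_zero]
    -- the slice identity
    have hslice : ∀ t, ∫ x, G t x = ∫ x, (⟪curl (u t) x, timeDeriv Ψ t x⟫ + ⟪g t x, Ψ t x⟫) := by
      intro t
      by_cases ht : t ∈ I
      · have hΨt : ContDiff ℝ 3 (Ψ t) := contDiff_infty.1 (hΨ.contDiff_slice t) 3
        have hcΨt : HasCompactSupport (Ψ t) := hΨ.hasCompactSupport_slice t
        have hΨtS : tsupport (Ψ t) ⊆ S := slice_tsupport_subset_of_tsupport_uncurry_subset_prod hΨO t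
        have hdΨ := (hΨ.mono le_top).timeDeriv_top
        have hΨ₁ : ContDiff ℝ 1 (timeDeriv Ψ t) := contDiff_infty.1 (hdΨ.contDiff_slice t) 1
        have hcΨ₁ : HasCompactSupport (timeDeriv Ψ t) := hdΨ.hasCompactSupport_slice t
        have hΨ₁S : tsupport (timeDeriv Ψ t) ⊆ S :=
          slice_tsupport_subset_of_tsupport_uncurry_subset_prod
            ((tsupport_uncurry_timeDeriv_subset_tsupport Ψ).trans hΨO) t
        have key := integral_slice_vorticity_identity hS (hU3 t ht) (fun x hx => hdiv (t, x) ⟨ht, hx⟩)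
          hΨt hcΨt hΨtS hΨ₁ hcΨ₁ hΨ₁S ν
        have eL : ∀ x, G t x = ⟪u t x, curl (timeDeriv Ψ t) x⟫ +
            ⟪u t x, convect (u t) (curl (Ψ t)) x⟫ + ν * ⟪u t x, Δ (curl (Ψ t)) x⟫ := by
          intro x
          simp only [hGdef, hψdef, hΨ.timeDeriv_curl_slice t x]
        have eR : ∀ x, ⟪curl (u t) x, timeDeriv Ψ t x⟫ + ⟪g t x, Ψ t x⟫ =
            ⟪curl (u t) x, timeDeriv Ψ t x⟫ + ⟪ν • Δ (curl (u t)) x - convect (u t) (curl (u t)) x +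
              convect (curl (u t)) (u t) x, Ψ t x⟫ := by
          intro x
          rw [hg t x]
        simp_rw [eL, eR]
        exact key
      · have h0 : ∀ x, (t, x) ∉ tsupport (uncurry Ψ) := fun x h => ht (hΨO h).1
        have eL : ∀ x, G t x = 0 := fun x => hG0 t ht x
        have eR : ∀ x, ⟪curl (u t) x, timeDeriv Ψ t x⟫ + ⟪g t x, Ψ t x⟫ = 0 := by
          intro x
          rw [IsSpaceTimeTestOn.timeDeriv_eq_zero_of_notMem (h0 x),
            show Ψ t x = uncurry Ψ (t, x) from rfl, image_eq_zero_of_notMem_tsupport (h0 x),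
            inner_zero_right, inner_zero_right, add_zero]
        simp_rw [eL, eR]
    simp_rw [hslice] at hmom'
    exact hmom'
  -- ### Step C: the pointwise time derivative
  have hω0' : ContinuousOn (uncurry fun t x => curl (u t) x) O := hω0
  have hderiv : ∀ t ∈ I, ∀ x ∈ S, HasDerivAt (fun s => curl (u s) x) (g t x) t :=
    fun t ht x hx => hasDerivAt_of_integral_identity hI hS hω0' hgc hid ht hx
  refine ⟨fun t ht x hx => hdiv (t, x) ⟨ht, hx⟩, hU0, hDU, hω0, hDω, hΔω, fun t ht x hx => ?_⟩
  rw [← hg t x]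
  exact hderiv t ht x hx
/-! ### Weighted slice integrals: continuity and differentiation in time -/

/-- `x ↦ φ(x)² h(x)` is continuous on the whole space when `h` is continuous on an open set
containing the support of the continuous weight `φ`. [folklore] -/
private theorem continuous_sq_mul_of_continuousOn {φ h : (EuclideanSpace ℝ (Fin 3)) → ℝ}
    {S : Set (EuclideanSpace ℝ (Fin 3))} (hS : IsOpen S) (hφ : Continuous φ) (hφS : tsupport φ ⊆ S)
    (hh : ContinuousOn h S) : Continuous fun x => φ x ^ 2 * h x := by
  refine continuous_iff_continuousAt.2 fun x => ?_
  by_cases hx : x ∈ S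
  · exact (hφ.continuousAt.pow 2).mul (hh.continuousAt (hS.mem_nhds hx))
  · have hφ0 : φ =ᶠ[𝓝 x] 0 := notMem_tsupport_iff_eventuallyEq.1 fun h => hx (hφS h)
    have hev : (fun _ => (0 : ℝ)) =ᶠ[𝓝 x] fun y => φ y ^ 2 * h y := by
      filter_upwards [hφ0] with y hy
      rw [hy, Pi.zero_apply]; ring
    exact continuousAt_const.congr hev

/-- **Differentiation of the weighted slice energy under the integral sign.** Let `w, g` be
jointly continuous on `I × S` (`I`, `S` open) with `∂ₜw(t, x) = g(t, x)` there, and let `φ` be a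
continuous weight with compact support inside `S`. Then for `t ∈ I`,
`d/dt ∫ φ²|w(t)|² = ∫ 2φ²⟪w(t), g(t)⟫` (dominated differentiation, the derivative being bounded
on a compact time-neighbourhood times the support). [folklore] -/
private theorem hasDerivAt_integral_sq_mul_norm_sq {I : Set ℝ} {S : Set (EuclideanSpace ℝ (Fin 3))}
    (hI : IsOpen I) (hS : IsOpen S)
    {w g : ℝ → (EuclideanSpace ℝ (Fin 3)) → (EuclideanSpace ℝ (Fin 3))}
    (hw : ContinuousOn (uncurry w) (I ×ˢ S)) (hg : ContinuousOn (uncurry g) (I ×ˢ S))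
    (hwg : ∀ t ∈ I, ∀ x ∈ S, HasDerivAt (fun s => w s x) (g t x) t)
    {φ : (EuclideanSpace ℝ (Fin 3)) → ℝ} (hφ : Continuous φ) (hφc : HasCompactSupport φ)
    (hφS : tsupport φ ⊆ S) {t : ℝ} (ht : t ∈ I) :
    HasDerivAt (fun s => ∫ x, φ x ^ 2 * ‖w s x‖ ^ 2)
      (∫ x, 2 * (φ x ^ 2 * ⟪w t x, g t x⟫)) t := by
  have hO : IsOpen (I ×ˢ S) := hI.prod hS
  -- a compact time-neighbourhood `J = [t - δ/2, t + δ/2] ⊆ I`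
  obtain ⟨δ, hδ, hball⟩ := Metric.isOpen_iff.1 hI t ht
  set J : Set ℝ := Icc (t - δ / 2) (t + δ / 2) with hJ
  have hJI : J ⊆ I := fun s hs => hball <| by
    rw [Metric.mem_ball, Real.dist_eq, abs_lt]
    constructor <;> linarith [hs.1, hs.2]
  have hJn : J ∈ 𝓝 t := Icc_mem_nhds (by linarith) (by linarith)
  -- slices through `x`
  have hsl : ∀ s ∈ I, ContinuousOn (fun x => w s x) S := fun s hs => by
    have hc : Continuous (fun x : (EuclideanSpace ℝ (Fin 3)) => ((s, x) : ℝ × (EuclideanSpace ℝ (Fin 3)))) :=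
      continuous_const.prodMk continuous_id
    exact hw.comp hc.continuousOn fun x hx => ⟨hs, hx⟩
  have hsl' : ∀ s ∈ I, ContinuousOn (fun x => g s x) S := fun s hs => by
    have hc : Continuous (fun x : (EuclideanSpace ℝ (Fin 3)) => ((s, x) : ℝ × (EuclideanSpace ℝ (Fin 3)))) :=
      continuous_const.prodMk continuous_id
    exact hg.comp hc.continuousOn fun x hx => ⟨hs, hx⟩
  have hFc : ∀ s ∈ I, Continuous fun x => φ x ^ 2 * ‖w s x‖ ^ 2 := fun s hs =>
    continuous_sq_mul_of_continuousOn hS hφ hφS ((hsl s hs).norm.pow 2)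
  have hF'c : ∀ s ∈ I, Continuous fun x => 2 * (φ x ^ 2 * ⟪w s x, g s x⟫) := fun s hs =>
    continuous_const.mul (continuous_sq_mul_of_continuousOn hS hφ hφS ((hsl s hs).inner (hsl' s hs)))
  -- joint continuity of the derivative field on `I × S` and a bound on `J × tsupport φ`
  have hjoint : ContinuousOn (fun p : ℝ × (EuclideanSpace ℝ (Fin 3)) => 2 * (φ p.2 ^ 2 * ⟪w p.1 p.2, g p.1 p.2⟫))
      (I ×ˢ S) :=
    continuousOn_const.mul ((((hφ.comp continuous_snd).continuousOn).pow 2).mul (hw.inner hg))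
  obtain ⟨M, hM⟩ := (isCompact_Icc.prod hφc).exists_bound_of_continuousOn
    (hjoint.mono (prod_mono hJI hφS))
  -- off the support everything vanishes
  have hφ0 : ∀ x ∉ tsupport φ, φ x = 0 := fun x hx => image_eq_zero_of_notMem_tsupport hx
  have key := hasDerivAt_integral_of_dominated_loc_of_deriv_le
    (μ := (volume : Measure (EuclideanSpace ℝ (Fin 3))))
    (F := fun s x => φ x ^ 2 * ‖w s x‖ ^ 2) (F' := fun s x => 2 * (φ x ^ 2 * ⟪w s x, g s x⟫))
    (x₀ := t) (bound := (tsupport φ).indicator fun _ => M) hJn ?_ ?_ ?_ ?_ ?_ ?_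
  · exact key.2
  · filter_upwards [hI.mem_nhds ht] with s hs using (hFc s hs).aestronglyMeasurable
  · refine (hFc t ht).integrable_of_hasCompactSupport (hφc.mono fun x hx => ?_)
    rw [mem_support] at hx ⊢
    intro h; exact hx (by rw [h]; ring)
  · exact (hF'c t ht).aestronglyMeasurable
  · refine Eventually.of_forall fun x s hs => ?_
    by_cases hx : x ∈ tsupport φ
    · rw [indicator_of_mem hx]
      exact hM (s, x) (mk_mem_prod hs hx)
    · rw [indicator_of_notMem hx, hφ0 x hx]
      simp
  · exact (integrableOn_const (hφc.measure_lt_top (μ := volume)).ne).integrable_indicator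
      (isClosed_tsupport φ).measurableSet
  · refine Eventually.of_forall fun x s hs => ?_
    by_cases hxS : x ∈ S
    · have h := ((hwg s (hJI hs) x hxS).norm_sq).const_mul (φ x ^ 2)
      have e : φ x ^ 2 * (2 * ⟪w s x, g s x⟫) = 2 * (φ x ^ 2 * ⟪w s x, g s x⟫) := by ring
      rw [e] at h
      exact h
    · have hx0 : φ x = 0 := hφ0 x fun h => hxS (hφS h)
      have e1 : (fun s => φ x ^ 2 * ‖w s x‖ ^ 2) = fun _ => (0 : ℝ) := by
        funext s; rw [hx0]; ring
      have e2 : 2 * (φ x ^ 2 * ⟪w s x, g s x⟫) = 0 := by rw [hx0]; ring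
      rw [e1, e2]
      exact hasDerivAt_const s 0

/-- Continuity in time of a weighted slice integral `t ↦ ∫ φ² H(t, x) dx` for `H` jointly
continuous on `I × S` and a continuous weight `φ` compactly supported inside `S`. [folklore] -/
private theorem continuousOn_integral_sq_mul {I : Set ℝ} {S : Set (EuclideanSpace ℝ (Fin 3))}
    (hI : IsOpen I) (hS : IsOpen S) {H : ℝ → (EuclideanSpace ℝ (Fin 3)) → ℝ}
    (hH : ContinuousOn (uncurry H) (I ×ˢ S)) {φ : (EuclideanSpace ℝ (Fin 3)) → ℝ} (hφ : Continuous φ)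
    (hφc : HasCompactSupport φ) (hφS : tsupport φ ⊆ S) :
    ContinuousOn (fun t => ∫ x, φ x ^ 2 * H t x) I := by
  refine continuousOn_integral_of_continuousOn_prod (μ := (volume : Measure (EuclideanSpace ℝ (Fin 3))))
    hI hS hφc hφS (Λ := fun t x => φ x ^ 2 * H t x) ?_ fun t _ x hx => ?_
  · exact (((hφ.comp continuous_snd).continuousOn).pow 2).mul hH
  · rw [image_eq_zero_of_notMem_tsupport hx]; ring

/-- Continuity in time of a local slice norm `t ↦ ∫_{B̄(c,r)} H(t, x) dx` for `H` jointly
continuous on `I × S`, `B̄(c, 2r) ⊆ S` (insert a cut-off `≡ 1` on the ball). [folklore] -/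
private theorem continuousOn_setIntegral_closedBall {I : Set ℝ} {S : Set (EuclideanSpace ℝ (Fin 3))}
    (hI : IsOpen I) (hS : IsOpen S) {H : ℝ → (EuclideanSpace ℝ (Fin 3)) → ℝ}
    (hH : ContinuousOn (uncurry H) (I ×ˢ S)) {c : (EuclideanSpace ℝ (Fin 3))} {r : ℝ} (hr : 0 < r)
    (hcS : closedBall c (2 * r) ⊆ S) :
    ContinuousOn (fun t => ∫ x in closedBall c r, H t x) I := by
  -- the cut-off `χ = ballCutoff c (3r/5)`: `≡ 1` on `B(c, 6r/5) ⊇ B̄(c, r)`, supported in `B̄(c, 9r/5)`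
  set r' : ℝ := 3 * r / 5 with hr'
  have hr'0 : 0 < r' := by positivity
  set χ : (EuclideanSpace ℝ (Fin 3)) → ℝ := ballCutoff c r' with hχ
  have hχc : Continuous χ := (contDiff_ballCutoff c r' (n := 0)).continuous
  have hχ1 : ∀ x ∈ closedBall c r, χ x = 1 := fun x hx => by
    have hx' : x ∈ ball c (2 * r') := by
      rw [mem_closedBall] at hx; rw [mem_ball]; linarith
    exact (ballCutoff_eventuallyEq_one hr'0 hx').eq_of_nhds
  have hχ0 : ∀ x ∉ closedBall c (2 * r), χ x = 0 := fun x hx => by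
    rw [mem_closedBall, dist_eq_norm, not_le] at hx
    exact ballCutoff_eq_zero hr'0 (by linarith)
  have hχsupp : tsupport χ ⊆ closedBall c (2 * r) := by
    refine closure_minimal (fun x hx => ?_) isClosed_closedBall
    by_contra h
    exact hx (hχ0 x h)
  have hχK : IsCompact (tsupport χ) := (isCompact_closedBall c (2 * r)).of_isClosed_subset
    (isClosed_tsupport χ) hχsupp
  haveI : IsFiniteMeasure ((volume : Measure (EuclideanSpace ℝ (Fin 3))).restrict (closedBall c r)) :=
    isFiniteMeasure_restrict.2 (measure_closedBall_lt_top).ne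
  have h := continuousOn_integral_of_continuousOn_prod
    (μ := (volume : Measure (EuclideanSpace ℝ (Fin 3))).restrict (closedBall c r))
    hI hS hχK (hχsupp.trans hcS) (Λ := fun t x => χ x * H t x)
    (((hχc.comp continuous_snd).continuousOn).mul hH) fun t _ x hx => by
      rw [image_eq_zero_of_notMem_tsupport hx, zero_mul]
  refine h.congr fun t _ => ?_
  exact setIntegral_congr_fun measurableSet_closedBall fun x hx => by rw [hχ1 x hx, one_mul]
/-! ### Slice inequalities (fixed time) -/

/-- `φ² g` is integrable for continuous `φ, g` with `φ` compactly supported. [folklore] -/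
private theorem integrable_sq_mul_of_hasCompactSupport' {φ : (EuclideanSpace ℝ (Fin 3)) → ℝ}
    (hφ : Continuous φ) (hφc : HasCompactSupport φ) {g : (EuclideanSpace ℝ (Fin 3)) → ℝ}
    (hg : Continuous g) : Integrable fun x => φ x ^ 2 * g x := by
  have hc : HasCompactSupport (fun x => φ x ^ 2 * g x) := by
    refine hφc.mono fun x hx => ?_
    rw [mem_support] at hx ⊢
    intro h
    exact hx (by rw [h]; ring)
  exact ((hφ.pow 2).mul hg).integrable_of_hasCompactSupport hc

/-- Young's inequality with exponents `(4, 4/3)` in polynomial form: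
`2 a t³ ≤ ε t⁴ + 27 a⁴/(16 ε³)` for `a, t ≥ 0`, `ε > 0`. [folklore] -/
private theorem two_mul_mul_cube_le_young {ε a t : ℝ} (hε : 0 < ε) (ha : 0 ≤ a) (ht : 0 ≤ t) :
    2 * a * t ^ 3 ≤ ε * t ^ 4 + 27 * a ^ 4 / (16 * ε ^ 3) := by
  set u : ℝ := a / (2 * ε) with hu
  have hu0 : 0 ≤ u := by positivity
  have hpoly : 4 * u * t ^ 3 ≤ t ^ 4 + 27 * u ^ 4 := by
    have h : 0 ≤ (t - 3 * u) ^ 2 * (t ^ 2 + 2 * u * t + 3 * u ^ 2) := by positivity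
    have hexp : (t - 3 * u) ^ 2 * (t ^ 2 + 2 * u * t + 3 * u ^ 2) =
        t ^ 4 + 27 * u ^ 4 - 4 * u * t ^ 3 := by ring
    rw [hexp] at h
    linarith
  have ha' : a = 2 * ε * u := by rw [hu]; field_simp
  have h1 : 2 * a * t ^ 3 = ε * (4 * u * t ^ 3) := by rw [ha']; ring
  have h2 : 27 * a ^ 4 / (16 * ε ^ 3) = ε * (27 * u ^ 4) := by
    rw [ha']; field_simp; ring
  rw [h1, h2, ← mul_add]
  exact mul_le_mul_of_nonneg_left hpoly hε.le

/-- Cauchy–Schwarz on a closed ball for continuous nonnegative functions: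
`∫_B f g ≤ √(∫_B f²) √(∫_B g²)`. [folklore] -/
private theorem setIntegral_mul_le_sqrt_mul_sqrt_closedBall {f g : (EuclideanSpace ℝ (Fin 3)) → ℝ}
    (hf : Continuous f) (hg : Continuous g) (hf0 : ∀ x, 0 ≤ f x) (hg0 : ∀ x, 0 ≤ g x)
    (c : (EuclideanSpace ℝ (Fin 3))) (r : ℝ) :
    ∫ x in closedBall c r, f x * g x ≤
      Real.sqrt (∫ x in closedBall c r, f x ^ 2) * Real.sqrt (∫ x in closedBall c r, g x ^ 2) := by
  set μ : Measure (EuclideanSpace ℝ (Fin 3)) :=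
    (volume : Measure (EuclideanSpace ℝ (Fin 3))).restrict (closedBall c r) with hμ
  haveI : IsFiniteMeasure μ := isFiniteMeasure_restrict.2 (measure_closedBall_lt_top).ne
  have hbd : ∀ {h : (EuclideanSpace ℝ (Fin 3)) → ℝ}, Continuous h → MemLp h (ENNReal.ofReal 2) μ := by
    intro h hh
    obtain ⟨M, hM⟩ := (isCompact_closedBall c r).exists_bound_of_continuousOn hh.continuousOn
    have hb : ∀ᵐ x ∂μ, h x ∈ Icc (-M) M := by
      refine ae_restrict_of_forall_mem measurableSet_closedBall fun x hx => ?_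
      have hx' := hM x hx
      rw [Real.norm_eq_abs] at hx'
      exact ⟨by linarith [neg_abs_le (h x)], (le_abs_self _).trans hx'⟩
    exact memLp_of_bounded hb hh.aestronglyMeasurable _
  have hcs := integral_mul_le_Lp_mul_Lq_of_nonneg (μ := μ) Real.HolderConjugate.two_two
    (ae_of_all _ hf0) (ae_of_all _ hg0) (hbd hf) (hbd hg)
  have e1 : ∫ a, f a ^ (2 : ℝ) ∂μ = ∫ x in closedBall c r, f x ^ 2 := by
    rw [hμ]; exact integral_congr_ae (Eventually.of_forall fun x => by simp only [Real.rpow_two])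
  have e2 : ∫ a, g a ^ (2 : ℝ) ∂μ = ∫ x in closedBall c r, g x ^ 2 := by
    rw [hμ]; exact integral_congr_ae (Eventually.of_forall fun x => by simp only [Real.rpow_two])
  rw [e1, e2] at hcs
  rw [Real.sqrt_eq_rpow, Real.sqrt_eq_rpow]
  exact hcs

/-- The real form of the Sobolev inequality `‖W‖₆ ≤ K₀‖∇W‖₂` for a compactly supported `C¹`
field: `∫|W|⁶ ≤ ((K₀ + 1)√(∫‖∇W‖²))⁶`. [folklore] -/
private theorem integral_norm_pow_six_le_sobolev
    {W : (EuclideanSpace ℝ (Fin 3)) → (EuclideanSpace ℝ (Fin 3))} (hW : ContDiff ℝ 1 W)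
    (hWc : HasCompactSupport W) :
    ∫ x, ‖W x‖ ^ 6 ≤
      ((((SNormLESNormFDerivOfEqConst (EuclideanSpace ℝ (Fin 3))
          (volume : Measure (EuclideanSpace ℝ (Fin 3))) 2 : ℝ≥0) : ℝ) + 1) *
        Real.sqrt (∫ x, ‖fderiv ℝ W x‖ ^ 2)) ^ 6 := by
  set K₀ : ℝ≥0 := SNormLESNormFDerivOfEqConst (EuclideanSpace ℝ (Fin 3))
    (volume : Measure (EuclideanSpace ℝ (Fin 3))) 2 with hK₀
  set K : ℝ := (K₀ : ℝ) + 1 with hK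
  have hK0 : 0 < K := by rw [hK]; positivity
  have hWcont : Continuous W := hW.continuous
  have hDWc : Continuous (fderiv ℝ W) := hW.continuous_fderiv one_ne_zero
  have hDWcs : HasCompactSupport (fderiv ℝ W) := hWc.fderiv (𝕜 := ℝ)
  have IW6 : Integrable fun x => ‖W x‖ ^ 6 :=
    (hWcont.norm.pow 6).integrable_of_hasCompactSupport
      (HasCompactSupport.intro hWc fun x hx => by
        simp [image_eq_zero_of_notMem_tsupport hx])
  have IDW2 : Integrable fun x => ‖fderiv ℝ W x‖ ^ 2 :=
    (hDWc.norm.pow 2).integrable_of_hasCompactSupport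
      (HasCompactSupport.intro hDWcs fun x hx => by
        simp [image_eq_zero_of_notMem_tsupport hx])
  set sD : ℝ := Real.sqrt (∫ x, ‖fderiv ℝ W x‖ ^ 2) with hsD
  have hsD0 : 0 ≤ sD := Real.sqrt_nonneg _
  have hWm2 : MemLp W 2 volume := (hWcont.memLp_of_hasCompactSupport (μ := volume) hWc)
  have hDWm2 : MemLp (fderiv ℝ W) 2 volume :=
    (memLp_two_iff_integrable_sq_norm hDWc.aestronglyMeasurable).2 IDW2
  have hDW2' : (eLpNorm (fderiv ℝ W) 2 volume).toReal = sD := by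
    rw [toReal_eLpNorm_two_eq_sqrt hDWc IDW2, hsD]
  have hsob := eLpNorm_six_le_eLpNorm_fderiv_two (volume : Measure (EuclideanSpace ℝ (Fin 3)))
    (F := (EuclideanSpace ℝ (Fin 3))) finrank_euclideanSpace_fin hW hWm2.eLpNorm_lt_top
  have hDW_eq : eLpNorm (fderiv ℝ W) 2 volume = ENNReal.ofReal sD := by
    rw [← hDW2', ENNReal.ofReal_toReal hDWm2.eLpNorm_lt_top.ne]
  have hK₀K : (K₀ : ℝ≥0∞) ≤ ENNReal.ofReal K := by
    rw [hK, show ((K₀ : ℝ) + 1 : ℝ) = ((K₀ + 1 : ℝ≥0) : ℝ) by push_cast; ring,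
      ENNReal.ofReal_coe_nnreal]
    exact_mod_cast le_self_add
  have hW6e : eLpNorm W 6 volume ≤ ENNReal.ofReal (K * sD) := by
    refine hsob.trans ?_
    rw [hDW_eq, ENNReal.ofReal_mul hK0.le]
    exact mul_le_mul' hK₀K le_rfl
  -- unfold `eLpNorm W 6` as `(∫⁻ ‖W‖ₑ ^ 6) ^ (1/6)`
  have h6 : eLpNorm W 6 volume = (∫⁻ x, ‖W x‖ₑ ^ (6 : ℝ)) ^ (1 / (6 : ℝ)) := by
    rw [eLpNorm_eq_lintegral_rpow_enorm_toReal (by norm_num) (by norm_num)]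
    norm_num
  rw [h6] at hW6e
  have hlin : ∫⁻ x, ‖W x‖ₑ ^ (6 : ℝ) ≤ ENNReal.ofReal (K * sD) ^ (6 : ℝ) := by
    have h := ENNReal.rpow_le_rpow hW6e (by norm_num : (0 : ℝ) ≤ 6)
    rwa [← ENNReal.rpow_mul, show (1 / (6 : ℝ)) * 6 = 1 by norm_num, ENNReal.rpow_one] at h
  -- back to real integrals
  have hreal : ∫ x, ‖W x‖ ^ 6 = (∫⁻ x, ‖W x‖ₑ ^ (6 : ℝ)).toReal := by
    rw [integral_eq_lintegral_of_nonneg_ae (Eventually.of_forall fun x => by positivity)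
      IW6.aestronglyMeasurable]
    congr 1
    refine lintegral_congr fun x => ?_
    rw [← ofReal_norm, ENNReal.ofReal_rpow_of_nonneg (norm_nonneg _) (by norm_num : (0:ℝ) ≤ 6),
      show (6 : ℝ) = ((6 : ℕ) : ℝ) by norm_num, Real.rpow_natCast]
  rw [hreal]
  have hfin : ENNReal.ofReal (K * sD) ^ (6 : ℝ) ≠ ⊤ :=
    ENNReal.rpow_ne_top_of_nonneg (by norm_num) ENNReal.ofReal_ne_top
  calc (∫⁻ x, ‖W x‖ₑ ^ (6 : ℝ)).toReal ≤ (ENNReal.ofReal (K * sD) ^ (6 : ℝ)).toReal :=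
        ENNReal.toReal_mono hfin hlin
    _ = (K * sD) ^ 6 := by
        rw [← ENNReal.toReal_rpow, ENNReal.toReal_ofReal (by positivity),
          show (6 : ℝ) = ((6 : ℕ) : ℝ) by norm_num, Real.rpow_natCast]

/-- **Skew-symmetry of transport against a cut-off, local form**: for `V, Z ∈ C¹(ℝ³; ℝ³)`,
`ψ ∈ C¹_c` and `div V = 0` on `{ψ ≠ 0}`: `∫ ψ ⟪(V·∇)Z, Z⟫ = −½ ∫ (Dψ·V) |Z|²`. [folklore] -/
private theorem integral_mul_inner_convect_eq_of_divergence_eq_zero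
    {V Z : (EuclideanSpace ℝ (Fin 3)) → (EuclideanSpace ℝ (Fin 3))} {ψ : (EuclideanSpace ℝ (Fin 3)) → ℝ}
    (hV : ContDiff ℝ 1 V) (hZ : ContDiff ℝ 1 Z) (hψ : ContDiff ℝ 1 ψ) (hψc : HasCompactSupport ψ)
    (hdiv : ∀ x, ψ x ≠ 0 → VectorCalculus.divergence V x = 0) :
    ∫ x, ψ x * ⟪convect V Z x, Z x⟫ = -(2⁻¹ * ∫ x, fderiv ℝ ψ x (V x) * ‖Z x‖ ^ 2) := by
  have hΨ : ContDiff ℝ 1 fun y => ψ y • Z y := hψ.smul hZ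
  have hΨc : HasCompactSupport fun y => ψ y • Z y := hψc.smul_right
  have h := integral_inner_convect_add_eq_zero hV hZ hΨ hΨc
  have h3 : ∫ x, VectorCalculus.divergence V x * ⟪Z x, ψ x • Z x⟫ = 0 := by
    refine integral_eq_zero_of_ae (Eventually.of_forall fun x => ?_)
    by_cases hx : ψ x = 0
    · simp [hx]
    · simp [hdiv x hx]
  have h1 : ∀ x, ⟪convect V Z x, ψ x • Z x⟫ = ψ x * ⟪convect V Z x, Z x⟫ := fun x => by
    rw [real_inner_smul_right]
  have h2 : ∀ x, ⟪Z x, convect V (fun y => ψ y • Z y) x⟫ =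
      ψ x * ⟪convect V Z x, Z x⟫ + fderiv ℝ ψ x (V x) * ‖Z x‖ ^ 2 := by
    intro x
    rw [convect_smul_apply (hψ.differentiable one_ne_zero x) (hZ.differentiable one_ne_zero x),
      inner_add_right, real_inner_smul_right, real_inner_smul_right, real_inner_self_eq_norm_sq,
      real_inner_comm]
  have hcv : Continuous fun x => convect V Z x :=
    (hZ.continuous_fderiv one_ne_zero).clm_apply hV.continuous
  have iA : Integrable (fun x => ψ x * ⟪convect V Z x, Z x⟫) (volume : Measure (EuclideanSpace ℝ (Fin 3))) :=
    (hψ.continuous.mul (hcv.inner hZ.continuous)).integrable_of_hasCompactSupport hψc.mul_right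
  have hcDψ : HasCompactSupport (fderiv ℝ ψ) := hψc.fderiv (𝕜 := ℝ)
  have iB : Integrable (fun x => fderiv ℝ ψ x (V x) * ‖Z x‖ ^ 2) (volume : Measure (EuclideanSpace ℝ (Fin 3))) :=
    (((hψ.continuous_fderiv one_ne_zero).clm_apply hV.continuous).mul
      (hZ.continuous.norm.pow 2)).integrable_of_hasCompactSupport
      ((hcDψ.mono fun x hx => by contrapose! hx; simp_all).mul_right)
  simp_rw [h1, h2] at h
  rw [h3, add_zero, integral_add iA iB] at h
  linarith

/-- The gradient of the weighted field `φw`: `∫‖∇(φw)‖² ≤ 2∫φ²‖∇w‖² + 2B_φ² ∫_{B̄(c,r)}|w|²`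
(Leibniz rule, `(a+b)² ≤ 2a² + 2b²`, `∇φ = 0` off `B̄(c,s)`). [folklore] -/
private theorem integral_norm_fderiv_weight_smul_sq_le {φ : (EuclideanSpace ℝ (Fin 3)) → ℝ} (hφ : ContDiff ℝ 1 φ)
    (hφ01 : ∀ x, 0 ≤ φ x ∧ φ x ≤ 1) {c : (EuclideanSpace ℝ (Fin 3))} {s r : ℝ}
    (hφs : tsupport φ ⊆ closedBall c s) (hsr : s ≤ r) {Bφ : ℝ} (hBφ : ∀ x, ‖fderiv ℝ φ x‖ ≤ Bφ)
    {w : (EuclideanSpace ℝ (Fin 3)) → (EuclideanSpace ℝ (Fin 3))} (hw : ContDiff ℝ 1 w) :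
    Integrable (fun x => ‖fderiv ℝ (fun x => φ x • w x) x‖ ^ 2) ∧
    ∫ x, ‖fderiv ℝ (fun x => φ x • w x) x‖ ^ 2 ≤
      2 * (∫ x, φ x ^ 2 * ‖fderiv ℝ w x‖ ^ 2) + 2 * Bφ ^ 2 * ∫ x in closedBall c r, ‖w x‖ ^ 2 := by
  have hφc : HasCompactSupport φ := (isCompact_closedBall c s).of_isClosed_subset (isClosed_tsupport φ) hφs
  have hφcont : Continuous φ := hφ.continuous
  have hwc : Continuous w := hw.continuous
  have hDw : Continuous (fderiv ℝ w) := hw.continuous_fderiv one_ne_zero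
  have hW1 : ContDiff ℝ 1 (fun x => φ x • w x) := hφ.smul hw
  have hWc : HasCompactSupport (fun x => φ x • w x) := hφc.smul_right
  have hDWc : Continuous (fderiv ℝ (fun x => φ x • w x)) := hW1.continuous_fderiv one_ne_zero
  have hsub : closedBall c s ⊆ closedBall c r := closedBall_subset_closedBall hsr
  have hDφ_zero : ∀ x, x ∉ closedBall c s → fderiv ℝ φ x = 0 := fun x hx =>
    fderiv_of_notMem_tsupport ℝ fun h => hx (hφs h)
  have hc2 : HasCompactSupport (fun x => ‖fderiv ℝ (fun x => φ x • w x) x‖ ^ 2) :=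
    (hWc.fderiv (𝕜 := ℝ)).norm.mono fun x hx => by
      rw [mem_support] at hx ⊢
      intro h0
      exact hx (by rw [h0]; ring)
  have IDW2 : Integrable fun x => ‖fderiv ℝ (fun x => φ x • w x) x‖ ^ 2 :=
    (hDWc.norm.pow 2).integrable_of_hasCompactSupport hc2
  have ID' : Integrable fun x => φ x ^ 2 * ‖fderiv ℝ w x‖ ^ 2 :=
    integrable_sq_mul_of_hasCompactSupport' hφcont hφc (hDw.norm.pow 2)
  have IYl : IntegrableOn (fun x => ‖w x‖ ^ 2) (closedBall c r) :=
    (hwc.norm.pow 2).continuousOn.integrableOn_compact (isCompact_closedBall _ _)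
  have Iind : Integrable fun x => (closedBall c r).indicator (fun x => ‖w x‖ ^ 2) x := by
    rw [integrable_indicator_iff measurableSet_closedBall]; exact IYl
  have hpt : ∀ x, ‖fderiv ℝ (fun x => φ x • w x) x‖ ^ 2 ≤
      2 * (φ x ^ 2 * ‖fderiv ℝ w x‖ ^ 2) + 2 * Bφ ^ 2 * (closedBall c r).indicator (fun x => ‖w x‖ ^ 2) x := by
    intro x
    have hφd : DifferentiableAt ℝ φ x := (hφ.differentiable one_ne_zero) x
    have hwd : DifferentiableAt ℝ w x := (hw.differentiable one_ne_zero) x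
    have hDW : fderiv ℝ (fun x => φ x • w x) x = φ x • fderiv ℝ w x + (fderiv ℝ φ x).smulRight (w x) :=
      fderiv_fun_smul hφd hwd
    have hle : ‖fderiv ℝ (fun x => φ x • w x) x‖ ≤ φ x * ‖fderiv ℝ w x‖ + ‖fderiv ℝ φ x‖ * ‖w x‖ := by
      rw [hDW]
      refine (norm_add_le _ _).trans (le_of_eq ?_)
      rw [norm_smul, Real.norm_eq_abs, abs_of_nonneg (hφ01 x).1, ContinuousLinearMap.norm_smulRight_apply]
    have hsq : ‖fderiv ℝ (fun x => φ x • w x) x‖ ^ 2 ≤ (φ x * ‖fderiv ℝ w x‖ + ‖fderiv ℝ φ x‖ * ‖w x‖) ^ 2 :=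
      pow_le_pow_left₀ (norm_nonneg _) hle 2
    by_cases hxB : x ∈ closedBall c s
    · rw [indicator_of_mem (hsub hxB)]
      have h_b : ‖fderiv ℝ φ x‖ * ‖w x‖ ≤ Bφ * ‖w x‖ := mul_le_mul_of_nonneg_right (hBφ x) (norm_nonneg _)
      have h0 : 0 ≤ ‖fderiv ℝ φ x‖ * ‖w x‖ := by positivity
      nlinarith only [hsq, h_b, h0, sq_nonneg (φ x * ‖fderiv ℝ w x‖ - ‖fderiv ℝ φ x‖ * ‖w x‖)]
    · rw [hDφ_zero x hxB, norm_zero, zero_mul, add_zero] at hsq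
      have hind : 0 ≤ 2 * Bφ ^ 2 * (closedBall c r).indicator (fun x => ‖w x‖ ^ 2) x :=
        mul_nonneg (by positivity) (indicator_nonneg (fun y _ => by positivity) _)
      nlinarith only [hsq, hind, sq_nonneg (φ x * ‖fderiv ℝ w x‖)]
  refine ⟨IDW2, ?_⟩
  calc ∫ x, ‖fderiv ℝ (fun x => φ x • w x) x‖ ^ 2
      ≤ ∫ x, (2 * (φ x ^ 2 * ‖fderiv ℝ w x‖ ^ 2) +
          2 * Bφ ^ 2 * (closedBall c r).indicator (fun x => ‖w x‖ ^ 2) x) :=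
        integral_mono IDW2 ((ID'.const_mul _).add (Iind.const_mul _)) hpt
    _ = 2 * (∫ x, φ x ^ 2 * ‖fderiv ℝ w x‖ ^ 2) + 2 * Bφ ^ 2 * ∫ x in closedBall c r, ‖w x‖ ^ 2 := by
        rw [integral_add (ID'.const_mul _) (Iind.const_mul _), integral_const_mul, integral_const_mul,
          integral_indicator measurableSet_closedBall]


/-- **The localized transport term** (Grujić 2009, (6), from [GrZh] §2; here pointwise in time
with the cut-off `ψ = θ⁴`, `|∇ψ| ≤ 4B_θ θ³`): for `C¹` fields `V, W` and the weight `θ`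
(`0 ≤ θ ≤ 1`, `tsupport θ ⊆ B̄(c,s)`, `‖∇θ‖ ≤ B_θ`),
`∫ (∇(θ⁴)·V)|W|² ≤ (ν/4)∫θ⁴‖∇W‖² + νB_θ²Y + 13824 K⁶B_θ⁴E²Y/ν³`, `Y = ∫_{B̄(c,6s)}|W|²`,
`E = ∫_{B̄(c,6s)}|V|²`, by Cauchy–Schwarz twice, the Sobolev inequality for `θ²W` and Young's
inequality `(4, 4/3)`. [folklore] -/
private theorem integral_fderiv_pow_four_mul_norm_sq_le (c : (EuclideanSpace ℝ (Fin 3))) {s ν : ℝ}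
    (hs : 0 < s) (hν : 0 < ν)
    {θ : (EuclideanSpace ℝ (Fin 3)) → ℝ} (hθ : ContDiff ℝ 1 θ) (hθ01 : ∀ x, 0 ≤ θ x ∧ θ x ≤ 1)
    (hθs : tsupport θ ⊆ closedBall c s) {Bθ : ℝ} (hBθ0 : 0 ≤ Bθ) (hBθ : ∀ x, ‖fderiv ℝ θ x‖ ≤ Bθ)
    {V W : (EuclideanSpace ℝ (Fin 3)) → (EuclideanSpace ℝ (Fin 3))} (hV : ContDiff ℝ 1 V)
    (hW : ContDiff ℝ 1 W) :
    ∫ x, fderiv ℝ (fun y => θ y ^ 4) x (V x) * ‖W x‖ ^ 2 ≤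
      ν / 4 * (∫ x, (θ x ^ 2) ^ 2 * ‖fderiv ℝ W x‖ ^ 2) +
        ν * Bθ ^ 2 * (∫ x in closedBall c (6 * s), ‖W x‖ ^ 2) +
        13824 * (((SNormLESNormFDerivOfEqConst (EuclideanSpace ℝ (Fin 3))
            (volume : Measure (EuclideanSpace ℝ (Fin 3))) 2 : ℝ≥0) : ℝ) + 1) ^ 6 * Bθ ^ 4 / ν ^ 3 *
          (∫ x in closedBall c (6 * s), ‖V x‖ ^ 2) ^ 2 * (∫ x in closedBall c (6 * s), ‖W x‖ ^ 2) := by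
  -- constants and basic objects
  set K₀ : ℝ≥0 := SNormLESNormFDerivOfEqConst (EuclideanSpace ℝ (Fin 3))
    (volume : Measure (EuclideanSpace ℝ (Fin 3))) 2 with hK₀
  set K : ℝ := (K₀ : ℝ) + 1 with hK
  have hK0 : 0 < K := by rw [hK]; positivity
  have hθc : HasCompactSupport θ :=
    (isCompact_closedBall c s).of_isClosed_subset (isClosed_tsupport θ) hθs
  have hθcont : Continuous θ := hθ.continuous
  have hθd : ∀ x, DifferentiableAt ℝ θ x := fun x => hθ.differentiable one_ne_zero x
  have hVc : Continuous V := hV.continuous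
  have hWc : Continuous W := hW.continuous
  have hDWc : Continuous (fderiv ℝ W) := hW.continuous_fderiv one_ne_zero
  have hs6 : s ≤ 6 * s := by linarith
  have hsub : closedBall c s ⊆ closedBall c (6 * s) := closedBall_subset_closedBall hs6
  -- the weight `φ = θ²` of the Sobolev step
  set φ : (EuclideanSpace ℝ (Fin 3)) → ℝ := fun x => θ x ^ 2 with hφdef
  have hφ1 : ContDiff ℝ 1 φ := hθ.pow 2
  have hφ01 : ∀ x, 0 ≤ φ x ∧ φ x ≤ 1 := fun x => by
    have h0 := (hθ01 x).1; have h1 := (hθ01 x).2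
    exact ⟨by positivity, by nlinarith⟩
  have hφs : tsupport φ ⊆ closedBall c s := by
    refine (closure_mono fun x hx => ?_).trans hθs
    rw [mem_support] at hx ⊢
    intro h; apply hx; show θ x ^ 2 = 0; rw [h]; ring
  have hφc : HasCompactSupport φ :=
    (isCompact_closedBall c s).of_isClosed_subset (isClosed_tsupport φ) hφs
  have hDφ : ∀ x, ‖fderiv ℝ φ x‖ ≤ 2 * Bθ := by
    intro x
    have h : fderiv ℝ φ x = (2 * θ x) • fderiv ℝ θ x := by
      rw [show φ = fun y => θ y ^ 2 from rfl, ((hθd x).hasFDerivAt.pow 2).fderiv, nsmul_eq_mul]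
      norm_num
    rw [h, norm_smul, Real.norm_eq_abs]
    have h1 : |2 * θ x| ≤ 2 := by
      rw [abs_le]; constructor <;> nlinarith [(hθ01 x).1, (hθ01 x).2]
    exact mul_le_mul h1 (hBθ x) (norm_nonneg _) (by norm_num)
  -- quantities
  set D' : ℝ := ∫ x, (θ x ^ 2) ^ 2 * ‖fderiv ℝ W x‖ ^ 2 with hD'
  set Y : ℝ := ∫ x in closedBall c (6 * s), ‖W x‖ ^ 2 with hY
  set E : ℝ := ∫ x in closedBall c (6 * s), ‖V x‖ ^ 2 with hE
  have hD'0 : 0 ≤ D' := integral_nonneg fun x => by positivity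
  have hY0 : 0 ≤ Y := setIntegral_nonneg measurableSet_closedBall fun x _ => by positivity
  have hE0 : 0 ≤ E := setIntegral_nonneg measurableSet_closedBall fun x _ => by positivity
  have IYbig : IntegrableOn (fun x => ‖W x‖ ^ 2) (closedBall c (6 * s)) :=
    (hWc.norm.pow 2).continuousOn.integrableOn_compact (isCompact_closedBall _ _)
  have IEbig : IntegrableOn (fun x => ‖V x‖ ^ 2) (closedBall c (6 * s)) :=
    (hVc.norm.pow 2).continuousOn.integrableOn_compact (isCompact_closedBall _ _)
  -- ### the pointwise bound `(∇θ⁴·V)|W|² ≤ 4B_θ θ³|V||W|²`, supported in `B̄(c,s)`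
  have hψd : ∀ x, fderiv ℝ (fun y => θ y ^ 4) x = (4 * θ x ^ 3) • fderiv ℝ θ x := fun x => by
    rw [((hθd x).hasFDerivAt.pow 4).fderiv, nsmul_eq_mul]
    norm_num
  have hpt : ∀ x, fderiv ℝ (fun y => θ y ^ 4) x (V x) * ‖W x‖ ^ 2 ≤
      4 * Bθ * (θ x ^ 3 * ‖W x‖ ^ 2 * ‖V x‖) := by
    intro x
    rw [hψd x, smul_apply, smul_eq_mul]
    have h1 : |fderiv ℝ θ x (V x)| ≤ Bθ * ‖V x‖ := by
      rw [← Real.norm_eq_abs]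
      exact (ContinuousLinearMap.le_opNorm _ _).trans (mul_le_mul_of_nonneg_right (hBθ x) (norm_nonneg _))
    have h2 : 0 ≤ θ x ^ 3 := pow_nonneg (hθ01 x).1 3
    have h3 : fderiv ℝ θ x (V x) ≤ Bθ * ‖V x‖ := (le_abs_self _).trans h1
    have h4 : 0 ≤ ‖W x‖ ^ 2 := sq_nonneg _
    nlinarith [mul_le_mul_of_nonneg_left h3 (mul_nonneg h2 h4)]
  have hzero : ∀ x, x ∉ closedBall c s → θ x = 0 := fun x hx =>
    image_eq_zero_of_notMem_tsupport fun h => hx (hθs h)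
  -- integrability of both sides
  have hψc4 : HasCompactSupport (fun y => θ y ^ 4) := by
    refine hθc.mono fun x hx => ?_
    rw [mem_support] at hx ⊢
    intro h; apply hx; rw [h]; ring
  have Ilhs : Integrable fun x => fderiv ℝ (fun y => θ y ^ 4) x (V x) * ‖W x‖ ^ 2 :=
    ((((hθ.pow 4).continuous_fderiv one_ne_zero).clm_apply hVc).mul (hWc.norm.pow 2)).integrable_of_hasCompactSupport
      (((hψc4.fderiv (𝕜 := ℝ)).mono fun x hx => by contrapose! hx; simp_all).mul_right)
  have hPc : Continuous fun x => θ x ^ 3 * ‖W x‖ ^ 2 * ‖V x‖ :=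
    ((hθcont.pow 3).mul (hWc.norm.pow 2)).mul hVc.norm
  have IP : Integrable fun x => θ x ^ 3 * ‖W x‖ ^ 2 * ‖V x‖ := by
    refine hPc.integrable_of_hasCompactSupport (hθc.mono fun x hx => ?_)
    rw [mem_support] at hx ⊢
    intro h; apply hx; rw [h]; ring
  set P : ℝ := ∫ x in closedBall c s, θ x ^ 3 * ‖W x‖ ^ 2 * ‖V x‖ with hPdef
  have hP_eq : ∫ x, θ x ^ 3 * ‖W x‖ ^ 2 * ‖V x‖ = P := by
    rw [hPdef]
    exact (setIntegral_eq_integral_of_forall_compl_eq_zero fun x hx => by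
      rw [hzero x hx]; ring).symm
  have hT2P : ∫ x, fderiv ℝ (fun y => θ y ^ 4) x (V x) * ‖W x‖ ^ 2 ≤ 4 * Bθ * P := by
    calc ∫ x, fderiv ℝ (fun y => θ y ^ 4) x (V x) * ‖W x‖ ^ 2
        ≤ ∫ x, 4 * Bθ * (θ x ^ 3 * ‖W x‖ ^ 2 * ‖V x‖) := integral_mono Ilhs (IP.const_mul _) hpt
      _ = 4 * Bθ * P := by rw [integral_const_mul, hP_eq]
  -- ### Cauchy–Schwarz twice
  have hCS1 := setIntegral_mul_le_sqrt_mul_sqrt_closedBall (f := fun x => θ x ^ 3 * ‖W x‖ ^ 2)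
    (g := fun x => ‖V x‖) ((hθcont.pow 3).mul (hWc.norm.pow 2))
    hVc.norm (fun x => by have := (hθ01 x).1; positivity) (fun x => norm_nonneg _) c s
  have hEs : ∫ x in closedBall c s, ‖V x‖ ^ 2 ≤ E :=
    setIntegral_mono_set IEbig (ae_of_all _ fun x => by positivity) (ae_of_all _ hsub)
  have hCS2 := setIntegral_mul_le_sqrt_mul_sqrt_closedBall (f := fun x => θ x ^ 6 * ‖W x‖ ^ 3)
    (g := fun x => ‖W x‖) ((hθcont.pow 6).mul (hWc.norm.pow 3))
    hWc.norm (fun x => by have := (hθ01 x).1; positivity) (fun x => norm_nonneg _) c s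
  have hYs : ∫ x in closedBall c s, ‖W x‖ ^ 2 ≤ Y :=
    setIntegral_mono_set IYbig (ae_of_all _ fun x => by positivity) (ae_of_all _ hsub)
  -- rewrite the squared integrands
  have e1 : ∫ x in closedBall c s, (θ x ^ 3 * ‖W x‖ ^ 2) ^ 2 = ∫ x in closedBall c s, θ x ^ 6 * ‖W x‖ ^ 3 * ‖W x‖ :=
    setIntegral_congr_fun measurableSet_closedBall fun x _ => by ring
  have e2 : ∫ x in closedBall c s, (θ x ^ 6 * ‖W x‖ ^ 3) ^ 2 = ∫ x in closedBall c s, θ x ^ 12 * ‖W x‖ ^ 6 :=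
    setIntegral_congr_fun measurableSet_closedBall fun x _ => by ring
  rw [e1] at hCS1
  rw [e2] at hCS2
  -- ### Sobolev for `φW = θ²W`
  set Wφ : (EuclideanSpace ℝ (Fin 3)) → (EuclideanSpace ℝ (Fin 3)) := fun x => φ x • W x with hWφ
  have hWφ1 : ContDiff ℝ 1 Wφ := hφ1.smul hW
  have hWφc : HasCompactSupport Wφ := hφc.smul_right
  have hWφnorm : ∀ x, ‖Wφ x‖ = θ x ^ 2 * ‖W x‖ := fun x => by
    show ‖θ x ^ 2 • W x‖ = _; rw [norm_smul, Real.norm_eq_abs, abs_of_nonneg (by positivity)]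
  have hsob := integral_norm_pow_six_le_sobolev hWφ1 hWφc
  obtain ⟨IDWφ, hgrad⟩ := integral_norm_fderiv_weight_smul_sq_le hφ1 hφ01 hφs hs6 hDφ hW
  -- `X2 = 2D' + 8B_θ²Y`, `sX = √X2`
  set X2 : ℝ := 2 * D' + 2 * (2 * Bθ) ^ 2 * Y with hX2
  have hX20 : 0 ≤ X2 := by positivity
  have hgrad' : ∫ x, ‖fderiv ℝ Wφ x‖ ^ 2 ≤ X2 := by
    have e : ∫ x, φ x ^ 2 * ‖fderiv ℝ W x‖ ^ 2 = D' := by rw [hD']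
    rw [hX2, ← e]; exact hgrad
  set sX : ℝ := Real.sqrt X2 with hsX
  have hsX0 : 0 ≤ sX := Real.sqrt_nonneg _
  have hKsX : 0 ≤ K * sX := mul_nonneg hK0.le hsX0
  have hJ6 : ∫ x, ‖Wφ x‖ ^ 6 ≤ (K * sX) ^ 6 := by
    refine hsob.trans (pow_le_pow_left₀ (by positivity) ?_ 6)
    exact mul_le_mul_of_nonneg_left (Real.sqrt_le_sqrt hgrad') hK0.le
  have IWφ6 : Integrable fun x => ‖Wφ x‖ ^ 6 :=
    (hWφ1.continuous.norm.pow 6).integrable_of_hasCompactSupport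
      (HasCompactSupport.intro hWφc fun x hx => by simp [image_eq_zero_of_notMem_tsupport hx])
  have hJ6B : ∫ x in closedBall c s, θ x ^ 12 * ‖W x‖ ^ 6 ≤ (K * sX) ^ 6 := by
    have e : (fun x => ‖Wφ x‖ ^ 6) = fun x => θ x ^ 12 * ‖W x‖ ^ 6 := by
      funext x; rw [hWφnorm x]; ring
    rw [e] at IWφ6 hJ6
    exact (setIntegral_le_integral IWφ6 (ae_of_all _ fun x => by
      have := (hθ01 x).1; positivity)).trans hJ6
  -- ### the chain
  set τ : ℝ := Real.sqrt (K * sX) with hτ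
  have hτ0 : 0 ≤ τ := Real.sqrt_nonneg _
  have hτ2 : τ ^ 2 = K * sX := Real.sq_sqrt hKsX
  have hτ4 : τ ^ 4 = K ^ 2 * X2 := by
    rw [show (4 : ℕ) = 2 * 2 by norm_num, pow_mul, hτ2, mul_pow, hsX, Real.sq_sqrt hX20]
  have hτ6 : (K * sX) ^ 3 = τ ^ 6 := by
    rw [show (6 : ℕ) = 2 * 3 by norm_num, pow_mul, hτ2]
  set q : ℝ := Real.sqrt (Real.sqrt Y) with hq
  have hq0 : 0 ≤ q := Real.sqrt_nonneg _
  have hq2 : q ^ 2 = Real.sqrt Y := Real.sq_sqrt (Real.sqrt_nonneg _)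
  have hq4 : q ^ 4 = Y := by
    rw [show (4 : ℕ) = 2 * 2 by norm_num, pow_mul, hq2, Real.sq_sqrt hY0]
  set sE : ℝ := Real.sqrt E with hsE
  have hsE0 : 0 ≤ sE := Real.sqrt_nonneg _
  have hsE2 : sE ^ 2 = E := Real.sq_sqrt hE0
  -- `J4 ≤ (K sX)³ √Y = (τ³ q)²`
  have hJ4 : ∫ x in closedBall c s, θ x ^ 6 * ‖W x‖ ^ 3 * ‖W x‖ ≤ (τ ^ 3 * q) ^ 2 := by
    have h1 : Real.sqrt (∫ x in closedBall c s, θ x ^ 12 * ‖W x‖ ^ 6) ≤ τ ^ 6 := by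
      have e : τ ^ 6 = Real.sqrt ((K * sX) ^ 6) := by
        rw [show (K * sX) ^ 6 = ((K * sX) ^ 3) ^ 2 by ring, Real.sqrt_sq (pow_nonneg hKsX 3), hτ6]
      rw [e]
      exact Real.sqrt_le_sqrt hJ6B
    have h2 : Real.sqrt (∫ x in closedBall c s, ‖W x‖ ^ 2) ≤ q ^ 2 := by
      rw [hq2]; exact Real.sqrt_le_sqrt hYs
    have h3 : 0 ≤ τ ^ 6 := pow_nonneg hτ0 6
    calc ∫ x in closedBall c s, θ x ^ 6 * ‖W x‖ ^ 3 * ‖W x‖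
        ≤ Real.sqrt (∫ x in closedBall c s, θ x ^ 12 * ‖W x‖ ^ 6) *
            Real.sqrt (∫ x in closedBall c s, ‖W x‖ ^ 2) := hCS2
      _ ≤ τ ^ 6 * q ^ 2 := mul_le_mul h1 h2 (Real.sqrt_nonneg _) h3
      _ = (τ ^ 3 * q) ^ 2 := by ring
  -- `P ≤ τ³ q √E`
  have hP : P ≤ τ ^ 3 * q * sE := by
    have h0 : 0 ≤ τ ^ 3 * q := mul_nonneg (pow_nonneg hτ0 3) hq0
    have h1 : Real.sqrt (∫ x in closedBall c s, θ x ^ 6 * ‖W x‖ ^ 3 * ‖W x‖) ≤ τ ^ 3 * q := by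
      have e : τ ^ 3 * q = Real.sqrt ((τ ^ 3 * q) ^ 2) := (Real.sqrt_sq h0).symm
      rw [e]
      exact Real.sqrt_le_sqrt hJ4
    have h2 : Real.sqrt (∫ x in closedBall c s, ‖V x‖ ^ 2) ≤ sE := by
      rw [hsE]; exact Real.sqrt_le_sqrt hEs
    calc P ≤ Real.sqrt (∫ x in closedBall c s, θ x ^ 6 * ‖W x‖ ^ 3 * ‖W x‖) *
            Real.sqrt (∫ x in closedBall c s, ‖V x‖ ^ 2) := hCS1
      _ ≤ τ ^ 3 * q * sE := mul_le_mul h1 h2 (Real.sqrt_nonneg _) h0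
  -- ### Young
  set a : ℝ := 2 * Bθ * sE * q with ha
  have ha0 : 0 ≤ a := by positivity
  set ε : ℝ := ν / (8 * K ^ 2) with hε
  have hε0 : 0 < ε := by positivity
  have hyoung := two_mul_mul_cube_le_young hε0 ha0 hτ0
  have hT2 : ∫ x, fderiv ℝ (fun y => θ y ^ 4) x (V x) * ‖W x‖ ^ 2 ≤ 2 * a * τ ^ 3 := by
    refine hT2P.trans ?_
    have : 4 * Bθ * P ≤ 4 * Bθ * (τ ^ 3 * q * sE) := mul_le_mul_of_nonneg_left hP (by positivity)
    calc 4 * Bθ * P ≤ 4 * Bθ * (τ ^ 3 * q * sE) := this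
      _ = 2 * a * τ ^ 3 := by rw [ha]; ring
  -- the two Young terms
  have hY1 : ε * τ ^ 4 = ν / 4 * D' + ν * Bθ ^ 2 * Y := by
    rw [hτ4, hε, hX2]; field_simp; ring
  have hY2 : 27 * a ^ 4 / (16 * ε ^ 3) = 13824 * K ^ 6 * Bθ ^ 4 / ν ^ 3 * E ^ 2 * Y := by
    have ha4 : a ^ 4 = 16 * Bθ ^ 4 * E ^ 2 * Y := by
      rw [ha, show (2 * Bθ * sE * q) ^ 4 = 16 * Bθ ^ 4 * (sE ^ 2) ^ 2 * q ^ 4 by ring, hsE2, hq4]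
    rw [ha4, hε]
    field_simp
    ring
  linarith only [hT2, hyoung, hY1, hY2]

/-- **The slice inequality** (Grujić 2009 §4 p. 865: the vorticity equation (2) multiplied by
`ψ²ω` and integrated, `= T₁ + T₂ + T₃`, with (5), (6) and the estimate of `T₃` — here at a fixed
time, with the stretching bound supplied by `exists_localized_stretching_le_of_holderHalf`):
for `V ∈ C³` divergence free on `B(c, 6s)`, `ω = curl V`, the weight `θ` and `φ = θ²`,
`2∫φ²⟪ω, νΔω − (V·∇)ω + (ω·∇)V⟫ ≤ (C₁ + C₂(Y+F) + C₃E)∫φ²|ω|² + (49νB_θ² + C₄ + C_T E²)(Y+F)`.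
[folklore] -/
private theorem localEnstrophy_slice_le (c : (EuclideanSpace ℝ (Fin 3))) {s ν : ℝ} (hs : 0 < s) (hν : 0 < ν)
    {θ : (EuclideanSpace ℝ (Fin 3)) → ℝ} (hθ : ContDiff ℝ 1 θ) (hθ01 : ∀ x, 0 ≤ θ x ∧ θ x ≤ 1)
    (hθs : tsupport θ ⊆ closedBall c s) {Bθ : ℝ} (hBθ0 : 0 ≤ Bθ) (hBθ : ∀ x, ‖fderiv ℝ θ x‖ ≤ Bθ)
    {V : (EuclideanSpace ℝ (Fin 3)) → (EuclideanSpace ℝ (Fin 3))} (hV : ContDiff ℝ 3 V)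
    (hdiv : ∀ y ∈ ball c (6 * s), VectorCalculus.divergence V y = 0) {C₁ C₂ C₃ C₄ : ℝ}
    (hstretch : 2 * ∫ x, (θ x ^ 2) ^ 2 * ⟪curl V x, fderiv ℝ V x (curl V x)⟫ ≤
      ν / 2 * (∫ x, (θ x ^ 2) ^ 2 * frobeniusNormSq (fderiv ℝ (curl V) x)) +
        (C₁ + C₂ * ((∫ x in closedBall c (6 * s), ‖curl V x‖ ^ 2) +
            (∫ x in closedBall c (6 * s), ‖fderiv ℝ V x‖ ^ 2)) +
          C₃ * (∫ x in closedBall c (6 * s), ‖V x‖ ^ 2)) * (∫ x, (θ x ^ 2) ^ 2 * ‖curl V x‖ ^ 2) +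
        C₄ * ((∫ x in closedBall c (6 * s), ‖curl V x‖ ^ 2) +
          (∫ x in closedBall c (6 * s), ‖fderiv ℝ V x‖ ^ 2))) :
    ∫ x, 2 * ((θ x ^ 2) ^ 2 * ⟪curl V x,
        ν • Δ (curl V) x - convect V (curl V) x + convect (curl V) V x⟫) ≤
      (C₁ + C₂ * ((∫ x in closedBall c (6 * s), ‖curl V x‖ ^ 2) +
            (∫ x in closedBall c (6 * s), ‖fderiv ℝ V x‖ ^ 2)) +
          C₃ * (∫ x in closedBall c (6 * s), ‖V x‖ ^ 2)) * (∫ x, (θ x ^ 2) ^ 2 * ‖curl V x‖ ^ 2) +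
        (49 * ν * Bθ ^ 2 + C₄ +
          13824 * (((SNormLESNormFDerivOfEqConst (EuclideanSpace ℝ (Fin 3))
            (volume : Measure (EuclideanSpace ℝ (Fin 3))) 2 : ℝ≥0) : ℝ) + 1) ^ 6 * Bθ ^ 4 / ν ^ 3 *
            (∫ x in closedBall c (6 * s), ‖V x‖ ^ 2) ^ 2) *
          ((∫ x in closedBall c (6 * s), ‖curl V x‖ ^ 2) +
            (∫ x in closedBall c (6 * s), ‖fderiv ℝ V x‖ ^ 2)) := by
  set K : ℝ := ((SNormLESNormFDerivOfEqConst (EuclideanSpace ℝ (Fin 3))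
    (volume : Measure (EuclideanSpace ℝ (Fin 3))) 2 : ℝ≥0) : ℝ) + 1 with hK
  have hK0 : 0 < K := by rw [hK]; positivity
  -- basic objects
  have hV1 : ContDiff ℝ 1 V := hV.of_le (by norm_num)
  have hVc : Continuous V := hV.continuous
  have hDV : Continuous (fderiv ℝ V) := hV1.continuous_fderiv one_ne_zero
  have hW2 : ContDiff ℝ 2 (curl V) := contDiff_curl (n := 2) (by exact hV)
  have hW1 : ContDiff ℝ 1 (curl V) := hW2.of_le (by norm_num)
  have hWc : Continuous (curl V) := hW1.continuous
  have hDW : Continuous (fderiv ℝ (curl V)) := hW1.continuous_fderiv one_ne_zero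
  have hΔW : Continuous (Δ (curl V)) := continuous_laplacian hW2
  have hθc : HasCompactSupport θ :=
    (isCompact_closedBall c s).of_isClosed_subset (isClosed_tsupport θ) hθs
  have hθcont : Continuous θ := hθ.continuous
  have hθd : ∀ x, DifferentiableAt ℝ θ x := fun x => hθ.differentiable one_ne_zero x
  have hs6 : s ≤ 6 * s := by linarith
  have hsub : closedBall c s ⊆ closedBall c (6 * s) := closedBall_subset_closedBall hs6
  have hsub' : closedBall c s ⊆ ball c (6 * s) := fun x hx => by
    rw [mem_closedBall] at hx; rw [mem_ball]; linarith
  -- the weights `φ = θ²`, `ψ = θ⁴ = φ²`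
  set φ : (EuclideanSpace ℝ (Fin 3)) → ℝ := fun x => θ x ^ 2 with hφdef
  have hφ1 : ContDiff ℝ 1 φ := hθ.pow 2
  have hφcont : Continuous φ := hφ1.continuous
  have hφs : tsupport φ ⊆ closedBall c s := by
    refine (closure_mono fun x hx => ?_).trans hθs
    rw [mem_support] at hx ⊢
    intro h; apply hx; show θ x ^ 2 = 0; rw [h]; ring
  have hφc : HasCompactSupport φ :=
    (isCompact_closedBall c s).of_isClosed_subset (isClosed_tsupport φ) hφs
  have hDφ : ∀ x, ‖fderiv ℝ φ x‖ ≤ 2 * Bθ := by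
    intro x
    have h : fderiv ℝ φ x = (2 * θ x) • fderiv ℝ θ x := by
      rw [show φ = fun y => θ y ^ 2 from rfl, ((hθd x).hasFDerivAt.pow 2).fderiv, nsmul_eq_mul]
      norm_num
    rw [h, norm_smul, Real.norm_eq_abs]
    have h1 : |2 * θ x| ≤ 2 := by
      rw [abs_le]; constructor <;> nlinarith [(hθ01 x).1, (hθ01 x).2]
    exact mul_le_mul h1 (hBθ x) (norm_nonneg _) (by norm_num)
  have hDφ0 : ∀ x ∉ closedBall c (6 * s), fderiv ℝ φ x = 0 := fun x hx =>
    fderiv_of_notMem_tsupport ℝ fun h => hx (hsub (hφs h))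
  set ψ : (EuclideanSpace ℝ (Fin 3)) → ℝ := fun x => θ x ^ 4 with hψdef
  have hψ1 : ContDiff ℝ 1 ψ := hθ.pow 4
  have hψc : HasCompactSupport ψ := by
    refine hθc.mono fun x hx => ?_
    rw [mem_support] at hx ⊢
    intro h; apply hx; show θ x ^ 4 = 0; rw [h]; ring
  have hψφ : ∀ x, ψ x = φ x ^ 2 := fun x => by show θ x ^ 4 = (θ x ^ 2) ^ 2; ring
  have hdivψ : ∀ x, ψ x ≠ 0 → VectorCalculus.divergence V x = 0 := by
    intro x hx
    have hθx : θ x ≠ 0 := fun h => hx (by show θ x ^ 4 = 0; rw [h]; ring)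
    exact hdiv x (hsub' (hθs (subset_tsupport _ (mem_support.2 hθx))))
  -- quantities
  set Yφ : ℝ := ∫ x, (θ x ^ 2) ^ 2 * ‖curl V x‖ ^ 2 with hYφ
  set Dφ : ℝ := ∫ x, (θ x ^ 2) ^ 2 * frobeniusNormSq (fderiv ℝ (curl V) x) with hDφdef
  set D' : ℝ := ∫ x, (θ x ^ 2) ^ 2 * ‖fderiv ℝ (curl V) x‖ ^ 2 with hD'
  set Y : ℝ := ∫ x in closedBall c (6 * s), ‖curl V x‖ ^ 2 with hY
  set F : ℝ := ∫ x in closedBall c (6 * s), ‖fderiv ℝ V x‖ ^ 2 with hF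
  set E : ℝ := ∫ x in closedBall c (6 * s), ‖V x‖ ^ 2 with hE
  have IDφ : Integrable fun x => φ x ^ 2 * frobeniusNormSq (fderiv ℝ (curl V) x) :=
    integrable_sq_mul_of_hasCompactSupport' hφcont hφc (continuous_frobeniusNormSq_fderiv hW1 one_ne_zero)
  have ID' : Integrable fun x => φ x ^ 2 * ‖fderiv ℝ (curl V) x‖ ^ 2 :=
    integrable_sq_mul_of_hasCompactSupport' hφcont hφc (hDW.norm.pow 2)
  have IY : IntegrableOn (fun x => ‖curl V x‖ ^ 2) (closedBall c (6 * s)) :=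
    (hWc.norm.pow 2).continuousOn.integrableOn_compact (isCompact_closedBall _ _)
  have hDφ0' : 0 ≤ Dφ := integral_nonneg fun x => mul_nonneg (by positivity) (frobeniusNormSq_nonneg _)
  have hY0 : 0 ≤ Y := setIntegral_nonneg measurableSet_closedBall fun x _ => by positivity
  have hF0 : 0 ≤ F := setIntegral_nonneg measurableSet_closedBall fun x _ => by positivity
  have hE0 : 0 ≤ E := setIntegral_nonneg measurableSet_closedBall fun x _ => by positivity
  have hD'D : D' ≤ Dφ := integral_mono ID' IDφ fun x =>
    mul_le_mul_of_nonneg_left (sq_opNorm_le_frobeniusNormSq _) (sq_nonneg _)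
  -- ### (i) the viscous term
  have hvisc := integral_sq_mul_inner_laplacian_le (u := curl V) (φ := φ) hW2 hφ1 hφc (M := 2 * Bθ)
    hDφ (S := closedBall c (6 * s)) measurableSet_closedBall hDφ0 (Eb := Y) IY le_rfl
  rw [finrank_euclideanSpace_fin] at hvisc
  have hvisc' : ∫ x, φ x * φ x * (2 * ⟪curl V x, Δ (curl V) x⟫) ≤ -Dφ + 48 * Bθ ^ 2 * Y := by
    have e : ∫ x, φ x * φ x * frobeniusNormSq (fderiv ℝ (curl V) x) = Dφ := by
      rw [hDφdef]; exact integral_congr_ae (Eventually.of_forall fun x => by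
        show φ x * φ x * _ = (θ x ^ 2) ^ 2 * _; rw [hφdef]; ring)
    rw [e] at hvisc
    have e2 : (4 : ℝ) * ((3 : ℕ) : ℝ) * (2 * Bθ) ^ 2 * Y = 48 * Bθ ^ 2 * Y := by push_cast; ring
    linarith only [hvisc, e2.le, e2.ge]
  -- ### (ii) the transport term
  have htr := integral_mul_inner_convect_eq_of_divergence_eq_zero hV1 hW1 hψ1 hψc hdivψ
  have hT2 := integral_fderiv_pow_four_mul_norm_sq_le c hs hν hθ hθ01 hθs hBθ0 hBθ hV1 hW1
  -- ### the pointwise splitting of the integrand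
  have hsplit : ∀ x, 2 * ((θ x ^ 2) ^ 2 * ⟪curl V x,
      ν • Δ (curl V) x - convect V (curl V) x + convect (curl V) V x⟫) =
      ν * (φ x * φ x * (2 * ⟪curl V x, Δ (curl V) x⟫)) - 2 * (ψ x * ⟪convect V (curl V) x, curl V x⟫) +
        2 * ((θ x ^ 2) ^ 2 * ⟪curl V x, fderiv ℝ V x (curl V x)⟫) := by
    intro x
    rw [hψφ x]
    simp only [hφdef, convect, inner_add_right, inner_sub_right, real_inner_smul_right,
      real_inner_comm (curl V x) (fderiv ℝ (curl V) x (V x))]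
    ring
  -- integrability of the three pieces
  have I1 : Integrable fun x => φ x * φ x * (2 * ⟪curl V x, Δ (curl V) x⟫) := by
    have h := integrable_sq_mul_of_hasCompactSupport' hφcont hφc
      (g := fun x => 2 * ⟪curl V x, Δ (curl V) x⟫) (continuous_const.mul (hWc.inner hΔW))
    refine h.congr (Eventually.of_forall fun x => ?_)
    show φ x ^ 2 * (2 * ⟪curl V x, Δ (curl V) x⟫) = φ x * φ x * (2 * ⟪curl V x, Δ (curl V) x⟫)
    ring
  have I2 : Integrable fun x => ψ x * ⟪convect V (curl V) x, curl V x⟫ :=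
    (hψ1.continuous.mul ((hDW.clm_apply hVc).inner hWc)).integrable_of_hasCompactSupport hψc.mul_right
  have I3 : Integrable fun x => (θ x ^ 2) ^ 2 * ⟪curl V x, fderiv ℝ V x (curl V x)⟫ :=
    integrable_sq_mul_of_hasCompactSupport' hφcont hφc
      (g := fun x => ⟪curl V x, fderiv ℝ V x (curl V x)⟫) (hWc.inner (hDV.clm_apply hWc))
  have I1' : Integrable fun x => ν * (φ x * φ x * (2 * ⟪curl V x, Δ (curl V) x⟫)) := I1.const_mul ν
  have I2' : Integrable fun x => 2 * (ψ x * ⟪convect V (curl V) x, curl V x⟫) := I2.const_mul 2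
  have I3' : Integrable fun x => 2 * ((θ x ^ 2) ^ 2 * ⟪curl V x, fderiv ℝ V x (curl V x)⟫) :=
    I3.const_mul 2
  have I12 : Integrable fun x => ν * (φ x * φ x * (2 * ⟪curl V x, Δ (curl V) x⟫)) -
      2 * (ψ x * ⟪convect V (curl V) x, curl V x⟫) := I1'.sub I2'
  have hint : ∫ x, 2 * ((θ x ^ 2) ^ 2 * ⟪curl V x,
      ν • Δ (curl V) x - convect V (curl V) x + convect (curl V) V x⟫) =
      ν * (∫ x, φ x * φ x * (2 * ⟪curl V x, Δ (curl V) x⟫)) -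
        2 * (∫ x, ψ x * ⟪convect V (curl V) x, curl V x⟫) +
        2 * ∫ x, (θ x ^ 2) ^ 2 * ⟪curl V x, fderiv ℝ V x (curl V x)⟫ := by
    rw [integral_congr_ae (Eventually.of_forall hsplit), integral_add I12 I3', integral_sub I1' I2',
      integral_const_mul, integral_const_mul, integral_const_mul]
  rw [hint, htr]
  -- ### assemble (all linear after isolating the products with `ν`)
  have hT2' : ∫ x, fderiv ℝ (fun y => θ y ^ 4) x (V x) * ‖curl V x‖ ^ 2 ≤
      ν / 4 * D' + ν * Bθ ^ 2 * Y + 13824 * K ^ 6 * Bθ ^ 4 / ν ^ 3 * E ^ 2 * Y := hT2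
  have hψ4 : ∫ x, fderiv ℝ ψ x (V x) * ‖curl V x‖ ^ 2 =
      ∫ x, fderiv ℝ (fun y => θ y ^ 4) x (V x) * ‖curl V x‖ ^ 2 := by rw [hψdef]
  rw [hψ4]
  have hνA := mul_le_mul_of_nonneg_left hvisc' hν.le
  have hνD := mul_le_mul_of_nonneg_left hD'D hν.le
  have hCT0 : 0 ≤ 13824 * K ^ 6 * Bθ ^ 4 / ν ^ 3 * E ^ 2 := by positivity
  have hx1 : 13824 * K ^ 6 * Bθ ^ 4 / ν ^ 3 * E ^ 2 * Y ≤
      13824 * K ^ 6 * Bθ ^ 4 / ν ^ 3 * E ^ 2 * (Y + F) :=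
    mul_le_mul_of_nonneg_left (by linarith) hCT0
  have hνB0 : 0 ≤ ν * Bθ ^ 2 := by positivity
  have hx2 : ν * Bθ ^ 2 * Y ≤ ν * Bθ ^ 2 * (Y + F) := mul_le_mul_of_nonneg_left (by linarith) hνB0
  have hνDφ : 0 ≤ ν * Dφ := mul_nonneg hν.le hDφ0'
  linarith only [hνA, hνD, hT2', hstretch, hx1, hx2, hνDφ]

/-! ### The local enstrophy balance -/

/-- **The local enstrophy balance of a Leray–Hopf solution on a cylinder of smoothness under
½-Hölder coherence of the vorticity direction, with the weight's regularity recorded** (Grujić 2009, §4 p. 865 and the proof of Thm. 1,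
pp. 866–868, in pointwise-in-time form). Let `u` be a Leray–Hopf weak solution (viscosity
`ν > 0`, no force) on `[0, T)`, jointly `C^∞` on `I × S` (`I ⊆ (0,T)`, `S` open), let
`B̄(c, 12s) ⊆ S`, and suppose that for every `t ∈ I` and all `x, y ∈ B(c, 6s)` with
`|ω(x,t)|, |ω(y,t)| > M_h` one has `√(1 − ⟪ξ(x,t), ξ(y,t)⟫²) ≤ K_h|x − y|^{1/2}`
(`ξ = ω/|ω|`). Then there are a continuous weight `φ` with `0 ≤ φ ≤ 1`, `φ = 1` on `B(c, s/2)`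
and `tsupport φ ⊆ B̄(c, s)` (the square of a `C¹` ball cut-off), a function `D` continuous on
`I`, and constants
`A₀, A₁, B₀, B₁ ≥ 0` such that: the local sizes `Y(t) = ∫_{B̄(c,6s)}|ω(t)|²`,
`F(t) = ∫_{B̄(c,6s)}‖∇u(t)‖²`, `E(t) = ∫_{B̄(c,6s)}|u(t)|²` are continuous on `I`; for every
`t ∈ I`, `t ↦ ∫φ²|ω(t)|²` has derivative `D(t)` at `t`; and
`D(t) ≤ (A₀ + A₁(Y + F + E)(t)) ∫φ²|ω(t)|² + (B₀ + B₁E(t)²)(Y + F)(t)`.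
(Grujić: "multiplying the vorticity equations (2) by `ψ²ω` and integrating … `= T₁ + T₂ + T₃`",
with (5), (6) and the depletion estimate of `T₃`; the module docstring records the deviations.) [cite: Grujic2009, §4 p. 865 ((5), (6)) and Thm. 1 proof pp. 866–868] -/
theorem IsLerayHopfOn.exists_weight_localEnstrophy_deriv_le {T ν : ℝ} (hν : 0 < ν)
    {u₀ : (EuclideanSpace ℝ (Fin 3)) → (EuclideanSpace ℝ (Fin 3))}
    {u : ℝ → (EuclideanSpace ℝ (Fin 3)) → (EuclideanSpace ℝ (Fin 3))}
    (hLH : IsLerayHopfOn T ν 0 u₀ u) {I : Set ℝ} {S : Set (EuclideanSpace ℝ (Fin 3))}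
    (hI : IsOpen I) (hS : IsOpen S) (hIT : I ⊆ Ioo 0 T)
    (hu : ContDiffOn ℝ ∞ (uncurry u) (I ×ˢ S))
    (c : (EuclideanSpace ℝ (Fin 3))) {s : ℝ} (hs : 0 < s) (hcS : closedBall c (12 * s) ⊆ S)
    {Kh Mh : ℝ} (hMh : 0 < Mh)
    (hdir : ∀ t ∈ I, ∀ x ∈ ball c (6 * s), ∀ y ∈ ball c (6 * s),
      Mh < ‖curl (u t) x‖ → Mh < ‖curl (u t) y‖ →
        Real.sqrt (1 - ⟪vorticityDirection (curl (u t)) x, vorticityDirection (curl (u t)) y⟫ ^ 2) ≤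
          Kh * Real.sqrt ‖x - y‖) :
    ∃ (φ : (EuclideanSpace ℝ (Fin 3)) → ℝ) (D : ℝ → ℝ) (A₀ A₁ B₀ B₁ : ℝ),
      (∀ x ∈ ball c (s / 2), φ x = 1) ∧ (∀ x, 0 ≤ φ x ∧ φ x ≤ 1) ∧
      0 ≤ A₀ ∧ 0 ≤ A₁ ∧ 0 ≤ B₀ ∧ 0 ≤ B₁ ∧
      Continuous φ ∧ tsupport φ ⊆ closedBall c s ∧
      ContinuousOn (fun t => ∫ x in closedBall c (6 * s), ‖curl (u t) x‖ ^ 2) I ∧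
      ContinuousOn (fun t => ∫ x in closedBall c (6 * s), ‖fderiv ℝ (u t) x‖ ^ 2) I ∧
      ContinuousOn (fun t => ∫ x in closedBall c (6 * s), ‖u t x‖ ^ 2) I ∧
      ContinuousOn D I ∧
      (∀ t ∈ I, HasDerivAt (fun t' => ∫ x, φ x ^ 2 * ‖curl (u t') x‖ ^ 2) (D t) t) ∧
      ∀ t ∈ I, D t ≤
        (A₀ + A₁ * ((∫ x in closedBall c (6 * s), ‖curl (u t) x‖ ^ 2) +
            (∫ x in closedBall c (6 * s), ‖fderiv ℝ (u t) x‖ ^ 2) +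
            (∫ x in closedBall c (6 * s), ‖u t x‖ ^ 2))) * (∫ x, φ x ^ 2 * ‖curl (u t) x‖ ^ 2) +
        (B₀ + B₁ * (∫ x in closedBall c (6 * s), ‖u t x‖ ^ 2) ^ 2) *
          ((∫ x in closedBall c (6 * s), ‖curl (u t) x‖ ^ 2) +
            (∫ x in closedBall c (6 * s), ‖fderiv ℝ (u t) x‖ ^ 2)) := by
  set O : Set (ℝ × (EuclideanSpace ℝ (Fin 3))) := I ×ˢ S with hOdef
  have hO : IsOpen O := hI.prod hS
  -- ### the classical vorticity equation and the joint continuity on `I × S`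
  obtain ⟨hdiv, hU0, hDU, hω0, hDω, hΔω, hderiv⟩ := hLH.vorticity_classical_of_contDiffOn hI hS hIT hu
  -- the right-hand side `g`
  obtain ⟨g, hg⟩ : ∃ g : ℝ → (EuclideanSpace ℝ (Fin 3)) → (EuclideanSpace ℝ (Fin 3)), ∀ t x, g t x =
      ν • Δ (curl (u t)) x - convect (u t) (curl (u t)) x + convect (curl (u t)) (u t) x :=
    ⟨_, fun _ _ => rfl⟩
  have hgc : ContinuousOn (uncurry g) O := by
    have e : uncurry g = fun w : ℝ × (EuclideanSpace ℝ (Fin 3)) => ν • Δ (curl (u w.1)) w.2 -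
        fderiv ℝ (curl (u w.1)) w.2 (u w.1 w.2) + fderiv ℝ (u w.1) w.2 (curl (u w.1) w.2) := by
      funext w
      exact hg w.1 w.2
    rw [e]
    exact ((hΔω.const_smul ν).sub (hDω.clm_apply hU0)).add (hDU.clm_apply hω0)
  have hderiv' : ∀ t ∈ I, ∀ x ∈ S, HasDerivAt (fun s' => curl (u s') x) (g t x) t := by
    intro t ht x hx; rw [hg t x]; exact hderiv t ht x hx
  -- ### geometry
  have h6S : closedBall c (6 * s) ⊆ S := (closedBall_subset_closedBall (by linarith)).trans hcS
  have hsub1 : closedBall c s ⊆ ball c (6 * s) := fun x hx => by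
    rw [mem_closedBall] at hx; rw [mem_ball]; linarith
  have hsub2 : ball c (6 * s) ⊆ closedBall c (6 * s) := ball_subset_closedBall
  -- ### the weight `θ = ballCutoff c (s/4)`, `φ = θ²`
  have hs4 : 0 < s / 4 := by positivity
  set θ : (EuclideanSpace ℝ (Fin 3)) → ℝ := ballCutoff c (s / 4) with hθdef
  have hθ1 : ContDiff ℝ 1 θ := contDiff_ballCutoff c (s / 4)
  have hθ01 : ∀ x, 0 ≤ θ x ∧ θ x ≤ 1 := fun x => ⟨ballCutoff_nonneg _ _ _, ballCutoff_le_one _ _ _⟩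
  have hθone : ∀ x ∈ ball c (s / 2), θ x = 1 := fun x hx => by
    have hx' : x ∈ ball c (2 * (s / 4)) := by rw [show 2 * (s / 4) = s / 2 by ring]; exact hx
    exact (ballCutoff_eventuallyEq_one hs4 hx').eq_of_nhds
  have hθs : tsupport θ ⊆ closedBall c s := by
    refine closure_minimal (fun x hx => ?_) isClosed_closedBall
    by_contra h
    rw [mem_closedBall, dist_eq_norm, not_le] at h
    exact hx (ballCutoff_eq_zero hs4 (by linarith))
  have hθc : HasCompactSupport θ :=
    (isCompact_closedBall c s).of_isClosed_subset (isClosed_tsupport θ) hθs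
  obtain ⟨Bθ', hBθ'⟩ := (hθ1.continuous_fderiv one_ne_zero).bounded_above_of_compact_support
    (hθc.fderiv (𝕜 := ℝ))
  set Bθ : ℝ := max Bθ' 0 with hBθdef
  have hBθ0 : 0 ≤ Bθ := le_max_right _ _
  have hBθ : ∀ x, ‖fderiv ℝ θ x‖ ≤ Bθ := fun x => (hBθ' x).trans (le_max_left _ _)
  set φ : (EuclideanSpace ℝ (Fin 3)) → ℝ := fun x => θ x ^ 2 with hφdef
  have hφ1 : ContDiff ℝ 1 φ := hθ1.pow 2
  have hφcont : Continuous φ := hφ1.continuous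
  have hφ01 : ∀ x, 0 ≤ φ x ∧ φ x ≤ 1 := fun x => by
    have h0 := (hθ01 x).1; have h1 := (hθ01 x).2
    exact ⟨by positivity, by show θ x ^ 2 ≤ 1; nlinarith⟩
  have hφs : tsupport φ ⊆ closedBall c s := by
    refine (closure_mono fun x hx => ?_).trans hθs
    rw [mem_support] at hx ⊢
    intro h; apply hx; show θ x ^ 2 = 0; rw [h]; ring
  have hφc : HasCompactSupport φ :=
    (isCompact_closedBall c s).of_isClosed_subset (isClosed_tsupport φ) hφs
  have hφS : tsupport φ ⊆ S := hφs.trans (hsub1.trans (hsub2.trans h6S))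
  have hφx : ∀ x, φ x ≠ 0 → x ∈ closedBall c s := fun x hx => hφs (subset_tsupport _ (mem_support.2 hx))
  -- ### the constants of the stretching estimate
  obtain ⟨C₁, C₂, C₃, C₄, hC₁, hC₂, hC₃, hC₄, hF2⟩ :=
    exists_localized_stretching_le_of_holderHalf c hs (half_pos hν) hMh Kh hφ1 hφ01 hφs
  set K : ℝ := ((SNormLESNormFDerivOfEqConst (EuclideanSpace ℝ (Fin 3))
    (volume : Measure (EuclideanSpace ℝ (Fin 3))) 2 : ℝ≥0) : ℝ) + 1 with hK
  have hK0 : 0 < K := by rw [hK]; positivity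
  -- ### the derivative `D`
  set D : ℝ → ℝ := fun t => ∫ x, 2 * (φ x ^ 2 * ⟪curl (u t) x, g t x⟫) with hDdef
  refine ⟨φ, D, C₁, C₂ + C₃, 49 * ν * Bθ ^ 2 + C₄, 13824 * K ^ 6 * Bθ ^ 4 / ν ^ 3,
    fun x hx => by show θ x ^ 2 = 1; rw [hθone x hx]; ring, hφ01, hC₁, add_nonneg hC₂ hC₃,
    by positivity, by positivity, hφcont, hφs, ?_, ?_, ?_, ?_, fun t ht => ?_, fun t ht => ?_⟩
  -- continuity of the local sizes
  · have h12 : closedBall c (2 * (6 * s)) ⊆ S := by rw [show 2 * (6 * s) = 12 * s by ring]; exact hcS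
    have hc : ContinuousOn (uncurry fun t x => ‖curl (u t) x‖ ^ 2) O :=
      fun w hw => ((hω0 w hw).norm).pow 2
    exact continuousOn_setIntegral_closedBall hI hS hc (by positivity) h12
  · have h12 : closedBall c (2 * (6 * s)) ⊆ S := by rw [show 2 * (6 * s) = 12 * s by ring]; exact hcS
    have hc : ContinuousOn (uncurry fun t x => ‖fderiv ℝ (u t) x‖ ^ 2) O :=
      fun w hw => ((hDU w hw).norm).pow 2
    exact continuousOn_setIntegral_closedBall hI hS hc (by positivity) h12
  · have h12 : closedBall c (2 * (6 * s)) ⊆ S := by rw [show 2 * (6 * s) = 12 * s by ring]; exact hcS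
    have hc : ContinuousOn (uncurry fun t x => ‖u t x‖ ^ 2) O :=
      fun w hw => ((hU0 w hw).norm).pow 2
    exact continuousOn_setIntegral_closedBall hI hS hc (by positivity) h12
  -- continuity of `D`
  · have h := continuousOn_integral_sq_mul hI hS (H := fun t x => 2 * ⟪curl (u t) x, g t x⟫)
      (continuousOn_const.mul (hω0.inner hgc)) hφcont hφc hφS
    refine h.congr fun t _ => ?_
    exact integral_congr_ae (Eventually.of_forall fun x => by
      show 2 * (φ x ^ 2 * ⟪curl (u t) x, g t x⟫) = φ x ^ 2 * (2 * ⟪curl (u t) x, g t x⟫); ring)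
  -- the derivative
  · exact hasDerivAt_integral_sq_mul_norm_sq hI hS (w := fun t x => curl (u t) x) hω0 hgc hderiv'
      hφcont hφc hφS ht
  -- ### the inequality at the time `t`: globalize the slice near `B̄(c, 6s)`
  have hut : ContDiffOn ℝ ∞ (u t) S := contDiffOn_slice_of_contDiffOn_prod hu ht
  obtain ⟨V, hV, N, hNo, hKN, hNS, hVu⟩ :=
    ContDiffOn.exists_contDiff_eqOn_nhds_of_isCompact hut hS (isCompact_closedBall c (6 * s)) h6S
  have hV3 : ContDiff ℝ 3 V := contDiff_infty.1 hV 3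
  have hV2 : ContDiff ℝ 2 V := hV3.of_le (by norm_num)
  -- transfer of values and derivatives on the open set `N ⊇ B̄(c, 6s)`
  have hVeq : ∀ x ∈ N, V x = u t x := fun x hx => hVu hx
  have hVev : ∀ x ∈ N, V =ᶠ[𝓝 x] u t := fun x hx =>
    eventuallyEq_of_mem (hNo.mem_nhds hx) hVu
  have hDVeq : ∀ x ∈ N, fderiv ℝ V x = fderiv ℝ (u t) x := fun x hx => (hVev x hx).fderiv_eq
  have hcurl : ∀ x ∈ N, curl V x = curl (u t) x := fun x hx => by
    rw [curl_eq_curlCLM, curl_eq_curlCLM, hDVeq x hx]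
  have hcurl_ev : ∀ x ∈ N, curl V =ᶠ[𝓝 x] curl (u t) := fun x hx => by
    filter_upwards [hNo.mem_nhds hx] with y hy using hcurl y hy
  have hDcurl : ∀ x ∈ N, fderiv ℝ (curl V) x = fderiv ℝ (curl (u t)) x := fun x hx =>
    (hcurl_ev x hx).fderiv_eq
  have hΔ : ∀ x ∈ N, Δ (curl V) x = Δ (curl (u t)) x := fun x hx =>
    (laplacian_congr_nhds (hcurl_ev x hx)).eq_of_nhds
  have hdir_eq : ∀ x ∈ N, vorticityDirection (curl V) x = vorticityDirection (curl (u t)) x :=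
    fun x hx => by simp only [vorticityDirection, hcurl x hx]
  -- the hypotheses of the slice inequality for `V`
  have hballN : ball c (6 * s) ⊆ N := hsub2.trans hKN
  have hdivV : ∀ y ∈ ball c (6 * s), VectorCalculus.divergence V y = 0 := fun y hy => by
    have e : VectorCalculus.divergence V y = VectorCalculus.divergence (u t) y := by
      simp only [VectorCalculus.divergence, hDVeq y (hballN hy)]
    rw [e]; exact hdiv t ht y (h6S (hsub2 hy))
  have hdirV : ∀ x ∈ ball c (6 * s), ∀ y ∈ ball c (6 * s), Mh < ‖curl V x‖ → Mh < ‖curl V y‖ →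
      Real.sqrt (1 - ⟪vorticityDirection (curl V) x, vorticityDirection (curl V) y⟫ ^ 2) ≤
        Kh * Real.sqrt ‖x - y‖ := by
    intro x hx y hy hMx hMy
    rw [hdir_eq x (hballN hx), hdir_eq y (hballN hy)]
    rw [hcurl x (hballN hx)] at hMx
    rw [hcurl y (hballN hy)] at hMy
    exact hdir t ht x hx y hy hMx hMy
  have hstretch := hF2 hV2 hdivV hdirV
  have hslice := localEnstrophy_slice_le c hs hν hθ1 hθ01 hθs hBθ0 hBθ hV3 hdivV hstretch
  -- ### identify the `V`-quantities with the `u t`-quantities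
  have eY : ∫ x in closedBall c (6 * s), ‖curl V x‖ ^ 2 = ∫ x in closedBall c (6 * s), ‖curl (u t) x‖ ^ 2 :=
    setIntegral_congr_fun measurableSet_closedBall fun x hx => by rw [hcurl x (hKN hx)]
  have eF : ∫ x in closedBall c (6 * s), ‖fderiv ℝ V x‖ ^ 2 =
      ∫ x in closedBall c (6 * s), ‖fderiv ℝ (u t) x‖ ^ 2 :=
    setIntegral_congr_fun measurableSet_closedBall fun x hx => by rw [hDVeq x (hKN hx)]
  have eE : ∫ x in closedBall c (6 * s), ‖V x‖ ^ 2 = ∫ x in closedBall c (6 * s), ‖u t x‖ ^ 2 :=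
    setIntegral_congr_fun measurableSet_closedBall fun x hx => by rw [hVeq x (hKN hx)]
  have hN_of_φ : ∀ x, φ x ≠ 0 → x ∈ N := fun x hx => hKN (hsub2 (hsub1 (hφx x hx)))
  have eYφ : ∫ x, (θ x ^ 2) ^ 2 * ‖curl V x‖ ^ 2 = ∫ x, φ x ^ 2 * ‖curl (u t) x‖ ^ 2 := by
    refine integral_congr_ae (Eventually.of_forall fun x => ?_)
    show φ x ^ 2 * ‖curl V x‖ ^ 2 = φ x ^ 2 * ‖curl (u t) x‖ ^ 2
    by_cases hx : φ x = 0
    · rw [hx]; ring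
    · rw [hcurl x (hN_of_φ x hx)]
  have eD : ∫ x, 2 * ((θ x ^ 2) ^ 2 * ⟪curl V x,
      ν • Δ (curl V) x - convect V (curl V) x + convect (curl V) V x⟫) = D t := by
    refine integral_congr_ae (Eventually.of_forall fun x => ?_)
    show 2 * (φ x ^ 2 * ⟪curl V x, ν • Δ (curl V) x - convect V (curl V) x + convect (curl V) V x⟫) =
      2 * (φ x ^ 2 * ⟪curl (u t) x, g t x⟫)
    by_cases hx : φ x = 0
    · rw [hx]; ring
    · have hxN := hN_of_φ x hx
      rw [hg t x]
      simp only [convect, hcurl x hxN, hΔ x hxN, hDcurl x hxN, hDVeq x hxN, hVeq x hxN]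
  rw [eY, eF, eE, eYφ, eD] at hslice
  -- ### the final comparison of coefficients
  set Y : ℝ := ∫ x in closedBall c (6 * s), ‖curl (u t) x‖ ^ 2 with hY
  set F : ℝ := ∫ x in closedBall c (6 * s), ‖fderiv ℝ (u t) x‖ ^ 2 with hF
  set E : ℝ := ∫ x in closedBall c (6 * s), ‖u t x‖ ^ 2 with hE
  set Yφ : ℝ := ∫ x, φ x ^ 2 * ‖curl (u t) x‖ ^ 2 with hYφ
  have hY0 : 0 ≤ Y := setIntegral_nonneg measurableSet_closedBall fun x _ => by positivity
  have hF0 : 0 ≤ F := setIntegral_nonneg measurableSet_closedBall fun x _ => by positivity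
  have hE0 : 0 ≤ E := setIntegral_nonneg measurableSet_closedBall fun x _ => by positivity
  have hYφ0 : 0 ≤ Yφ := integral_nonneg fun x => by positivity
  have h1 : (C₁ + C₂ * (Y + F) + C₃ * E) * Yφ ≤ (C₁ + (C₂ + C₃) * (Y + F + E)) * Yφ := by
    apply mul_le_mul_of_nonneg_right _ hYφ0
    nlinarith [mul_nonneg hC₂ hE0, mul_nonneg hC₃ (add_nonneg hY0 hF0)]
  linarith only [hslice, h1]

/-- **The local enstrophy balance of a Leray–Hopf solution on a cylinder of smoothness under
½-Hölder coherence of the vorticity direction** (Grujić 2009, §4 p. 865 and the proof of Thm. 1,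
pp. 866–868, in pointwise-in-time form). Let `u` be a Leray–Hopf weak solution (viscosity
`ν > 0`, no force) on `[0, T)`, jointly `C^∞` on `I × S` (`I ⊆ (0,T)`, `S` open), let
`B̄(c, 12s) ⊆ S`, and suppose that for every `t ∈ I` and all `x, y ∈ B(c, 6s)` with
`|ω(x,t)|, |ω(y,t)| > M_h` one has `√(1 − ⟪ξ(x,t), ξ(y,t)⟫²) ≤ K_h|x − y|^{1/2}`
(`ξ = ω/|ω|`). Then there are a weight `φ` with `0 ≤ φ ≤ 1` and `φ = 1` on `B(c, s/2)`, a function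
`D` continuous on `I`, and constants `A₀, A₁, B₀, B₁ ≥ 0` such that: the local sizes
`Y(t) = ∫_{B̄(c,6s)}|ω(t)|²`, `F(t) = ∫_{B̄(c,6s)}‖∇u(t)‖²`, `E(t) = ∫_{B̄(c,6s)}|u(t)|²` are
continuous on `I`; for every `t ∈ I`, `t ↦ ∫φ²|ω(t)|²` has derivative `D(t)` at `t`; and
`D(t) ≤ (A₀ + A₁(Y + F + E)(t)) ∫φ²|ω(t)|² + (B₀ + B₁E(t)²)(Y + F)(t)` (the projection of
`IsLerayHopfOn.exists_weight_localEnstrophy_deriv_le` forgetting the regularity of `φ`). [cite: Grujic2009, §4 p. 865 ((5), (6)) and Thm. 1 proof pp. 866–868] -/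
theorem IsLerayHopfOn.exists_localEnstrophy_deriv_le {T ν : ℝ} (hν : 0 < ν)
    {u₀ : (EuclideanSpace ℝ (Fin 3)) → (EuclideanSpace ℝ (Fin 3))}
    {u : ℝ → (EuclideanSpace ℝ (Fin 3)) → (EuclideanSpace ℝ (Fin 3))}
    (hLH : IsLerayHopfOn T ν 0 u₀ u) {I : Set ℝ} {S : Set (EuclideanSpace ℝ (Fin 3))}
    (hI : IsOpen I) (hS : IsOpen S) (hIT : I ⊆ Ioo 0 T)
    (hu : ContDiffOn ℝ ∞ (uncurry u) (I ×ˢ S))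
    (c : (EuclideanSpace ℝ (Fin 3))) {s : ℝ} (hs : 0 < s) (hcS : closedBall c (12 * s) ⊆ S)
    {Kh Mh : ℝ} (hMh : 0 < Mh)
    (hdir : ∀ t ∈ I, ∀ x ∈ ball c (6 * s), ∀ y ∈ ball c (6 * s),
      Mh < ‖curl (u t) x‖ → Mh < ‖curl (u t) y‖ →
        Real.sqrt (1 - ⟪vorticityDirection (curl (u t)) x, vorticityDirection (curl (u t)) y⟫ ^ 2) ≤
          Kh * Real.sqrt ‖x - y‖) :
    ∃ (φ : (EuclideanSpace ℝ (Fin 3)) → ℝ) (D : ℝ → ℝ) (A₀ A₁ B₀ B₁ : ℝ),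
      (∀ x ∈ ball c (s / 2), φ x = 1) ∧ (∀ x, 0 ≤ φ x ∧ φ x ≤ 1) ∧
      0 ≤ A₀ ∧ 0 ≤ A₁ ∧ 0 ≤ B₀ ∧ 0 ≤ B₁ ∧
      ContinuousOn (fun t => ∫ x in closedBall c (6 * s), ‖curl (u t) x‖ ^ 2) I ∧
      ContinuousOn (fun t => ∫ x in closedBall c (6 * s), ‖fderiv ℝ (u t) x‖ ^ 2) I ∧
      ContinuousOn (fun t => ∫ x in closedBall c (6 * s), ‖u t x‖ ^ 2) I ∧
      ContinuousOn D I ∧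
      (∀ t ∈ I, HasDerivAt (fun t' => ∫ x, φ x ^ 2 * ‖curl (u t') x‖ ^ 2) (D t) t) ∧
      ∀ t ∈ I, D t ≤
        (A₀ + A₁ * ((∫ x in closedBall c (6 * s), ‖curl (u t) x‖ ^ 2) +
            (∫ x in closedBall c (6 * s), ‖fderiv ℝ (u t) x‖ ^ 2) +
            (∫ x in closedBall c (6 * s), ‖u t x‖ ^ 2))) * (∫ x, φ x ^ 2 * ‖curl (u t) x‖ ^ 2) +
        (B₀ + B₁ * (∫ x in closedBall c (6 * s), ‖u t x‖ ^ 2) ^ 2) *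
          ((∫ x in closedBall c (6 * s), ‖curl (u t) x‖ ^ 2) +
            (∫ x in closedBall c (6 * s), ‖fderiv ℝ (u t) x‖ ^ 2)) := by
  obtain ⟨φ, D, A₀, A₁, B₀, B₁, h1, h01, hA₀, hA₁, hB₀, hB₁, -, -, hY, hF, hE, hD, hder, hle⟩ :=
    hLH.exists_weight_localEnstrophy_deriv_le hν hI hS hIT hu c hs hcS hMh hdir
  exact ⟨φ, D, A₀, A₁, B₀, B₁, h1, h01, hA₀, hA₁, hB₀, hB₁, hY, hF, hE, hD, hder, hle⟩

/-! ### The local enstrophy balance under a local Hölder coherence compensated by a local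
Lebesgue bound on the vorticity (Grujić–Zhang 2006, Thm. 1.1) -/

set_option maxHeartbeats 800000 in
/-- **The local enstrophy balance of a Leray–Hopf solution on a cylinder of smoothness under an
`α`-Hölder coherence of the vorticity direction compensated by a local `L^r` bound on the
vorticity** (Grujić–Zhang 2006, proof of Thm. 1.1: §2 (2.4)–(2.6) and §3 (3.2)–(3.10), pp. 558–563,
there `α = 1/q`, `r = q`; here in pointwise-in-time form and for a general pair `(α, r)` on Chae's
scaling line, `0 < α`, `1 < r`, `αr < 3`, `1/r < (2+α)/3`, `θ = 1 + α/2 − (3/2)(1/r)`). Let `u` be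
a Leray–Hopf weak solution (viscosity `ν > 0`, no force) on `[0, T)`, jointly `C^∞` on `I × S`
(`I ⊆ (0,T)`, `S` open), let `B̄(c, 12s) ⊆ S`, and suppose that for every `t ∈ I` and all
`x, y ∈ B(c, 6s)` with `|ω(x,t)|, |ω(y,t)| > M_h` one has
`√(1 − ⟪ξ(x,t), ξ(y,t)⟫²) ≤ K_h|x − y|^α` (`ξ = ω/|ω|`). Then there are a continuous weight `φ`
with `0 ≤ φ ≤ 1`, `φ = 1` on `B(c, s/2)` and `tsupport φ ⊆ B̄(c, s)`, a function `D` continuous on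
`I`, and constants `A₀, A₁, A₂, B₀, B₁ ≥ 0` such that: the local sizes
`Y(t) = ∫_{B̄(c,6s)}|ω(t)|²`, `F(t) = ∫_{B̄(c,6s)}‖∇u(t)‖²`, `E(t) = ∫_{B̄(c,6s)}|u(t)|²` and
`∫_{B̄(c,6s)}|ω(t)|^r` are continuous on `I`; for every `t ∈ I`, `t ↦ ∫φ²|ω(t)|²` has derivative
`D(t)` at `t`; and
`D(t) ≤ (A₀ + A₁(Y + F + E)(t) + A₂ (∫_{B̄(c,6s)}|ω(t)|^r)^{1/(rθ)}) ∫φ²|ω(t)|² + (B₀ + B₁E(t)²)(Y + F)(t)`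
— Grujić–Zhang's (2.4) with (2.6), (3.3) and (3.9)–(3.10), whose weight
`‖ω‖_{L^{q}(B)}^{q/(q−1)}` is `(∫_B|ω|^q)^{1/(q−1)}` (`rθ = q − 1`); the stretching term from
`exists_localized_stretching_le_of_holderExp_of_vorticity_Lr`, the viscous and transport terms as
in `IsLerayHopfOn.exists_weight_localEnstrophy_deriv_le` (module docstring for the deviations). [cite: GrujicZhang2006, Thm. 1.1 proof §2 (2.4)–(2.6), §3 (3.2)–(3.10) (pp. 558–563); Grujic2009, §4 p. 865 ((5), (6))] -/
theorem IsLerayHopfOn.exists_weight_localEnstrophy_deriv_le_hybrid {T ν : ℝ} (hν : 0 < ν)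
    {u₀ : (EuclideanSpace ℝ (Fin 3)) → (EuclideanSpace ℝ (Fin 3))}
    {u : ℝ → (EuclideanSpace ℝ (Fin 3)) → (EuclideanSpace ℝ (Fin 3))}
    (hLH : IsLerayHopfOn T ν 0 u₀ u) {I : Set ℝ} {S : Set (EuclideanSpace ℝ (Fin 3))}
    (hI : IsOpen I) (hS : IsOpen S) (hIT : I ⊆ Ioo 0 T)
    (hu : ContDiffOn ℝ ∞ (uncurry u) (I ×ˢ S))
    (c : (EuclideanSpace ℝ (Fin 3))) {s : ℝ} (hs : 0 < s) (hcS : closedBall c (12 * s) ⊆ S)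
    {α r θ : ℝ} (hα : 0 < α) (hr : 1 < r) (hαr : α * r < 3) (hup : 1 / r < (2 + α) / 3)
    (hθ : θ = 1 + α / 2 - 3 / 2 * (1 / r))
    {Kh Mh : ℝ} (hMh : 0 < Mh)
    (hdir : ∀ t ∈ I, ∀ x ∈ ball c (6 * s), ∀ y ∈ ball c (6 * s),
      Mh < ‖curl (u t) x‖ → Mh < ‖curl (u t) y‖ →
        Real.sqrt (1 - ⟪vorticityDirection (curl (u t)) x, vorticityDirection (curl (u t)) y⟫ ^ 2) ≤
          Kh * ‖x - y‖ ^ α) :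
    ∃ (φ : (EuclideanSpace ℝ (Fin 3)) → ℝ) (D : ℝ → ℝ) (A₀ A₁ A₂ B₀ B₁ : ℝ),
      (∀ x ∈ ball c (s / 2), φ x = 1) ∧ (∀ x, 0 ≤ φ x ∧ φ x ≤ 1) ∧
      0 ≤ A₀ ∧ 0 ≤ A₁ ∧ 0 ≤ A₂ ∧ 0 ≤ B₀ ∧ 0 ≤ B₁ ∧
      Continuous φ ∧ tsupport φ ⊆ closedBall c s ∧
      ContinuousOn (fun t => ∫ x in closedBall c (6 * s), ‖curl (u t) x‖ ^ 2) I ∧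
      ContinuousOn (fun t => ∫ x in closedBall c (6 * s), ‖fderiv ℝ (u t) x‖ ^ 2) I ∧
      ContinuousOn (fun t => ∫ x in closedBall c (6 * s), ‖u t x‖ ^ 2) I ∧
      ContinuousOn (fun t => ∫ x in closedBall c (6 * s), ‖curl (u t) x‖ ^ r) I ∧
      ContinuousOn D I ∧
      (∀ t ∈ I, HasDerivAt (fun t' => ∫ x, φ x ^ 2 * ‖curl (u t') x‖ ^ 2) (D t) t) ∧
      ∀ t ∈ I, D t ≤
        (A₀ + A₁ * ((∫ x in closedBall c (6 * s), ‖curl (u t) x‖ ^ 2) +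
            (∫ x in closedBall c (6 * s), ‖fderiv ℝ (u t) x‖ ^ 2) +
            (∫ x in closedBall c (6 * s), ‖u t x‖ ^ 2)) +
          A₂ * (∫ x in closedBall c (6 * s), ‖curl (u t) x‖ ^ r) ^ (1 / (r * θ))) *
          (∫ x, φ x ^ 2 * ‖curl (u t) x‖ ^ 2) +
        (B₀ + B₁ * (∫ x in closedBall c (6 * s), ‖u t x‖ ^ 2) ^ 2) *
          ((∫ x in closedBall c (6 * s), ‖curl (u t) x‖ ^ 2) +
            (∫ x in closedBall c (6 * s), ‖fderiv ℝ (u t) x‖ ^ 2)) := by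
  set O : Set (ℝ × (EuclideanSpace ℝ (Fin 3))) := I ×ˢ S with hOdef
  have hO : IsOpen O := hI.prod hS
  have hr0 : 0 < r := by linarith
  -- ### the classical vorticity equation and the joint continuity on `I × S`
  obtain ⟨hdiv, hU0, hDU, hω0, hDω, hΔω, hderiv⟩ := hLH.vorticity_classical_of_contDiffOn hI hS hIT hu
  -- the right-hand side `g`
  obtain ⟨g, hg⟩ : ∃ g : ℝ → (EuclideanSpace ℝ (Fin 3)) → (EuclideanSpace ℝ (Fin 3)), ∀ t x, g t x =
      ν • Δ (curl (u t)) x - convect (u t) (curl (u t)) x + convect (curl (u t)) (u t) x :=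
    ⟨_, fun _ _ => rfl⟩
  have hgc : ContinuousOn (uncurry g) O := by
    have e : uncurry g = fun w : ℝ × (EuclideanSpace ℝ (Fin 3)) => ν • Δ (curl (u w.1)) w.2 -
        fderiv ℝ (curl (u w.1)) w.2 (u w.1 w.2) + fderiv ℝ (u w.1) w.2 (curl (u w.1) w.2) := by
      funext w
      exact hg w.1 w.2
    rw [e]
    exact ((hΔω.const_smul ν).sub (hDω.clm_apply hU0)).add (hDU.clm_apply hω0)
  have hderiv' : ∀ t ∈ I, ∀ x ∈ S, HasDerivAt (fun s' => curl (u s') x) (g t x) t := by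
    intro t ht x hx; rw [hg t x]; exact hderiv t ht x hx
  -- ### geometry
  have h6S : closedBall c (6 * s) ⊆ S := (closedBall_subset_closedBall (by linarith)).trans hcS
  have hsub1 : closedBall c s ⊆ ball c (6 * s) := fun x hx => by
    rw [mem_closedBall] at hx; rw [mem_ball]; linarith
  have hsub2 : ball c (6 * s) ⊆ closedBall c (6 * s) := ball_subset_closedBall
  -- ### the weight `θ = ballCutoff c (s/4)`, `φ = θ²`
  have hs4 : 0 < s / 4 := by positivity
  set θc : (EuclideanSpace ℝ (Fin 3)) → ℝ := ballCutoff c (s / 4) with hθcdef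
  have hθ1 : ContDiff ℝ 1 θc := contDiff_ballCutoff c (s / 4)
  have hθ01 : ∀ x, 0 ≤ θc x ∧ θc x ≤ 1 := fun x => ⟨ballCutoff_nonneg _ _ _, ballCutoff_le_one _ _ _⟩
  have hθone : ∀ x ∈ ball c (s / 2), θc x = 1 := fun x hx => by
    have hx' : x ∈ ball c (2 * (s / 4)) := by rw [show 2 * (s / 4) = s / 2 by ring]; exact hx
    exact (ballCutoff_eventuallyEq_one hs4 hx').eq_of_nhds
  have hθs : tsupport θc ⊆ closedBall c s := by
    refine closure_minimal (fun x hx => ?_) isClosed_closedBall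
    by_contra h
    rw [mem_closedBall, dist_eq_norm, not_le] at h
    exact hx (ballCutoff_eq_zero hs4 (by linarith))
  have hθc : HasCompactSupport θc :=
    (isCompact_closedBall c s).of_isClosed_subset (isClosed_tsupport θc) hθs
  obtain ⟨Bθ', hBθ'⟩ := (hθ1.continuous_fderiv one_ne_zero).bounded_above_of_compact_support
    (hθc.fderiv (𝕜 := ℝ))
  set Bθ : ℝ := max Bθ' 0 with hBθdef
  have hBθ0 : 0 ≤ Bθ := le_max_right _ _
  have hBθ : ∀ x, ‖fderiv ℝ θc x‖ ≤ Bθ := fun x => (hBθ' x).trans (le_max_left _ _)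
  set φ : (EuclideanSpace ℝ (Fin 3)) → ℝ := fun x => θc x ^ 2 with hφdef
  have hφ1 : ContDiff ℝ 1 φ := hθ1.pow 2
  have hφcont : Continuous φ := hφ1.continuous
  have hφ01 : ∀ x, 0 ≤ φ x ∧ φ x ≤ 1 := fun x => by
    have h0 := (hθ01 x).1; have h1 := (hθ01 x).2
    exact ⟨by positivity, by show θc x ^ 2 ≤ 1; nlinarith⟩
  have hφs : tsupport φ ⊆ closedBall c s := by
    refine (closure_mono fun x hx => ?_).trans hθs
    rw [mem_support] at hx ⊢
    intro h; apply hx; show θc x ^ 2 = 0; rw [h]; ring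
  have hφc : HasCompactSupport φ :=
    (isCompact_closedBall c s).of_isClosed_subset (isClosed_tsupport φ) hφs
  have hφS : tsupport φ ⊆ S := hφs.trans (hsub1.trans (hsub2.trans h6S))
  have hφx : ∀ x, φ x ≠ 0 → x ∈ closedBall c s := fun x hx => hφs (subset_tsupport _ (mem_support.2 hx))
  -- ### the constants of the hybrid stretching estimate
  obtain ⟨C₁, C₂, C₃, C₄, C₅, hC₁, hC₂, hC₃, hC₄, hC₅, hF2⟩ :=
    exists_localized_stretching_le_of_holderExp_of_vorticity_Lr c hs (half_pos hν) hMh hα hr hαr hup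
      hθ Kh hφ1 hφ01 hφs
  set K : ℝ := ((SNormLESNormFDerivOfEqConst (EuclideanSpace ℝ (Fin 3))
    (volume : Measure (EuclideanSpace ℝ (Fin 3))) 2 : ℝ≥0) : ℝ) + 1 with hK
  have hK0 : 0 < K := by rw [hK]; positivity
  -- ### the derivative `D`
  set D : ℝ → ℝ := fun t => ∫ x, 2 * (φ x ^ 2 * ⟪curl (u t) x, g t x⟫) with hDdef
  refine ⟨φ, D, C₁, C₂ + C₃, C₅, 49 * ν * Bθ ^ 2 + C₄, 13824 * K ^ 6 * Bθ ^ 4 / ν ^ 3,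
    fun x hx => by show θc x ^ 2 = 1; rw [hθone x hx]; ring, hφ01, hC₁, add_nonneg hC₂ hC₃, hC₅,
    by positivity, by positivity, hφcont, hφs, ?_, ?_, ?_, ?_, ?_, fun t ht => ?_, fun t ht => ?_⟩
  -- continuity of the local sizes
  · have h12 : closedBall c (2 * (6 * s)) ⊆ S := by rw [show 2 * (6 * s) = 12 * s by ring]; exact hcS
    have hc : ContinuousOn (uncurry fun t x => ‖curl (u t) x‖ ^ 2) O :=
      fun w hw => ((hω0 w hw).norm).pow 2
    exact continuousOn_setIntegral_closedBall hI hS hc (by positivity) h12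
  · have h12 : closedBall c (2 * (6 * s)) ⊆ S := by rw [show 2 * (6 * s) = 12 * s by ring]; exact hcS
    have hc : ContinuousOn (uncurry fun t x => ‖fderiv ℝ (u t) x‖ ^ 2) O :=
      fun w hw => ((hDU w hw).norm).pow 2
    exact continuousOn_setIntegral_closedBall hI hS hc (by positivity) h12
  · have h12 : closedBall c (2 * (6 * s)) ⊆ S := by rw [show 2 * (6 * s) = 12 * s by ring]; exact hcS
    have hc : ContinuousOn (uncurry fun t x => ‖u t x‖ ^ 2) O :=
      fun w hw => ((hU0 w hw).norm).pow 2
    exact continuousOn_setIntegral_closedBall hI hS hc (by positivity) h12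
  · have h12 : closedBall c (2 * (6 * s)) ⊆ S := by rw [show 2 * (6 * s) = 12 * s by ring]; exact hcS
    have hc : ContinuousOn (uncurry fun t x => ‖curl (u t) x‖ ^ r) O :=
      hω0.norm.rpow_const fun w _ => Or.inr hr0.le
    exact continuousOn_setIntegral_closedBall hI hS hc (by positivity) h12
  -- continuity of `D`
  · have h := continuousOn_integral_sq_mul hI hS (H := fun t x => 2 * ⟪curl (u t) x, g t x⟫)
      (continuousOn_const.mul (hω0.inner hgc)) hφcont hφc hφS
    refine h.congr fun t _ => ?_
    exact integral_congr_ae (Eventually.of_forall fun x => by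
      show 2 * (φ x ^ 2 * ⟪curl (u t) x, g t x⟫) = φ x ^ 2 * (2 * ⟪curl (u t) x, g t x⟫); ring)
  -- the derivative
  · exact hasDerivAt_integral_sq_mul_norm_sq hI hS (w := fun t x => curl (u t) x) hω0 hgc hderiv'
      hφcont hφc hφS ht
  -- ### the inequality at the time `t`: globalize the slice near `B̄(c, 6s)`
  have hut : ContDiffOn ℝ ∞ (u t) S := contDiffOn_slice_of_contDiffOn_prod hu ht
  obtain ⟨V, hV, N, hNo, hKN, hNS, hVu⟩ :=
    ContDiffOn.exists_contDiff_eqOn_nhds_of_isCompact hut hS (isCompact_closedBall c (6 * s)) h6S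
  have hV3 : ContDiff ℝ 3 V := contDiff_infty.1 hV 3
  have hV2 : ContDiff ℝ 2 V := hV3.of_le (by norm_num)
  -- transfer of values and derivatives on the open set `N ⊇ B̄(c, 6s)`
  have hVeq : ∀ x ∈ N, V x = u t x := fun x hx => hVu hx
  have hVev : ∀ x ∈ N, V =ᶠ[𝓝 x] u t := fun x hx =>
    eventuallyEq_of_mem (hNo.mem_nhds hx) hVu
  have hDVeq : ∀ x ∈ N, fderiv ℝ V x = fderiv ℝ (u t) x := fun x hx => (hVev x hx).fderiv_eq
  have hcurl : ∀ x ∈ N, curl V x = curl (u t) x := fun x hx => by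
    rw [curl_eq_curlCLM, curl_eq_curlCLM, hDVeq x hx]
  have hcurl_ev : ∀ x ∈ N, curl V =ᶠ[𝓝 x] curl (u t) := fun x hx => by
    filter_upwards [hNo.mem_nhds hx] with y hy using hcurl y hy
  have hDcurl : ∀ x ∈ N, fderiv ℝ (curl V) x = fderiv ℝ (curl (u t)) x := fun x hx =>
    (hcurl_ev x hx).fderiv_eq
  have hΔ : ∀ x ∈ N, Δ (curl V) x = Δ (curl (u t)) x := fun x hx =>
    (laplacian_congr_nhds (hcurl_ev x hx)).eq_of_nhds
  have hdir_eq : ∀ x ∈ N, vorticityDirection (curl V) x = vorticityDirection (curl (u t)) x :=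
    fun x hx => by simp only [vorticityDirection, hcurl x hx]
  -- the hypotheses of the slice inequality for `V`
  have hballN : ball c (6 * s) ⊆ N := hsub2.trans hKN
  have hdivV : ∀ y ∈ ball c (6 * s), VectorCalculus.divergence V y = 0 := fun y hy => by
    have e : VectorCalculus.divergence V y = VectorCalculus.divergence (u t) y := by
      simp only [VectorCalculus.divergence, hDVeq y (hballN hy)]
    rw [e]; exact hdiv t ht y (h6S (hsub2 hy))
  have hdirV : ∀ x ∈ ball c (6 * s), ∀ y ∈ ball c (6 * s), Mh < ‖curl V x‖ → Mh < ‖curl V y‖ →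
      Real.sqrt (1 - ⟪vorticityDirection (curl V) x, vorticityDirection (curl V) y⟫ ^ 2) ≤
        Kh * ‖x - y‖ ^ α := by
    intro x hx y hy hMx hMy
    rw [hdir_eq x (hballN hx), hdir_eq y (hballN hy)]
    rw [hcurl x (hballN hx)] at hMx
    rw [hcurl y (hballN hy)] at hMy
    exact hdir t ht x hx y hy hMx hMy
  have hstretch0 := hF2 hV2 hdivV hdirV
  -- move the hybrid weight into the constant term
  have hstretch : 2 * ∫ x, (θc x ^ 2) ^ 2 * ⟪curl V x, fderiv ℝ V x (curl V x)⟫ ≤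
      ν / 2 * (∫ x, (θc x ^ 2) ^ 2 * frobeniusNormSq (fderiv ℝ (curl V) x)) +
        ((C₁ + C₅ * (∫ x in closedBall c (6 * s), ‖curl V x‖ ^ r) ^ (1 / (r * θ))) +
            C₂ * ((∫ x in closedBall c (6 * s), ‖curl V x‖ ^ 2) +
              (∫ x in closedBall c (6 * s), ‖fderiv ℝ V x‖ ^ 2)) +
          C₃ * (∫ x in closedBall c (6 * s), ‖V x‖ ^ 2)) * (∫ x, (θc x ^ 2) ^ 2 * ‖curl V x‖ ^ 2) +
        C₄ * ((∫ x in closedBall c (6 * s), ‖curl V x‖ ^ 2) +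
          (∫ x in closedBall c (6 * s), ‖fderiv ℝ V x‖ ^ 2)) :=
    hstretch0.trans (le_of_eq (by ring))
  have hslice := localEnstrophy_slice_le c hs hν hθ1 hθ01 hθs hBθ0 hBθ hV3 hdivV hstretch
  -- ### identify the `V`-quantities with the `u t`-quantities
  have eY : ∫ x in closedBall c (6 * s), ‖curl V x‖ ^ 2 = ∫ x in closedBall c (6 * s), ‖curl (u t) x‖ ^ 2 :=
    setIntegral_congr_fun measurableSet_closedBall fun x hx => by rw [hcurl x (hKN hx)]
  have eR : ∫ x in closedBall c (6 * s), ‖curl V x‖ ^ r = ∫ x in closedBall c (6 * s), ‖curl (u t) x‖ ^ r :=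
    setIntegral_congr_fun measurableSet_closedBall fun x hx => by rw [hcurl x (hKN hx)]
  have eF : ∫ x in closedBall c (6 * s), ‖fderiv ℝ V x‖ ^ 2 =
      ∫ x in closedBall c (6 * s), ‖fderiv ℝ (u t) x‖ ^ 2 :=
    setIntegral_congr_fun measurableSet_closedBall fun x hx => by rw [hDVeq x (hKN hx)]
  have eE : ∫ x in closedBall c (6 * s), ‖V x‖ ^ 2 = ∫ x in closedBall c (6 * s), ‖u t x‖ ^ 2 :=
    setIntegral_congr_fun measurableSet_closedBall fun x hx => by rw [hVeq x (hKN hx)]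
  have hN_of_φ : ∀ x, φ x ≠ 0 → x ∈ N := fun x hx => hKN (hsub2 (hsub1 (hφx x hx)))
  have eYφ : ∫ x, (θc x ^ 2) ^ 2 * ‖curl V x‖ ^ 2 = ∫ x, φ x ^ 2 * ‖curl (u t) x‖ ^ 2 := by
    refine integral_congr_ae (Eventually.of_forall fun x => ?_)
    show φ x ^ 2 * ‖curl V x‖ ^ 2 = φ x ^ 2 * ‖curl (u t) x‖ ^ 2
    by_cases hx : φ x = 0
    · rw [hx]; ring
    · rw [hcurl x (hN_of_φ x hx)]
  have eD : ∫ x, 2 * ((θc x ^ 2) ^ 2 * ⟪curl V x,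
      ν • Δ (curl V) x - convect V (curl V) x + convect (curl V) V x⟫) = D t := by
    refine integral_congr_ae (Eventually.of_forall fun x => ?_)
    show 2 * (φ x ^ 2 * ⟪curl V x, ν • Δ (curl V) x - convect V (curl V) x + convect (curl V) V x⟫) =
      2 * (φ x ^ 2 * ⟪curl (u t) x, g t x⟫)
    by_cases hx : φ x = 0
    · rw [hx]; ring
    · have hxN := hN_of_φ x hx
      rw [hg t x]
      simp only [convect, hcurl x hxN, hΔ x hxN, hDcurl x hxN, hDVeq x hxN, hVeq x hxN]
  rw [eY, eR, eF, eE, eYφ, eD] at hslice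
  -- ### the final comparison of coefficients
  set Y : ℝ := ∫ x in closedBall c (6 * s), ‖curl (u t) x‖ ^ 2 with hY
  set F : ℝ := ∫ x in closedBall c (6 * s), ‖fderiv ℝ (u t) x‖ ^ 2 with hF
  set E : ℝ := ∫ x in closedBall c (6 * s), ‖u t x‖ ^ 2 with hE
  set NP : ℝ := (∫ x in closedBall c (6 * s), ‖curl (u t) x‖ ^ r) ^ (1 / (r * θ)) with hNP
  set Yφ : ℝ := ∫ x, φ x ^ 2 * ‖curl (u t) x‖ ^ 2 with hYφ
  have hY0 : 0 ≤ Y := setIntegral_nonneg measurableSet_closedBall fun x _ => by positivity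
  have hF0 : 0 ≤ F := setIntegral_nonneg measurableSet_closedBall fun x _ => by positivity
  have hE0 : 0 ≤ E := setIntegral_nonneg measurableSet_closedBall fun x _ => by positivity
  have hYφ0 : 0 ≤ Yφ := integral_nonneg fun x => by positivity
  have h1 : ((C₁ + C₅ * NP) + C₂ * (Y + F) + C₃ * E) * Yφ ≤
      (C₁ + (C₂ + C₃) * (Y + F + E) + C₅ * NP) * Yφ := by
    apply mul_le_mul_of_nonneg_right _ hYφ0
    nlinarith [mul_nonneg hC₂ hE0, mul_nonneg hC₃ (add_nonneg hY0 hF0)]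
  linarith only [hslice, h1]

/-- **The local enstrophy balance under a local Hölder coherence compensated by a local Lebesgue
bound on the vorticity** (Grujić–Zhang 2006, proof of Thm. 1.1, pointwise-in-time form; the
projection of `IsLerayHopfOn.exists_weight_localEnstrophy_deriv_le_hybrid` forgetting the regularity
of `φ`): under the hypotheses of that theorem there are a weight `φ` with `0 ≤ φ ≤ 1`, `φ = 1` on
`B(c, s/2)`, a function `D` continuous on `I` and constants `A₀, A₁, A₂, B₀, B₁ ≥ 0` with the local
sizes `Y, F, E, ∫_{B̄(c,6s)}|ω|^r` continuous on `I`, `d/dt ∫φ²|ω(t)|² = D(t)` on `I` and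
`D(t) ≤ (A₀ + A₁(Y + F + E)(t) + A₂ (∫_{B̄(c,6s)}|ω(t)|^r)^{1/(rθ)}) ∫φ²|ω(t)|² + (B₀ + B₁E(t)²)(Y + F)(t)`.
[cite: GrujicZhang2006, Thm. 1.1 proof §2 (2.4)–(2.6), §3 (3.2)–(3.10) (pp. 558–563)] -/
theorem IsLerayHopfOn.exists_localEnstrophy_deriv_le_hybrid {T ν : ℝ} (hν : 0 < ν)
    {u₀ : (EuclideanSpace ℝ (Fin 3)) → (EuclideanSpace ℝ (Fin 3))}
    {u : ℝ → (EuclideanSpace ℝ (Fin 3)) → (EuclideanSpace ℝ (Fin 3))}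
    (hLH : IsLerayHopfOn T ν 0 u₀ u) {I : Set ℝ} {S : Set (EuclideanSpace ℝ (Fin 3))}
    (hI : IsOpen I) (hS : IsOpen S) (hIT : I ⊆ Ioo 0 T)
    (hu : ContDiffOn ℝ ∞ (uncurry u) (I ×ˢ S))
    (c : (EuclideanSpace ℝ (Fin 3))) {s : ℝ} (hs : 0 < s) (hcS : closedBall c (12 * s) ⊆ S)
    {α r θ : ℝ} (hα : 0 < α) (hr : 1 < r) (hαr : α * r < 3) (hup : 1 / r < (2 + α) / 3)
    (hθ : θ = 1 + α / 2 - 3 / 2 * (1 / r))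
    {Kh Mh : ℝ} (hMh : 0 < Mh)
    (hdir : ∀ t ∈ I, ∀ x ∈ ball c (6 * s), ∀ y ∈ ball c (6 * s),
      Mh < ‖curl (u t) x‖ → Mh < ‖curl (u t) y‖ →
        Real.sqrt (1 - ⟪vorticityDirection (curl (u t)) x, vorticityDirection (curl (u t)) y⟫ ^ 2) ≤
          Kh * ‖x - y‖ ^ α) :
    ∃ (φ : (EuclideanSpace ℝ (Fin 3)) → ℝ) (D : ℝ → ℝ) (A₀ A₁ A₂ B₀ B₁ : ℝ),
      (∀ x ∈ ball c (s / 2), φ x = 1) ∧ (∀ x, 0 ≤ φ x ∧ φ x ≤ 1) ∧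
      0 ≤ A₀ ∧ 0 ≤ A₁ ∧ 0 ≤ A₂ ∧ 0 ≤ B₀ ∧ 0 ≤ B₁ ∧
      ContinuousOn (fun t => ∫ x in closedBall c (6 * s), ‖curl (u t) x‖ ^ 2) I ∧
      ContinuousOn (fun t => ∫ x in closedBall c (6 * s), ‖fderiv ℝ (u t) x‖ ^ 2) I ∧
      ContinuousOn (fun t => ∫ x in closedBall c (6 * s), ‖u t x‖ ^ 2) I ∧
      ContinuousOn (fun t => ∫ x in closedBall c (6 * s), ‖curl (u t) x‖ ^ r) I ∧
      ContinuousOn D I ∧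
      (∀ t ∈ I, HasDerivAt (fun t' => ∫ x, φ x ^ 2 * ‖curl (u t') x‖ ^ 2) (D t) t) ∧
      ∀ t ∈ I, D t ≤
        (A₀ + A₁ * ((∫ x in closedBall c (6 * s), ‖curl (u t) x‖ ^ 2) +
            (∫ x in closedBall c (6 * s), ‖fderiv ℝ (u t) x‖ ^ 2) +
            (∫ x in closedBall c (6 * s), ‖u t x‖ ^ 2)) +
          A₂ * (∫ x in closedBall c (6 * s), ‖curl (u t) x‖ ^ r) ^ (1 / (r * θ))) *
          (∫ x, φ x ^ 2 * ‖curl (u t) x‖ ^ 2) +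
        (B₀ + B₁ * (∫ x in closedBall c (6 * s), ‖u t x‖ ^ 2) ^ 2) *
          ((∫ x in closedBall c (6 * s), ‖curl (u t) x‖ ^ 2) +
            (∫ x in closedBall c (6 * s), ‖fderiv ℝ (u t) x‖ ^ 2)) := by
  obtain ⟨φ, D, A₀, A₁, A₂, B₀, B₁, h1, h01, hA₀, hA₁, hA₂, hB₀, hB₁, -, -, hY, hF, hE, hR, hD,
    hder, hle⟩ :=
    hLH.exists_weight_localEnstrophy_deriv_le_hybrid hν hI hS hIT hu c hs hcS hα hr hαr hup hθ hMh hdir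
  exact ⟨φ, D, A₀, A₁, A₂, B₀, B₁, h1, h01, hA₀, hA₁, hA₂, hB₀, hB₁, hY, hF, hE, hR, hD, hder, hle⟩


/-! ### The local enstrophy balance under a weak-`L^{6/5}` kernel for the triple product of the
vorticity directions (Grujić–Zhang 2006, Thm. 1.2) -/

/-- **The local enstrophy balance of a Leray–Hopf solution on a cylinder of smoothness under a
weak-`L^{6/5}` kernel dominating the triple product of the vorticity directions, with the weight's
regularity recorded** (Grujić–Zhang 2006, Thm. 1.2 and its proof p. 563, in the pointwise-in-time
frame of Grujić 2009, §4–§5). Let `u` be a Leray–Hopf weak solution (viscosity `ν > 0`, no force)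
on `[0, T)`, jointly `C^∞` on `I × S` (`I ⊆ (0,T)`, `S` open), let `B̄(c, 12s) ⊆ S`, let
`k : ℝ³ → [0, ∞]` be measurable with `l^{6/5}|{k > l}| ≤ Λ` (`l > 0`), and suppose that for every
`t ∈ I` and all `x, y ∈ B(c, 6s)` with `|ω(x,t)|, |ω(y,t)| > M_h` one has
`|⟪x − y, ξ(y,t) × ξ(x,t)⟫| / |x − y|⁴ ≤ k(x − y)` (`ξ = ω/|ω|`). Then there are a continuous weight
`φ` with `0 ≤ φ ≤ 1`, `φ = 1` on `B(c, s/2)` and `tsupport φ ⊆ B̄(c, s)`, a function `D` continuous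
on `I`, and constants `A₀, A₁, B₀, B₁ ≥ 0` such that: the local sizes `Y, F, E` are continuous on
`I`; for every `t ∈ I`, `t ↦ ∫φ²|ω(t)|²` has derivative `D(t)` at `t`; and
`D(t) ≤ (A₀ + A₁(Y + F + E)(t)) ∫φ²|ω(t)|² + (B₀ + B₁E(t)²)(Y + F)(t)`. Proof: as
`IsLerayHopfOn.exists_weight_localEnstrophy_deriv_le` with the stretching estimate
`exists_localized_stretching_le_of_kernel`. [cite: GrujicZhang2006, Thm. 1.2 (proof, p. 563) with §2 (2.4)–(2.6); Grujic2009, §4 p. 865 ((5), (6)) and Thm. 1 proof pp. 866–868] -/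
theorem IsLerayHopfOn.exists_weight_localEnstrophy_deriv_le_kernel {T ν : ℝ} (hν : 0 < ν)
    {u₀ : (EuclideanSpace ℝ (Fin 3)) → (EuclideanSpace ℝ (Fin 3))}
    {u : ℝ → (EuclideanSpace ℝ (Fin 3)) → (EuclideanSpace ℝ (Fin 3))}
    (hLH : IsLerayHopfOn T ν 0 u₀ u) {I : Set ℝ} {S : Set (EuclideanSpace ℝ (Fin 3))}
    (hI : IsOpen I) (hS : IsOpen S) (hIT : I ⊆ Ioo 0 T)
    (hu : ContDiffOn ℝ ∞ (uncurry u) (I ×ˢ S))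
    (c : (EuclideanSpace ℝ (Fin 3))) {s : ℝ} (hs : 0 < s) (hcS : closedBall c (12 * s) ⊆ S)
    {k : (EuclideanSpace ℝ (Fin 3)) → ℝ≥0∞} (hk : Measurable k) {Λ : ℝ} (hΛ : 0 ≤ Λ)
    (hweak : ∀ l : ℝ, 0 < l →
      ENNReal.ofReal l ^ (6 / 5 : ℝ) * volume {z | ENNReal.ofReal l < k z} ≤ ENNReal.ofReal Λ)
    {Mh : ℝ} (hMh : 0 < Mh)
    (hdir : ∀ t ∈ I, ∀ x ∈ ball c (6 * s), ∀ y ∈ ball c (6 * s),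
      Mh < ‖curl (u t) x‖ → Mh < ‖curl (u t) y‖ →
        ENNReal.ofReal (|⟪x - y, cross (vorticityDirection (curl (u t)) y)
            (vorticityDirection (curl (u t)) x)⟫| / ‖x - y‖ ^ 4) ≤ k (x - y)) :
    ∃ (φ : (EuclideanSpace ℝ (Fin 3)) → ℝ) (D : ℝ → ℝ) (A₀ A₁ B₀ B₁ : ℝ),
      (∀ x ∈ ball c (s / 2), φ x = 1) ∧ (∀ x, 0 ≤ φ x ∧ φ x ≤ 1) ∧
      0 ≤ A₀ ∧ 0 ≤ A₁ ∧ 0 ≤ B₀ ∧ 0 ≤ B₁ ∧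
      Continuous φ ∧ tsupport φ ⊆ closedBall c s ∧
      ContinuousOn (fun t => ∫ x in closedBall c (6 * s), ‖curl (u t) x‖ ^ 2) I ∧
      ContinuousOn (fun t => ∫ x in closedBall c (6 * s), ‖fderiv ℝ (u t) x‖ ^ 2) I ∧
      ContinuousOn (fun t => ∫ x in closedBall c (6 * s), ‖u t x‖ ^ 2) I ∧
      ContinuousOn D I ∧
      (∀ t ∈ I, HasDerivAt (fun t' => ∫ x, φ x ^ 2 * ‖curl (u t') x‖ ^ 2) (D t) t) ∧
      ∀ t ∈ I, D t ≤
        (A₀ + A₁ * ((∫ x in closedBall c (6 * s), ‖curl (u t) x‖ ^ 2) +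
            (∫ x in closedBall c (6 * s), ‖fderiv ℝ (u t) x‖ ^ 2) +
            (∫ x in closedBall c (6 * s), ‖u t x‖ ^ 2))) * (∫ x, φ x ^ 2 * ‖curl (u t) x‖ ^ 2) +
        (B₀ + B₁ * (∫ x in closedBall c (6 * s), ‖u t x‖ ^ 2) ^ 2) *
          ((∫ x in closedBall c (6 * s), ‖curl (u t) x‖ ^ 2) +
            (∫ x in closedBall c (6 * s), ‖fderiv ℝ (u t) x‖ ^ 2)) := by
  set O : Set (ℝ × (EuclideanSpace ℝ (Fin 3))) := I ×ˢ S with hOdef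
  have hO : IsOpen O := hI.prod hS
  -- ### the classical vorticity equation and the joint continuity on `I × S`
  obtain ⟨hdiv, hU0, hDU, hω0, hDω, hΔω, hderiv⟩ := hLH.vorticity_classical_of_contDiffOn hI hS hIT hu
  -- the right-hand side `g`
  obtain ⟨g, hg⟩ : ∃ g : ℝ → (EuclideanSpace ℝ (Fin 3)) → (EuclideanSpace ℝ (Fin 3)), ∀ t x, g t x =
      ν • Δ (curl (u t)) x - convect (u t) (curl (u t)) x + convect (curl (u t)) (u t) x :=
    ⟨_, fun _ _ => rfl⟩
  have hgc : ContinuousOn (uncurry g) O := by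
    have e : uncurry g = fun w : ℝ × (EuclideanSpace ℝ (Fin 3)) => ν • Δ (curl (u w.1)) w.2 -
        fderiv ℝ (curl (u w.1)) w.2 (u w.1 w.2) + fderiv ℝ (u w.1) w.2 (curl (u w.1) w.2) := by
      funext w
      exact hg w.1 w.2
    rw [e]
    exact ((hΔω.const_smul ν).sub (hDω.clm_apply hU0)).add (hDU.clm_apply hω0)
  have hderiv' : ∀ t ∈ I, ∀ x ∈ S, HasDerivAt (fun s' => curl (u s') x) (g t x) t := by
    intro t ht x hx; rw [hg t x]; exact hderiv t ht x hx
  -- ### geometry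
  have h6S : closedBall c (6 * s) ⊆ S := (closedBall_subset_closedBall (by linarith)).trans hcS
  have hsub1 : closedBall c s ⊆ ball c (6 * s) := fun x hx => by
    rw [mem_closedBall] at hx; rw [mem_ball]; linarith
  have hsub2 : ball c (6 * s) ⊆ closedBall c (6 * s) := ball_subset_closedBall
  -- ### the weight `θ = ballCutoff c (s/4)`, `φ = θ²`
  have hs4 : 0 < s / 4 := by positivity
  set θ : (EuclideanSpace ℝ (Fin 3)) → ℝ := ballCutoff c (s / 4) with hθdef
  have hθ1 : ContDiff ℝ 1 θ := contDiff_ballCutoff c (s / 4)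
  have hθ01 : ∀ x, 0 ≤ θ x ∧ θ x ≤ 1 := fun x => ⟨ballCutoff_nonneg _ _ _, ballCutoff_le_one _ _ _⟩
  have hθone : ∀ x ∈ ball c (s / 2), θ x = 1 := fun x hx => by
    have hx' : x ∈ ball c (2 * (s / 4)) := by rw [show 2 * (s / 4) = s / 2 by ring]; exact hx
    exact (ballCutoff_eventuallyEq_one hs4 hx').eq_of_nhds
  have hθs : tsupport θ ⊆ closedBall c s := by
    refine closure_minimal (fun x hx => ?_) isClosed_closedBall
    by_contra h
    rw [mem_closedBall, dist_eq_norm, not_le] at h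
    exact hx (ballCutoff_eq_zero hs4 (by linarith))
  have hθc : HasCompactSupport θ :=
    (isCompact_closedBall c s).of_isClosed_subset (isClosed_tsupport θ) hθs
  obtain ⟨Bθ', hBθ'⟩ := (hθ1.continuous_fderiv one_ne_zero).bounded_above_of_compact_support
    (hθc.fderiv (𝕜 := ℝ))
  set Bθ : ℝ := max Bθ' 0 with hBθdef
  have hBθ0 : 0 ≤ Bθ := le_max_right _ _
  have hBθ : ∀ x, ‖fderiv ℝ θ x‖ ≤ Bθ := fun x => (hBθ' x).trans (le_max_left _ _)
  set φ : (EuclideanSpace ℝ (Fin 3)) → ℝ := fun x => θ x ^ 2 with hφdef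
  have hφ1 : ContDiff ℝ 1 φ := hθ1.pow 2
  have hφcont : Continuous φ := hφ1.continuous
  have hφ01 : ∀ x, 0 ≤ φ x ∧ φ x ≤ 1 := fun x => by
    have h0 := (hθ01 x).1; have h1 := (hθ01 x).2
    exact ⟨by positivity, by show θ x ^ 2 ≤ 1; nlinarith⟩
  have hφs : tsupport φ ⊆ closedBall c s := by
    refine (closure_mono fun x hx => ?_).trans hθs
    rw [mem_support] at hx ⊢
    intro h; apply hx; show θ x ^ 2 = 0; rw [h]; ring
  have hφc : HasCompactSupport φ :=
    (isCompact_closedBall c s).of_isClosed_subset (isClosed_tsupport φ) hφs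
  have hφS : tsupport φ ⊆ S := hφs.trans (hsub1.trans (hsub2.trans h6S))
  have hφx : ∀ x, φ x ≠ 0 → x ∈ closedBall c s := fun x hx => hφs (subset_tsupport _ (mem_support.2 hx))
  -- ### the constants of the stretching estimate
  obtain ⟨C₁, C₂, C₃, C₄, hC₁, hC₂, hC₃, hC₄, hF2⟩ :=
    exists_localized_stretching_le_of_kernel c hs (half_pos hν) hMh hk hΛ hweak hφ1 hφ01 hφs
  set K : ℝ := ((SNormLESNormFDerivOfEqConst (EuclideanSpace ℝ (Fin 3))
    (volume : Measure (EuclideanSpace ℝ (Fin 3))) 2 : ℝ≥0) : ℝ) + 1 with hK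
  have hK0 : 0 < K := by rw [hK]; positivity
  -- ### the derivative `D`
  set D : ℝ → ℝ := fun t => ∫ x, 2 * (φ x ^ 2 * ⟪curl (u t) x, g t x⟫) with hDdef
  refine ⟨φ, D, C₁, C₂ + C₃, 49 * ν * Bθ ^ 2 + C₄, 13824 * K ^ 6 * Bθ ^ 4 / ν ^ 3,
    fun x hx => by show θ x ^ 2 = 1; rw [hθone x hx]; ring, hφ01, hC₁, add_nonneg hC₂ hC₃,
    by positivity, by positivity, hφcont, hφs, ?_, ?_, ?_, ?_, fun t ht => ?_, fun t ht => ?_⟩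
  -- continuity of the local sizes
  · have h12 : closedBall c (2 * (6 * s)) ⊆ S := by rw [show 2 * (6 * s) = 12 * s by ring]; exact hcS
    have hc : ContinuousOn (uncurry fun t x => ‖curl (u t) x‖ ^ 2) O :=
      fun w hw => ((hω0 w hw).norm).pow 2
    exact continuousOn_setIntegral_closedBall hI hS hc (by positivity) h12
  · have h12 : closedBall c (2 * (6 * s)) ⊆ S := by rw [show 2 * (6 * s) = 12 * s by ring]; exact hcS
    have hc : ContinuousOn (uncurry fun t x => ‖fderiv ℝ (u t) x‖ ^ 2) O :=
      fun w hw => ((hDU w hw).norm).pow 2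
    exact continuousOn_setIntegral_closedBall hI hS hc (by positivity) h12
  · have h12 : closedBall c (2 * (6 * s)) ⊆ S := by rw [show 2 * (6 * s) = 12 * s by ring]; exact hcS
    have hc : ContinuousOn (uncurry fun t x => ‖u t x‖ ^ 2) O :=
      fun w hw => ((hU0 w hw).norm).pow 2
    exact continuousOn_setIntegral_closedBall hI hS hc (by positivity) h12
  -- continuity of `D`
  · have h := continuousOn_integral_sq_mul hI hS (H := fun t x => 2 * ⟪curl (u t) x, g t x⟫)
      (continuousOn_const.mul (hω0.inner hgc)) hφcont hφc hφS
    refine h.congr fun t _ => ?_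
    exact integral_congr_ae (Eventually.of_forall fun x => by
      show 2 * (φ x ^ 2 * ⟪curl (u t) x, g t x⟫) = φ x ^ 2 * (2 * ⟪curl (u t) x, g t x⟫); ring)
  -- the derivative
  · exact hasDerivAt_integral_sq_mul_norm_sq hI hS (w := fun t x => curl (u t) x) hω0 hgc hderiv'
      hφcont hφc hφS ht
  -- ### the inequality at the time `t`: globalize the slice near `B̄(c, 6s)`
  have hut : ContDiffOn ℝ ∞ (u t) S := contDiffOn_slice_of_contDiffOn_prod hu ht
  obtain ⟨V, hV, N, hNo, hKN, hNS, hVu⟩ :=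
    ContDiffOn.exists_contDiff_eqOn_nhds_of_isCompact hut hS (isCompact_closedBall c (6 * s)) h6S
  have hV3 : ContDiff ℝ 3 V := contDiff_infty.1 hV 3
  have hV2 : ContDiff ℝ 2 V := hV3.of_le (by norm_num)
  -- transfer of values and derivatives on the open set `N ⊇ B̄(c, 6s)`
  have hVeq : ∀ x ∈ N, V x = u t x := fun x hx => hVu hx
  have hVev : ∀ x ∈ N, V =ᶠ[𝓝 x] u t := fun x hx =>
    eventuallyEq_of_mem (hNo.mem_nhds hx) hVu
  have hDVeq : ∀ x ∈ N, fderiv ℝ V x = fderiv ℝ (u t) x := fun x hx => (hVev x hx).fderiv_eq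
  have hcurl : ∀ x ∈ N, curl V x = curl (u t) x := fun x hx => by
    rw [curl_eq_curlCLM, curl_eq_curlCLM, hDVeq x hx]
  have hcurl_ev : ∀ x ∈ N, curl V =ᶠ[𝓝 x] curl (u t) := fun x hx => by
    filter_upwards [hNo.mem_nhds hx] with y hy using hcurl y hy
  have hDcurl : ∀ x ∈ N, fderiv ℝ (curl V) x = fderiv ℝ (curl (u t)) x := fun x hx =>
    (hcurl_ev x hx).fderiv_eq
  have hΔ : ∀ x ∈ N, Δ (curl V) x = Δ (curl (u t)) x := fun x hx =>
    (laplacian_congr_nhds (hcurl_ev x hx)).eq_of_nhds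
  have hdir_eq : ∀ x ∈ N, vorticityDirection (curl V) x = vorticityDirection (curl (u t)) x :=
    fun x hx => by simp only [vorticityDirection, hcurl x hx]
  -- the hypotheses of the slice inequality for `V`
  have hballN : ball c (6 * s) ⊆ N := hsub2.trans hKN
  have hdivV : ∀ y ∈ ball c (6 * s), VectorCalculus.divergence V y = 0 := fun y hy => by
    have e : VectorCalculus.divergence V y = VectorCalculus.divergence (u t) y := by
      simp only [VectorCalculus.divergence, hDVeq y (hballN hy)]
    rw [e]; exact hdiv t ht y (h6S (hsub2 hy))
  have hdirV : ∀ x ∈ ball c (6 * s), ∀ y ∈ ball c (6 * s), Mh < ‖curl V x‖ → Mh < ‖curl V y‖ →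
      ENNReal.ofReal (|⟪x - y, cross (vorticityDirection (curl V) y) (vorticityDirection (curl V) x)⟫| /
          ‖x - y‖ ^ 4) ≤ k (x - y) := by
    intro x hx y hy hMx hMy
    rw [hdir_eq x (hballN hx), hdir_eq y (hballN hy)]
    rw [hcurl x (hballN hx)] at hMx
    rw [hcurl y (hballN hy)] at hMy
    exact hdir t ht x hx y hy hMx hMy
  have hstretch := hF2 hV2 hdivV hdirV
  have hslice := localEnstrophy_slice_le c hs hν hθ1 hθ01 hθs hBθ0 hBθ hV3 hdivV hstretch
  -- ### identify the `V`-quantities with the `u t`-quantities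
  have eY : ∫ x in closedBall c (6 * s), ‖curl V x‖ ^ 2 = ∫ x in closedBall c (6 * s), ‖curl (u t) x‖ ^ 2 :=
    setIntegral_congr_fun measurableSet_closedBall fun x hx => by rw [hcurl x (hKN hx)]
  have eF : ∫ x in closedBall c (6 * s), ‖fderiv ℝ V x‖ ^ 2 =
      ∫ x in closedBall c (6 * s), ‖fderiv ℝ (u t) x‖ ^ 2 :=
    setIntegral_congr_fun measurableSet_closedBall fun x hx => by rw [hDVeq x (hKN hx)]
  have eE : ∫ x in closedBall c (6 * s), ‖V x‖ ^ 2 = ∫ x in closedBall c (6 * s), ‖u t x‖ ^ 2 :=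
    setIntegral_congr_fun measurableSet_closedBall fun x hx => by rw [hVeq x (hKN hx)]
  have hN_of_φ : ∀ x, φ x ≠ 0 → x ∈ N := fun x hx => hKN (hsub2 (hsub1 (hφx x hx)))
  have eYφ : ∫ x, (θ x ^ 2) ^ 2 * ‖curl V x‖ ^ 2 = ∫ x, φ x ^ 2 * ‖curl (u t) x‖ ^ 2 := by
    refine integral_congr_ae (Eventually.of_forall fun x => ?_)
    show φ x ^ 2 * ‖curl V x‖ ^ 2 = φ x ^ 2 * ‖curl (u t) x‖ ^ 2
    by_cases hx : φ x = 0
    · rw [hx]; ring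
    · rw [hcurl x (hN_of_φ x hx)]
  have eD : ∫ x, 2 * ((θ x ^ 2) ^ 2 * ⟪curl V x,
      ν • Δ (curl V) x - convect V (curl V) x + convect (curl V) V x⟫) = D t := by
    refine integral_congr_ae (Eventually.of_forall fun x => ?_)
    show 2 * (φ x ^ 2 * ⟪curl V x, ν • Δ (curl V) x - convect V (curl V) x + convect (curl V) V x⟫) =
      2 * (φ x ^ 2 * ⟪curl (u t) x, g t x⟫)
    by_cases hx : φ x = 0
    · rw [hx]; ring
    · have hxN := hN_of_φ x hx
      rw [hg t x]
      simp only [convect, hcurl x hxN, hΔ x hxN, hDcurl x hxN, hDVeq x hxN, hVeq x hxN]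
  rw [eY, eF, eE, eYφ, eD] at hslice
  -- ### the final comparison of coefficients
  set Y : ℝ := ∫ x in closedBall c (6 * s), ‖curl (u t) x‖ ^ 2 with hY
  set F : ℝ := ∫ x in closedBall c (6 * s), ‖fderiv ℝ (u t) x‖ ^ 2 with hF
  set E : ℝ := ∫ x in closedBall c (6 * s), ‖u t x‖ ^ 2 with hE
  set Yφ : ℝ := ∫ x, φ x ^ 2 * ‖curl (u t) x‖ ^ 2 with hYφ
  have hY0 : 0 ≤ Y := setIntegral_nonneg measurableSet_closedBall fun x _ => by positivity
  have hF0 : 0 ≤ F := setIntegral_nonneg measurableSet_closedBall fun x _ => by positivity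
  have hE0 : 0 ≤ E := setIntegral_nonneg measurableSet_closedBall fun x _ => by positivity
  have hYφ0 : 0 ≤ Yφ := integral_nonneg fun x => by positivity
  have h1 : (C₁ + C₂ * (Y + F) + C₃ * E) * Yφ ≤ (C₁ + (C₂ + C₃) * (Y + F + E)) * Yφ := by
    apply mul_le_mul_of_nonneg_right _ hYφ0
    nlinarith [mul_nonneg hC₂ hE0, mul_nonneg hC₃ (add_nonneg hY0 hF0)]
  linarith only [hslice, h1]


/-! ### The local enstrophy balance under a local `L^q` bound on the vorticity alone
(Grujić–Guberović 2010, Thm. 1) -/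

/-- **The local enstrophy balance of a Leray–Hopf solution on a cylinder of smoothness, with the
Grönwall weight `‖ω(t)‖_{L^q(B̄(c,6s))}^{2q/(2q−3)}` and no direction hypothesis** (Grujić–Guberović
2010, Thm. 1 and its proof, in the pointwise-in-time frame of Grujić 2009 §4–§5; the weight's
regularity recorded). Let `u` be a Leray–Hopf weak solution (viscosity `ν > 0`, no force) on
`[0, T)`, jointly `C^∞` on `I × S` (`I ⊆ (0,T)`, `S` open), let `B̄(c, 12s) ⊆ S` and `q > 3/2`.
Then there are a continuous weight `φ` with `0 ≤ φ ≤ 1`, `φ = 1` on `B(c, s/2)` and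
`tsupport φ ⊆ B̄(c, s)`, a function `D` continuous on `I`, and constants `A₀, A₁, A₂, B₀, B₁ ≥ 0`
such that: the local sizes `Y, F, E` and `t ↦ ∫_{B̄(c,6s)}|ω(t)|^q` are continuous on `I`; for
every `t ∈ I`, `t ↦ ∫φ²|ω(t)|²` has derivative `D(t)` at `t`; and
`D(t) ≤ (A₀ + A₁(Y + F + E)(t) + A₂ (∫_{B̄(c,6s)}|ω(t)|^q)^{2/(2q−3)}) ∫φ²|ω(t)|² + (B₀ + B₁E(t)²)(Y + F)(t)`.
Proof: as `IsLerayHopfOn.exists_weight_localEnstrophy_deriv_le_hybrid` with the stretching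
estimate `exists_localized_stretching_le_of_vorticity_Lq`. [cite: GrujicGuberovic2010, Thm. 1 (p. 413) with its proof; Grujic2009, §4 p. 865 ((5), (6)) and Thm. 1 proof pp. 866–868] -/
theorem IsLerayHopfOn.exists_weight_localEnstrophy_deriv_le_vorticity_Lq {T ν : ℝ} (hν : 0 < ν)
    {u₀ : (EuclideanSpace ℝ (Fin 3)) → (EuclideanSpace ℝ (Fin 3))}
    {u : ℝ → (EuclideanSpace ℝ (Fin 3)) → (EuclideanSpace ℝ (Fin 3))}
    (hLH : IsLerayHopfOn T ν 0 u₀ u) {I : Set ℝ} {S : Set (EuclideanSpace ℝ (Fin 3))}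
    (hI : IsOpen I) (hS : IsOpen S) (hIT : I ⊆ Ioo 0 T)
    (hu : ContDiffOn ℝ ∞ (uncurry u) (I ×ˢ S))
    (c : (EuclideanSpace ℝ (Fin 3))) {s : ℝ} (hs : 0 < s) (hcS : closedBall c (12 * s) ⊆ S)
    {q : ℝ} (hq : 3 / 2 < q) :
    ∃ (φ : (EuclideanSpace ℝ (Fin 3)) → ℝ) (D : ℝ → ℝ) (A₀ A₁ A₂ B₀ B₁ : ℝ),
      (∀ x ∈ ball c (s / 2), φ x = 1) ∧ (∀ x, 0 ≤ φ x ∧ φ x ≤ 1) ∧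
      0 ≤ A₀ ∧ 0 ≤ A₁ ∧ 0 ≤ A₂ ∧ 0 ≤ B₀ ∧ 0 ≤ B₁ ∧
      Continuous φ ∧ tsupport φ ⊆ closedBall c s ∧
      ContinuousOn (fun t => ∫ x in closedBall c (6 * s), ‖curl (u t) x‖ ^ 2) I ∧
      ContinuousOn (fun t => ∫ x in closedBall c (6 * s), ‖fderiv ℝ (u t) x‖ ^ 2) I ∧
      ContinuousOn (fun t => ∫ x in closedBall c (6 * s), ‖u t x‖ ^ 2) I ∧
      ContinuousOn (fun t => ∫ x in closedBall c (6 * s), ‖curl (u t) x‖ ^ q) I ∧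
      ContinuousOn D I ∧
      (∀ t ∈ I, HasDerivAt (fun t' => ∫ x, φ x ^ 2 * ‖curl (u t') x‖ ^ 2) (D t) t) ∧
      ∀ t ∈ I, D t ≤
        (A₀ + A₁ * ((∫ x in closedBall c (6 * s), ‖curl (u t) x‖ ^ 2) +
            (∫ x in closedBall c (6 * s), ‖fderiv ℝ (u t) x‖ ^ 2) +
            (∫ x in closedBall c (6 * s), ‖u t x‖ ^ 2)) +
          A₂ * (∫ x in closedBall c (6 * s), ‖curl (u t) x‖ ^ q) ^ (2 / (2 * q - 3))) *
          (∫ x, φ x ^ 2 * ‖curl (u t) x‖ ^ 2) +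
        (B₀ + B₁ * (∫ x in closedBall c (6 * s), ‖u t x‖ ^ 2) ^ 2) *
          ((∫ x in closedBall c (6 * s), ‖curl (u t) x‖ ^ 2) +
            (∫ x in closedBall c (6 * s), ‖fderiv ℝ (u t) x‖ ^ 2)) := by
  set O : Set (ℝ × (EuclideanSpace ℝ (Fin 3))) := I ×ˢ S with hOdef
  have hO : IsOpen O := hI.prod hS
  have hr0 : 0 < q := by linarith
  -- ### the classical vorticity equation and the joint continuity on `I × S`
  obtain ⟨hdiv, hU0, hDU, hω0, hDω, hΔω, hderiv⟩ := hLH.vorticity_classical_of_contDiffOn hI hS hIT hu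
  -- the right-hand side `g`
  obtain ⟨g, hg⟩ : ∃ g : ℝ → (EuclideanSpace ℝ (Fin 3)) → (EuclideanSpace ℝ (Fin 3)), ∀ t x, g t x =
      ν • Δ (curl (u t)) x - convect (u t) (curl (u t)) x + convect (curl (u t)) (u t) x :=
    ⟨_, fun _ _ => rfl⟩
  have hgc : ContinuousOn (uncurry g) O := by
    have e : uncurry g = fun w : ℝ × (EuclideanSpace ℝ (Fin 3)) => ν • Δ (curl (u w.1)) w.2 -
        fderiv ℝ (curl (u w.1)) w.2 (u w.1 w.2) + fderiv ℝ (u w.1) w.2 (curl (u w.1) w.2) := by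
      funext w
      exact hg w.1 w.2
    rw [e]
    exact ((hΔω.const_smul ν).sub (hDω.clm_apply hU0)).add (hDU.clm_apply hω0)
  have hderiv' : ∀ t ∈ I, ∀ x ∈ S, HasDerivAt (fun s' => curl (u s') x) (g t x) t := by
    intro t ht x hx; rw [hg t x]; exact hderiv t ht x hx
  -- ### geometry
  have h6S : closedBall c (6 * s) ⊆ S := (closedBall_subset_closedBall (by linarith)).trans hcS
  have hsub1 : closedBall c s ⊆ ball c (6 * s) := fun x hx => by
    rw [mem_closedBall] at hx; rw [mem_ball]; linarith
  have hsub2 : ball c (6 * s) ⊆ closedBall c (6 * s) := ball_subset_closedBall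
  -- ### the weight `θ = ballCutoff c (s/4)`, `φ = θ²`
  have hs4 : 0 < s / 4 := by positivity
  set θc : (EuclideanSpace ℝ (Fin 3)) → ℝ := ballCutoff c (s / 4) with hθcdef
  have hθ1 : ContDiff ℝ 1 θc := contDiff_ballCutoff c (s / 4)
  have hθ01 : ∀ x, 0 ≤ θc x ∧ θc x ≤ 1 := fun x => ⟨ballCutoff_nonneg _ _ _, ballCutoff_le_one _ _ _⟩
  have hθone : ∀ x ∈ ball c (s / 2), θc x = 1 := fun x hx => by
    have hx' : x ∈ ball c (2 * (s / 4)) := by rw [show 2 * (s / 4) = s / 2 by ring]; exact hx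
    exact (ballCutoff_eventuallyEq_one hs4 hx').eq_of_nhds
  have hθs : tsupport θc ⊆ closedBall c s := by
    refine closure_minimal (fun x hx => ?_) isClosed_closedBall
    by_contra h
    rw [mem_closedBall, dist_eq_norm, not_le] at h
    exact hx (ballCutoff_eq_zero hs4 (by linarith))
  have hθc : HasCompactSupport θc :=
    (isCompact_closedBall c s).of_isClosed_subset (isClosed_tsupport θc) hθs
  obtain ⟨Bθ', hBθ'⟩ := (hθ1.continuous_fderiv one_ne_zero).bounded_above_of_compact_support
    (hθc.fderiv (𝕜 := ℝ))
  set Bθ : ℝ := max Bθ' 0 with hBθdef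
  have hBθ0 : 0 ≤ Bθ := le_max_right _ _
  have hBθ : ∀ x, ‖fderiv ℝ θc x‖ ≤ Bθ := fun x => (hBθ' x).trans (le_max_left _ _)
  set φ : (EuclideanSpace ℝ (Fin 3)) → ℝ := fun x => θc x ^ 2 with hφdef
  have hφ1 : ContDiff ℝ 1 φ := hθ1.pow 2
  have hφcont : Continuous φ := hφ1.continuous
  have hφ01 : ∀ x, 0 ≤ φ x ∧ φ x ≤ 1 := fun x => by
    have h0 := (hθ01 x).1; have h1 := (hθ01 x).2
    exact ⟨by positivity, by show θc x ^ 2 ≤ 1; nlinarith⟩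
  have hφs : tsupport φ ⊆ closedBall c s := by
    refine (closure_mono fun x hx => ?_).trans hθs
    rw [mem_support] at hx ⊢
    intro h; apply hx; show θc x ^ 2 = 0; rw [h]; ring
  have hφc : HasCompactSupport φ :=
    (isCompact_closedBall c s).of_isClosed_subset (isClosed_tsupport φ) hφs
  have hφS : tsupport φ ⊆ S := hφs.trans (hsub1.trans (hsub2.trans h6S))
  have hφx : ∀ x, φ x ≠ 0 → x ∈ closedBall c s := fun x hx => hφs (subset_tsupport _ (mem_support.2 hx))
  -- ### the constants of the hybrid stretching estimate
  obtain ⟨C₁, C₂, C₃, C₄, C₅, hC₁, hC₂, hC₃, hC₄, hC₅, hF2⟩ :=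
    exists_localized_stretching_le_of_vorticity_Lq c hs (half_pos hν) hq hφ1 hφ01 hφs
  set K : ℝ := ((SNormLESNormFDerivOfEqConst (EuclideanSpace ℝ (Fin 3))
    (volume : Measure (EuclideanSpace ℝ (Fin 3))) 2 : ℝ≥0) : ℝ) + 1 with hK
  have hK0 : 0 < K := by rw [hK]; positivity
  -- ### the derivative `D`
  set D : ℝ → ℝ := fun t => ∫ x, 2 * (φ x ^ 2 * ⟪curl (u t) x, g t x⟫) with hDdef
  refine ⟨φ, D, C₁, C₂ + C₃, C₅, 49 * ν * Bθ ^ 2 + C₄, 13824 * K ^ 6 * Bθ ^ 4 / ν ^ 3,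
    fun x hx => by show θc x ^ 2 = 1; rw [hθone x hx]; ring, hφ01, hC₁, add_nonneg hC₂ hC₃, hC₅,
    by positivity, by positivity, hφcont, hφs, ?_, ?_, ?_, ?_, ?_, fun t ht => ?_, fun t ht => ?_⟩
  -- continuity of the local sizes
  · have h12 : closedBall c (2 * (6 * s)) ⊆ S := by rw [show 2 * (6 * s) = 12 * s by ring]; exact hcS
    have hc : ContinuousOn (uncurry fun t x => ‖curl (u t) x‖ ^ 2) O :=
      fun w hw => ((hω0 w hw).norm).pow 2
    exact continuousOn_setIntegral_closedBall hI hS hc (by positivity) h12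
  · have h12 : closedBall c (2 * (6 * s)) ⊆ S := by rw [show 2 * (6 * s) = 12 * s by ring]; exact hcS
    have hc : ContinuousOn (uncurry fun t x => ‖fderiv ℝ (u t) x‖ ^ 2) O :=
      fun w hw => ((hDU w hw).norm).pow 2
    exact continuousOn_setIntegral_closedBall hI hS hc (by positivity) h12
  · have h12 : closedBall c (2 * (6 * s)) ⊆ S := by rw [show 2 * (6 * s) = 12 * s by ring]; exact hcS
    have hc : ContinuousOn (uncurry fun t x => ‖u t x‖ ^ 2) O :=
      fun w hw => ((hU0 w hw).norm).pow 2
    exact continuousOn_setIntegral_closedBall hI hS hc (by positivity) h12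
  · have h12 : closedBall c (2 * (6 * s)) ⊆ S := by rw [show 2 * (6 * s) = 12 * s by ring]; exact hcS
    have hc : ContinuousOn (uncurry fun t x => ‖curl (u t) x‖ ^ q) O :=
      hω0.norm.rpow_const fun w _ => Or.inr hr0.le
    exact continuousOn_setIntegral_closedBall hI hS hc (by positivity) h12
  -- continuity of `D`
  · have h := continuousOn_integral_sq_mul hI hS (H := fun t x => 2 * ⟪curl (u t) x, g t x⟫)
      (continuousOn_const.mul (hω0.inner hgc)) hφcont hφc hφS
    refine h.congr fun t _ => ?_
    exact integral_congr_ae (Eventually.of_forall fun x => by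
      show 2 * (φ x ^ 2 * ⟪curl (u t) x, g t x⟫) = φ x ^ 2 * (2 * ⟪curl (u t) x, g t x⟫); ring)
  -- the derivative
  · exact hasDerivAt_integral_sq_mul_norm_sq hI hS (w := fun t x => curl (u t) x) hω0 hgc hderiv'
      hφcont hφc hφS ht
  -- ### the inequality at the time `t`: globalize the slice near `B̄(c, 6s)`
  have hut : ContDiffOn ℝ ∞ (u t) S := contDiffOn_slice_of_contDiffOn_prod hu ht
  obtain ⟨V, hV, N, hNo, hKN, hNS, hVu⟩ :=
    ContDiffOn.exists_contDiff_eqOn_nhds_of_isCompact hut hS (isCompact_closedBall c (6 * s)) h6S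
  have hV3 : ContDiff ℝ 3 V := contDiff_infty.1 hV 3
  -- transfer of values and derivatives on the open set `N ⊇ B̄(c, 6s)`
  have hVeq : ∀ x ∈ N, V x = u t x := fun x hx => hVu hx
  have hVev : ∀ x ∈ N, V =ᶠ[𝓝 x] u t := fun x hx =>
    eventuallyEq_of_mem (hNo.mem_nhds hx) hVu
  have hDVeq : ∀ x ∈ N, fderiv ℝ V x = fderiv ℝ (u t) x := fun x hx => (hVev x hx).fderiv_eq
  have hcurl : ∀ x ∈ N, curl V x = curl (u t) x := fun x hx => by
    rw [curl_eq_curlCLM, curl_eq_curlCLM, hDVeq x hx]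
  have hcurl_ev : ∀ x ∈ N, curl V =ᶠ[𝓝 x] curl (u t) := fun x hx => by
    filter_upwards [hNo.mem_nhds hx] with y hy using hcurl y hy
  have hDcurl : ∀ x ∈ N, fderiv ℝ (curl V) x = fderiv ℝ (curl (u t)) x := fun x hx =>
    (hcurl_ev x hx).fderiv_eq
  have hΔ : ∀ x ∈ N, Δ (curl V) x = Δ (curl (u t)) x := fun x hx =>
    (laplacian_congr_nhds (hcurl_ev x hx)).eq_of_nhds
  -- the hypotheses of the slice inequality for `V`
  have hballN : ball c (6 * s) ⊆ N := hsub2.trans hKN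
  have hdivV : ∀ y ∈ ball c (6 * s), VectorCalculus.divergence V y = 0 := fun y hy => by
    have e : VectorCalculus.divergence V y = VectorCalculus.divergence (u t) y := by
      simp only [VectorCalculus.divergence, hDVeq y (hballN hy)]
    rw [e]; exact hdiv t ht y (h6S (hsub2 hy))
  have hstretch0 := hF2 hV hdivV
  -- move the hybrid weight into the constant term
  have hstretch : 2 * ∫ x, (θc x ^ 2) ^ 2 * ⟪curl V x, fderiv ℝ V x (curl V x)⟫ ≤
      ν / 2 * (∫ x, (θc x ^ 2) ^ 2 * frobeniusNormSq (fderiv ℝ (curl V) x)) +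
        ((C₁ + C₅ * (∫ x in closedBall c (6 * s), ‖curl V x‖ ^ q) ^ (2 / (2 * q - 3))) +
            C₂ * ((∫ x in closedBall c (6 * s), ‖curl V x‖ ^ 2) +
              (∫ x in closedBall c (6 * s), ‖fderiv ℝ V x‖ ^ 2)) +
          C₃ * (∫ x in closedBall c (6 * s), ‖V x‖ ^ 2)) * (∫ x, (θc x ^ 2) ^ 2 * ‖curl V x‖ ^ 2) +
        C₄ * ((∫ x in closedBall c (6 * s), ‖curl V x‖ ^ 2) +
          (∫ x in closedBall c (6 * s), ‖fderiv ℝ V x‖ ^ 2)) :=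
    hstretch0.trans (le_of_eq (by ring))
  have hslice := localEnstrophy_slice_le c hs hν hθ1 hθ01 hθs hBθ0 hBθ hV3 hdivV hstretch
  -- ### identify the `V`-quantities with the `u t`-quantities
  have eY : ∫ x in closedBall c (6 * s), ‖curl V x‖ ^ 2 = ∫ x in closedBall c (6 * s), ‖curl (u t) x‖ ^ 2 :=
    setIntegral_congr_fun measurableSet_closedBall fun x hx => by rw [hcurl x (hKN hx)]
  have eR : ∫ x in closedBall c (6 * s), ‖curl V x‖ ^ q = ∫ x in closedBall c (6 * s), ‖curl (u t) x‖ ^ q :=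
    setIntegral_congr_fun measurableSet_closedBall fun x hx => by rw [hcurl x (hKN hx)]
  have eF : ∫ x in closedBall c (6 * s), ‖fderiv ℝ V x‖ ^ 2 =
      ∫ x in closedBall c (6 * s), ‖fderiv ℝ (u t) x‖ ^ 2 :=
    setIntegral_congr_fun measurableSet_closedBall fun x hx => by rw [hDVeq x (hKN hx)]
  have eE : ∫ x in closedBall c (6 * s), ‖V x‖ ^ 2 = ∫ x in closedBall c (6 * s), ‖u t x‖ ^ 2 :=
    setIntegral_congr_fun measurableSet_closedBall fun x hx => by rw [hVeq x (hKN hx)]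
  have hN_of_φ : ∀ x, φ x ≠ 0 → x ∈ N := fun x hx => hKN (hsub2 (hsub1 (hφx x hx)))
  have eYφ : ∫ x, (θc x ^ 2) ^ 2 * ‖curl V x‖ ^ 2 = ∫ x, φ x ^ 2 * ‖curl (u t) x‖ ^ 2 := by
    refine integral_congr_ae (Eventually.of_forall fun x => ?_)
    show φ x ^ 2 * ‖curl V x‖ ^ 2 = φ x ^ 2 * ‖curl (u t) x‖ ^ 2
    by_cases hx : φ x = 0
    · rw [hx]; ring
    · rw [hcurl x (hN_of_φ x hx)]
  have eD : ∫ x, 2 * ((θc x ^ 2) ^ 2 * ⟪curl V x,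
      ν • Δ (curl V) x - convect V (curl V) x + convect (curl V) V x⟫) = D t := by
    refine integral_congr_ae (Eventually.of_forall fun x => ?_)
    show 2 * (φ x ^ 2 * ⟪curl V x, ν • Δ (curl V) x - convect V (curl V) x + convect (curl V) V x⟫) =
      2 * (φ x ^ 2 * ⟪curl (u t) x, g t x⟫)
    by_cases hx : φ x = 0
    · rw [hx]; ring
    · have hxN := hN_of_φ x hx
      rw [hg t x]
      simp only [convect, hcurl x hxN, hΔ x hxN, hDcurl x hxN, hDVeq x hxN, hVeq x hxN]
  rw [eY, eR, eF, eE, eYφ, eD] at hslice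
  -- ### the final comparison of coefficients
  set Y : ℝ := ∫ x in closedBall c (6 * s), ‖curl (u t) x‖ ^ 2 with hY
  set F : ℝ := ∫ x in closedBall c (6 * s), ‖fderiv ℝ (u t) x‖ ^ 2 with hF
  set E : ℝ := ∫ x in closedBall c (6 * s), ‖u t x‖ ^ 2 with hE
  set NP : ℝ := (∫ x in closedBall c (6 * s), ‖curl (u t) x‖ ^ q) ^ (2 / (2 * q - 3)) with hNP
  set Yφ : ℝ := ∫ x, φ x ^ 2 * ‖curl (u t) x‖ ^ 2 with hYφ
  have hY0 : 0 ≤ Y := setIntegral_nonneg measurableSet_closedBall fun x _ => by positivity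
  have hF0 : 0 ≤ F := setIntegral_nonneg measurableSet_closedBall fun x _ => by positivity
  have hE0 : 0 ≤ E := setIntegral_nonneg measurableSet_closedBall fun x _ => by positivity
  have hYφ0 : 0 ≤ Yφ := integral_nonneg fun x => by positivity
  have h1 : ((C₁ + C₅ * NP) + C₂ * (Y + F) + C₃ * E) * Yφ ≤
      (C₁ + (C₂ + C₃) * (Y + F + E) + C₅ * NP) * Yφ := by
    apply mul_le_mul_of_nonneg_right _ hYφ0
    nlinarith [mul_nonneg hC₂ hE0, mul_nonneg hC₃ (add_nonneg hY0 hF0)]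
  linarith only [hslice, h1]

/-! ### The local enstrophy balance in Grujić–Guberović's coherence-weighted class (Grujić–Guberović
2010, Thm. 2) -/

set_option maxHeartbeats 800000 in
/-- **The local enstrophy balance of a Leray–Hopf solution on a cylinder of smoothness when the
coherence of the vorticity direction WEIGHTS the integrability of its magnitude** (Grujić–Guberović
2010, proof of Thm. 2, §4 pp. 415–417 with §2 (8)–(10) pp. 411–412; pointwise-in-time form). Same
frame as `IsLerayHopfOn.exists_weight_localEnstrophy_deriv_le_hybrid` (`u` Leray–Hopf, jointly `C^∞`
on `I × S`, `B̄(c, 12s) ⊆ S`, exponents `0 < α`, `1 < r`, `αr < 3`, `1/r < (2+α)/3`,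
`θ = 1 + α/2 − (3/2)(1/r)`), but the uniform Hölder constant of the coherence hypothesis is replaced
by a time-dependent WEIGHT `m(t, ·)` — for every `t ∈ I` measurable, nonnegative and bounded — on
the second point: `√(1 − ⟪ξ(x,t), ξ(y,t)⟫²) ≤ m(t,y)|x − y|^α` for `x, y ∈ B(c, 6s)` with
`|ω(x,t)|, |ω(y,t)| > M_h`. Conclusion: a weight `φ` (`0 ≤ φ ≤ 1`, `φ = 1` on `B(c, s/2)`,
`tsupport φ ⊆ B̄(c, s)`), the derivative `D` of `t ↦ ∫φ²|ω(t)|²` (continuous on `I`) and constants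
`A₀, A₁, A₂, B₀, B₁ ≥ 0` with
`D(t) ≤ (A₀ + A₁(Y + F + E)(t) + A₂ (∫_{B̄(c,6s)} (m(t)|ω(t)|)^r)^{1/(rθ)}) ∫φ²|ω(t)|² + (B₀ + B₁E(t)²)(Y + F)(t)`
for every `t ∈ I`. For Grujić–Guberović's `γ`-Hölder measure of coherence `ρ_{γ,2R}` (there
`(α, r) = (γ, α)`) the weight is `‖ρ_{γ,2R}(t) ω(t)‖_{L^α(B)}^{αδ}`, `δ = 2/((2+γ)α − 3)` — the
integrand of the class (5) whose finiteness is the hypothesis of Thm. 2; the stretching term from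
`exists_localized_stretching_le_of_holderWeight_Lr`, the viscous and transport terms as in
`IsLerayHopfOn.exists_weight_localEnstrophy_deriv_le` (module docstring for the deviations).
[cite: GrujicGuberovic2010, Thm. 2 (p. 415) with proof pp. 415–417 and §2 (8)–(10) (pp. 411–412); Grujic2009, §4 p. 865 ((5), (6))] -/
theorem IsLerayHopfOn.exists_weight_localEnstrophy_deriv_le_holderWeight {T ν : ℝ} (hν : 0 < ν)
    {u₀ : (EuclideanSpace ℝ (Fin 3)) → (EuclideanSpace ℝ (Fin 3))}
    {u : ℝ → (EuclideanSpace ℝ (Fin 3)) → (EuclideanSpace ℝ (Fin 3))}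
    (hLH : IsLerayHopfOn T ν 0 u₀ u) {I : Set ℝ} {S : Set (EuclideanSpace ℝ (Fin 3))}
    (hI : IsOpen I) (hS : IsOpen S) (hIT : I ⊆ Ioo 0 T)
    (hu : ContDiffOn ℝ ∞ (uncurry u) (I ×ˢ S))
    (c : (EuclideanSpace ℝ (Fin 3))) {s : ℝ} (hs : 0 < s) (hcS : closedBall c (12 * s) ⊆ S)
    {α r θ : ℝ} (hα : 0 < α) (hr : 1 < r) (hαr : α * r < 3) (hup : 1 / r < (2 + α) / 3)
    (hθ : θ = 1 + α / 2 - 3 / 2 * (1 / r))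
    {Mh : ℝ} (hMh : 0 < Mh)
    {m : ℝ → (EuclideanSpace ℝ (Fin 3)) → ℝ} (hmm : ∀ t ∈ I, Measurable (m t))
    (hm0 : ∀ t ∈ I, ∀ y, 0 ≤ m t y) (hmb : ∀ t ∈ I, ∃ Mb : ℝ, ∀ y, m t y ≤ Mb)
    (hdir : ∀ t ∈ I, ∀ x ∈ ball c (6 * s), ∀ y ∈ ball c (6 * s),
      Mh < ‖curl (u t) x‖ → Mh < ‖curl (u t) y‖ →
        Real.sqrt (1 - ⟪vorticityDirection (curl (u t)) x, vorticityDirection (curl (u t)) y⟫ ^ 2) ≤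
          m t y * ‖x - y‖ ^ α) :
    ∃ (φ : (EuclideanSpace ℝ (Fin 3)) → ℝ) (D : ℝ → ℝ) (A₀ A₁ A₂ B₀ B₁ : ℝ),
      (∀ x ∈ ball c (s / 2), φ x = 1) ∧ (∀ x, 0 ≤ φ x ∧ φ x ≤ 1) ∧
      0 ≤ A₀ ∧ 0 ≤ A₁ ∧ 0 ≤ A₂ ∧ 0 ≤ B₀ ∧ 0 ≤ B₁ ∧
      Continuous φ ∧ tsupport φ ⊆ closedBall c s ∧
      ContinuousOn (fun t => ∫ x in closedBall c (6 * s), ‖curl (u t) x‖ ^ 2) I ∧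
      ContinuousOn (fun t => ∫ x in closedBall c (6 * s), ‖fderiv ℝ (u t) x‖ ^ 2) I ∧
      ContinuousOn (fun t => ∫ x in closedBall c (6 * s), ‖u t x‖ ^ 2) I ∧
      ContinuousOn D I ∧
      (∀ t ∈ I, HasDerivAt (fun t' => ∫ x, φ x ^ 2 * ‖curl (u t') x‖ ^ 2) (D t) t) ∧
      ∀ t ∈ I, D t ≤
        (A₀ + A₁ * ((∫ x in closedBall c (6 * s), ‖curl (u t) x‖ ^ 2) +
            (∫ x in closedBall c (6 * s), ‖fderiv ℝ (u t) x‖ ^ 2) +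
            (∫ x in closedBall c (6 * s), ‖u t x‖ ^ 2)) +
          A₂ * (∫ x in closedBall c (6 * s), (m t x * ‖curl (u t) x‖) ^ r) ^ (1 / (r * θ))) *
          (∫ x, φ x ^ 2 * ‖curl (u t) x‖ ^ 2) +
        (B₀ + B₁ * (∫ x in closedBall c (6 * s), ‖u t x‖ ^ 2) ^ 2) *
          ((∫ x in closedBall c (6 * s), ‖curl (u t) x‖ ^ 2) +
            (∫ x in closedBall c (6 * s), ‖fderiv ℝ (u t) x‖ ^ 2)) := by
  set O : Set (ℝ × (EuclideanSpace ℝ (Fin 3))) := I ×ˢ S with hOdef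
  have hO : IsOpen O := hI.prod hS
  have hr0 : 0 < r := by linarith
  -- ### the classical vorticity equation and the joint continuity on `I × S`
  obtain ⟨hdiv, hU0, hDU, hω0, hDω, hΔω, hderiv⟩ := hLH.vorticity_classical_of_contDiffOn hI hS hIT hu
  -- the right-hand side `g`
  obtain ⟨g, hg⟩ : ∃ g : ℝ → (EuclideanSpace ℝ (Fin 3)) → (EuclideanSpace ℝ (Fin 3)), ∀ t x, g t x =
      ν • Δ (curl (u t)) x - convect (u t) (curl (u t)) x + convect (curl (u t)) (u t) x :=
    ⟨_, fun _ _ => rfl⟩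
  have hgc : ContinuousOn (uncurry g) O := by
    have e : uncurry g = fun w : ℝ × (EuclideanSpace ℝ (Fin 3)) => ν • Δ (curl (u w.1)) w.2 -
        fderiv ℝ (curl (u w.1)) w.2 (u w.1 w.2) + fderiv ℝ (u w.1) w.2 (curl (u w.1) w.2) := by
      funext w
      exact hg w.1 w.2
    rw [e]
    exact ((hΔω.const_smul ν).sub (hDω.clm_apply hU0)).add (hDU.clm_apply hω0)
  have hderiv' : ∀ t ∈ I, ∀ x ∈ S, HasDerivAt (fun s' => curl (u s') x) (g t x) t := by
    intro t ht x hx; rw [hg t x]; exact hderiv t ht x hx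
  -- ### geometry
  have h6S : closedBall c (6 * s) ⊆ S := (closedBall_subset_closedBall (by linarith)).trans hcS
  have hsub1 : closedBall c s ⊆ ball c (6 * s) := fun x hx => by
    rw [mem_closedBall] at hx; rw [mem_ball]; linarith
  have hsub2 : ball c (6 * s) ⊆ closedBall c (6 * s) := ball_subset_closedBall
  -- ### the weight `θ = ballCutoff c (s/4)`, `φ = θ²`
  have hs4 : 0 < s / 4 := by positivity
  set θc : (EuclideanSpace ℝ (Fin 3)) → ℝ := ballCutoff c (s / 4) with hθcdef
  have hθ1 : ContDiff ℝ 1 θc := contDiff_ballCutoff c (s / 4)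
  have hθ01 : ∀ x, 0 ≤ θc x ∧ θc x ≤ 1 := fun x => ⟨ballCutoff_nonneg _ _ _, ballCutoff_le_one _ _ _⟩
  have hθone : ∀ x ∈ ball c (s / 2), θc x = 1 := fun x hx => by
    have hx' : x ∈ ball c (2 * (s / 4)) := by rw [show 2 * (s / 4) = s / 2 by ring]; exact hx
    exact (ballCutoff_eventuallyEq_one hs4 hx').eq_of_nhds
  have hθs : tsupport θc ⊆ closedBall c s := by
    refine closure_minimal (fun x hx => ?_) isClosed_closedBall
    by_contra h
    rw [mem_closedBall, dist_eq_norm, not_le] at h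
    exact hx (ballCutoff_eq_zero hs4 (by linarith))
  have hθc : HasCompactSupport θc :=
    (isCompact_closedBall c s).of_isClosed_subset (isClosed_tsupport θc) hθs
  obtain ⟨Bθ', hBθ'⟩ := (hθ1.continuous_fderiv one_ne_zero).bounded_above_of_compact_support
    (hθc.fderiv (𝕜 := ℝ))
  set Bθ : ℝ := max Bθ' 0 with hBθdef
  have hBθ0 : 0 ≤ Bθ := le_max_right _ _
  have hBθ : ∀ x, ‖fderiv ℝ θc x‖ ≤ Bθ := fun x => (hBθ' x).trans (le_max_left _ _)
  set φ : (EuclideanSpace ℝ (Fin 3)) → ℝ := fun x => θc x ^ 2 with hφdef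
  have hφ1 : ContDiff ℝ 1 φ := hθ1.pow 2
  have hφcont : Continuous φ := hφ1.continuous
  have hφ01 : ∀ x, 0 ≤ φ x ∧ φ x ≤ 1 := fun x => by
    have h0 := (hθ01 x).1; have h1 := (hθ01 x).2
    exact ⟨by positivity, by show θc x ^ 2 ≤ 1; nlinarith⟩
  have hφs : tsupport φ ⊆ closedBall c s := by
    refine (closure_mono fun x hx => ?_).trans hθs
    rw [mem_support] at hx ⊢
    intro h; apply hx; show θc x ^ 2 = 0; rw [h]; ring
  have hφc : HasCompactSupport φ :=
    (isCompact_closedBall c s).of_isClosed_subset (isClosed_tsupport φ) hφs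
  have hφS : tsupport φ ⊆ S := hφs.trans (hsub1.trans (hsub2.trans h6S))
  have hφx : ∀ x, φ x ≠ 0 → x ∈ closedBall c s := fun x hx => hφs (subset_tsupport _ (mem_support.2 hx))
  -- ### the constants of the hybrid stretching estimate
  obtain ⟨C₁, C₂, C₃, C₄, C₅, hC₁, hC₂, hC₃, hC₄, hC₅, hF2⟩ :=
    exists_localized_stretching_le_of_holderWeight_Lr c hs (half_pos hν) hMh hα hr hαr hup
      hθ hφ1 hφ01 hφs
  set K : ℝ := ((SNormLESNormFDerivOfEqConst (EuclideanSpace ℝ (Fin 3))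
    (volume : Measure (EuclideanSpace ℝ (Fin 3))) 2 : ℝ≥0) : ℝ) + 1 with hK
  have hK0 : 0 < K := by rw [hK]; positivity
  -- ### the derivative `D`
  set D : ℝ → ℝ := fun t => ∫ x, 2 * (φ x ^ 2 * ⟪curl (u t) x, g t x⟫) with hDdef
  refine ⟨φ, D, C₁, C₂ + C₃, C₅, 49 * ν * Bθ ^ 2 + C₄, 13824 * K ^ 6 * Bθ ^ 4 / ν ^ 3,
    fun x hx => by show θc x ^ 2 = 1; rw [hθone x hx]; ring, hφ01, hC₁, add_nonneg hC₂ hC₃, hC₅,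
    by positivity, by positivity, hφcont, hφs, ?_, ?_, ?_, ?_, fun t ht => ?_, fun t ht => ?_⟩
  -- continuity of the local sizes
  · have h12 : closedBall c (2 * (6 * s)) ⊆ S := by rw [show 2 * (6 * s) = 12 * s by ring]; exact hcS
    have hc : ContinuousOn (uncurry fun t x => ‖curl (u t) x‖ ^ 2) O :=
      fun w hw => ((hω0 w hw).norm).pow 2
    exact continuousOn_setIntegral_closedBall hI hS hc (by positivity) h12
  · have h12 : closedBall c (2 * (6 * s)) ⊆ S := by rw [show 2 * (6 * s) = 12 * s by ring]; exact hcS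
    have hc : ContinuousOn (uncurry fun t x => ‖fderiv ℝ (u t) x‖ ^ 2) O :=
      fun w hw => ((hDU w hw).norm).pow 2
    exact continuousOn_setIntegral_closedBall hI hS hc (by positivity) h12
  · have h12 : closedBall c (2 * (6 * s)) ⊆ S := by rw [show 2 * (6 * s) = 12 * s by ring]; exact hcS
    have hc : ContinuousOn (uncurry fun t x => ‖u t x‖ ^ 2) O :=
      fun w hw => ((hU0 w hw).norm).pow 2
    exact continuousOn_setIntegral_closedBall hI hS hc (by positivity) h12
  -- continuity of `D`
  · have h := continuousOn_integral_sq_mul hI hS (H := fun t x => 2 * ⟪curl (u t) x, g t x⟫)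
      (continuousOn_const.mul (hω0.inner hgc)) hφcont hφc hφS
    refine h.congr fun t _ => ?_
    exact integral_congr_ae (Eventually.of_forall fun x => by
      show 2 * (φ x ^ 2 * ⟪curl (u t) x, g t x⟫) = φ x ^ 2 * (2 * ⟪curl (u t) x, g t x⟫); ring)
  -- the derivative
  · exact hasDerivAt_integral_sq_mul_norm_sq hI hS (w := fun t x => curl (u t) x) hω0 hgc hderiv'
      hφcont hφc hφS ht
  -- ### the inequality at the time `t`: globalize the slice near `B̄(c, 6s)`
  have hut : ContDiffOn ℝ ∞ (u t) S := contDiffOn_slice_of_contDiffOn_prod hu ht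
  obtain ⟨V, hV, N, hNo, hKN, hNS, hVu⟩ :=
    ContDiffOn.exists_contDiff_eqOn_nhds_of_isCompact hut hS (isCompact_closedBall c (6 * s)) h6S
  have hV3 : ContDiff ℝ 3 V := contDiff_infty.1 hV 3
  have hV2 : ContDiff ℝ 2 V := hV3.of_le (by norm_num)
  -- transfer of values and derivatives on the open set `N ⊇ B̄(c, 6s)`
  have hVeq : ∀ x ∈ N, V x = u t x := fun x hx => hVu hx
  have hVev : ∀ x ∈ N, V =ᶠ[𝓝 x] u t := fun x hx =>
    eventuallyEq_of_mem (hNo.mem_nhds hx) hVu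
  have hDVeq : ∀ x ∈ N, fderiv ℝ V x = fderiv ℝ (u t) x := fun x hx => (hVev x hx).fderiv_eq
  have hcurl : ∀ x ∈ N, curl V x = curl (u t) x := fun x hx => by
    rw [curl_eq_curlCLM, curl_eq_curlCLM, hDVeq x hx]
  have hcurl_ev : ∀ x ∈ N, curl V =ᶠ[𝓝 x] curl (u t) := fun x hx => by
    filter_upwards [hNo.mem_nhds hx] with y hy using hcurl y hy
  have hDcurl : ∀ x ∈ N, fderiv ℝ (curl V) x = fderiv ℝ (curl (u t)) x := fun x hx =>
    (hcurl_ev x hx).fderiv_eq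
  have hΔ : ∀ x ∈ N, Δ (curl V) x = Δ (curl (u t)) x := fun x hx =>
    (laplacian_congr_nhds (hcurl_ev x hx)).eq_of_nhds
  have hdir_eq : ∀ x ∈ N, vorticityDirection (curl V) x = vorticityDirection (curl (u t)) x :=
    fun x hx => by simp only [vorticityDirection, hcurl x hx]
  -- the hypotheses of the slice inequality for `V`
  have hballN : ball c (6 * s) ⊆ N := hsub2.trans hKN
  have hdivV : ∀ y ∈ ball c (6 * s), VectorCalculus.divergence V y = 0 := fun y hy => by
    have e : VectorCalculus.divergence V y = VectorCalculus.divergence (u t) y := by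
      simp only [VectorCalculus.divergence, hDVeq y (hballN hy)]
    rw [e]; exact hdiv t ht y (h6S (hsub2 hy))
  have hdirV : ∀ x ∈ ball c (6 * s), ∀ y ∈ ball c (6 * s), Mh < ‖curl V x‖ → Mh < ‖curl V y‖ →
      Real.sqrt (1 - ⟪vorticityDirection (curl V) x, vorticityDirection (curl V) y⟫ ^ 2) ≤
        m t y * ‖x - y‖ ^ α := by
    intro x hx y hy hMx hMy
    rw [hdir_eq x (hballN hx), hdir_eq y (hballN hy)]
    rw [hcurl x (hballN hx)] at hMx
    rw [hcurl y (hballN hy)] at hMy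
    exact hdir t ht x hx y hy hMx hMy
  obtain ⟨Mb, hMb⟩ := hmb t ht
  have hstretch0 := hF2 hV2 hdivV (hmm t ht) (hm0 t ht) hMb hdirV
  -- move the hybrid weight into the constant term
  have hstretch : 2 * ∫ x, (θc x ^ 2) ^ 2 * ⟪curl V x, fderiv ℝ V x (curl V x)⟫ ≤
      ν / 2 * (∫ x, (θc x ^ 2) ^ 2 * frobeniusNormSq (fderiv ℝ (curl V) x)) +
        ((C₁ + C₅ * (∫ x in closedBall c (6 * s), (m t x * ‖curl V x‖) ^ r) ^ (1 / (r * θ))) +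
            C₂ * ((∫ x in closedBall c (6 * s), ‖curl V x‖ ^ 2) +
              (∫ x in closedBall c (6 * s), ‖fderiv ℝ V x‖ ^ 2)) +
          C₃ * (∫ x in closedBall c (6 * s), ‖V x‖ ^ 2)) * (∫ x, (θc x ^ 2) ^ 2 * ‖curl V x‖ ^ 2) +
        C₄ * ((∫ x in closedBall c (6 * s), ‖curl V x‖ ^ 2) +
          (∫ x in closedBall c (6 * s), ‖fderiv ℝ V x‖ ^ 2)) :=
    hstretch0.trans (le_of_eq (by ring))
  have hslice := localEnstrophy_slice_le c hs hν hθ1 hθ01 hθs hBθ0 hBθ hV3 hdivV hstretch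
  -- ### identify the `V`-quantities with the `u t`-quantities
  have eY : ∫ x in closedBall c (6 * s), ‖curl V x‖ ^ 2 = ∫ x in closedBall c (6 * s), ‖curl (u t) x‖ ^ 2 :=
    setIntegral_congr_fun measurableSet_closedBall fun x hx => by rw [hcurl x (hKN hx)]
  have eR : ∫ x in closedBall c (6 * s), (m t x * ‖curl V x‖) ^ r =
      ∫ x in closedBall c (6 * s), (m t x * ‖curl (u t) x‖) ^ r :=
    setIntegral_congr_fun measurableSet_closedBall fun x hx => by rw [hcurl x (hKN hx)]
  have eF : ∫ x in closedBall c (6 * s), ‖fderiv ℝ V x‖ ^ 2 =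
      ∫ x in closedBall c (6 * s), ‖fderiv ℝ (u t) x‖ ^ 2 :=
    setIntegral_congr_fun measurableSet_closedBall fun x hx => by rw [hDVeq x (hKN hx)]
  have eE : ∫ x in closedBall c (6 * s), ‖V x‖ ^ 2 = ∫ x in closedBall c (6 * s), ‖u t x‖ ^ 2 :=
    setIntegral_congr_fun measurableSet_closedBall fun x hx => by rw [hVeq x (hKN hx)]
  have hN_of_φ : ∀ x, φ x ≠ 0 → x ∈ N := fun x hx => hKN (hsub2 (hsub1 (hφx x hx)))
  have eYφ : ∫ x, (θc x ^ 2) ^ 2 * ‖curl V x‖ ^ 2 = ∫ x, φ x ^ 2 * ‖curl (u t) x‖ ^ 2 := by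
    refine integral_congr_ae (Eventually.of_forall fun x => ?_)
    show φ x ^ 2 * ‖curl V x‖ ^ 2 = φ x ^ 2 * ‖curl (u t) x‖ ^ 2
    by_cases hx : φ x = 0
    · rw [hx]; ring
    · rw [hcurl x (hN_of_φ x hx)]
  have eD : ∫ x, 2 * ((θc x ^ 2) ^ 2 * ⟪curl V x,
      ν • Δ (curl V) x - convect V (curl V) x + convect (curl V) V x⟫) = D t := by
    refine integral_congr_ae (Eventually.of_forall fun x => ?_)
    show 2 * (φ x ^ 2 * ⟪curl V x, ν • Δ (curl V) x - convect V (curl V) x + convect (curl V) V x⟫) =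
      2 * (φ x ^ 2 * ⟪curl (u t) x, g t x⟫)
    by_cases hx : φ x = 0
    · rw [hx]; ring
    · have hxN := hN_of_φ x hx
      rw [hg t x]
      simp only [convect, hcurl x hxN, hΔ x hxN, hDcurl x hxN, hDVeq x hxN, hVeq x hxN]
  rw [eY, eR, eF, eE, eYφ, eD] at hslice
  -- ### the final comparison of coefficients
  set Y : ℝ := ∫ x in closedBall c (6 * s), ‖curl (u t) x‖ ^ 2 with hY
  set F : ℝ := ∫ x in closedBall c (6 * s), ‖fderiv ℝ (u t) x‖ ^ 2 with hF
  set E : ℝ := ∫ x in closedBall c (6 * s), ‖u t x‖ ^ 2 with hE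
  set NP : ℝ := (∫ x in closedBall c (6 * s), (m t x * ‖curl (u t) x‖) ^ r) ^ (1 / (r * θ)) with hNP
  set Yφ : ℝ := ∫ x, φ x ^ 2 * ‖curl (u t) x‖ ^ 2 with hYφ
  have hY0 : 0 ≤ Y := setIntegral_nonneg measurableSet_closedBall fun x _ => by positivity
  have hF0 : 0 ≤ F := setIntegral_nonneg measurableSet_closedBall fun x _ => by positivity
  have hE0 : 0 ≤ E := setIntegral_nonneg measurableSet_closedBall fun x _ => by positivity
  have hYφ0 : 0 ≤ Yφ := integral_nonneg fun x => by positivity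
  have h1 : ((C₁ + C₅ * NP) + C₂ * (Y + F) + C₃ * E) * Yφ ≤
      (C₁ + (C₂ + C₃) * (Y + F + E) + C₅ * NP) * Yφ := by
    apply mul_le_mul_of_nonneg_right _ hYφ0
    nlinarith [mul_nonneg hC₂ hE0, mul_nonneg hC₃ (add_nonneg hY0 hF0)]
  linarith only [hslice, h1]

end Literature.Analysis.FluidPDE

end
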